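import Literature.MathematicalPhysics.QuantumFieldTheory.Balaban1983to89.B3Op116SourceForm
import Literature.MathematicalPhysics.QuantumFieldTheory.Balaban1983to89.B3Op116ScaleChains
import Literature.MathematicalPhysics.QuantumFieldTheory.Balaban1983to89.B3Ineq210MixedRegularRegion
import Literature.MathematicalPhysics.QuantumFieldTheory.Balaban1983to89.B1Cor23DerivRegularRegion

/-!
# Bałaban, *(Higgs)₂,₃ quantum fields in a finite volume III. Renormalization* [B3] — the kernel of the operator (1.16) p. 414 at a
regular background ON THE TORUS `Ω = T_ε`: v1 = THE (2.10) DICTIONARY (columns and differentiated columns of `G_k(Ω,X)` as multi-scale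
majorants), the shifted majorants, the FIRST of the nine bond–bond chains of the value clause at `n = n′ = 1` (`M^*M ∘ M^*M`, PROVED,
uniform in `k`), the identification of the `D^*M` sources with the divergence `ε·D^{ε*}_B`; v1.1 (+§6, §7): the FIVE SHAPES of the
bond–bond chains with an ABSTRACT OUTER ROW of exponent `p` (so that FILE 4's derivative rows instantiate `p = 1`), and THE `L²` BOUND OF
THE NINTH CHAIN `‖D^ε_BG_k(T_ε,A+B)D^{ε*}_B‖ ≤ K` from the four pairings of [13] Cor. 2.3 (no logarithm of `k`); v1.2 (+§7 tail, §8): the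
ninth chain AS A PAIRING WITH SEPARATED SUPPORTS (decay `e^{−δr/L^k}`) and the BLOCK-AVERAGED COLUMN as a single top-scale bump (for the
averaging sources); **v1.3 (+§9–§19): THE UNIFORM BOUND `kernel116_one_one_unif_le`** — the print's «uniformly bounded» half of the
sentence of p. 414 for the VALUE of the kernel of (1.16) at `n = n′ = 1`, `Ω = T_ε`, `d ≤ 3`, PROVED uniformly in `k` from the (2.10)
bounds of `G_k(T,B)`, `G_k(T,A+B)` and the [13] Cor. 2.3 pairings (all sixteen source pairings of THEOREM A; the decay half is the next
append) — FILE 3(b) of the cell's programme for the analytic half of (1.16) (see «Honest scope»)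

statement-level skeleton of published theorems with citation tags; proofs where landed; nothing here is a claim about the Yang–Mills mass gap

T. Bałaban, Commun. Math. Phys. **88** (1983) 411–445 [cite: Balaban1983Higgs3]; part I, Commun. Math. Phys. **85** (1982) 603–636
[cite: Balaban1982Higgs1].  PDFs held: `paper:balaban1983-higgs-2-3-quantum-fields-finite-volume` (journal page = PDF page + 410;
p. 414 = `p0004.txt`, p. 426 = `p0016.txt`), `paper:balaban1982-cmp85-higgs23-i` (journal page = PDF page + 602).

CITATION HEADER (lean-in-tree rule).  Cell `lit-balaban` (HOME `run/shared/lean/pub/lit-balaban/`), reader/typer seat **r14** gen 19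
(unit `lit-balaban-r14`); TAKING line HOME/STATUS 2026-08-23T00:45:37Z (row owner r15: no objection 00:48:57Z); design
`lit-balaban-r14/DESIGN-B3-116-analytic.md` §4 (v2).  SKELETON row **B3.Eq1.16 (analytic half)** (fold owner r15); decl of record
`B3Sect2StatementsPart2.ScaledKernels.Ineq25At` (r15), clause (ii).  Programme files: FILE P `B3Op116Pieces` (p40 ✓), FILE E
`B3Op116ScaleChains` (r14 ✓, v1.2: `chain3_le`, `bond_chain3_le`), FILE 3(a) `B3Op116SourceForm` (r14 ✓: THEOREM A `opV_apply_eq_srcV`,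
the row toolkit), THIS FILE = FILE 3(b) (r14; v1 = seed), FILE 4 (p35: derivative/Hölder clauses), FILE 5 (p40: `norm116 ⇒ Ineq25At`).
USED BY NAME, never restated: r15's carrier predicate `B3Sect2StatementsPart2.ScaledKernels.Ineq210` on r14 g17/g18's region carrier
`B3Ineq210RegularRegion.regRegionKernels` (with `sum_pieceR`, `scaleR_eq`, `interior_univ`; its torus instance is PROVED for every `L ≥ 2`
by `B3Ineq210RegularRegion.ineq210_regularRegion_univ_small`), p40's `B3Op116Pieces.{mulM, covDeriv_add_split, norm_mulM_apply_le}` and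
dipole `B3Ineq210MixedRegularTorus.dip`, r14's `B3Op116ScaleChains.{bond_chain3_le, exp_tdist_shift_le', rate_eq}`, the typer's
`HiggsCovariancePos.{sum_site_dir, shift_unshift, unshift_shift, shiftEquiv}`; (v1.1) r14 g14's `B1Cor23DerivRegularRegion.{siteInner_adjCovDeriv,
pairing_DG_regular_region, pairing_GDt_regular_region, pairing_DGDt_regular_region}`, `B1Cor23RegularRegion.propagatorK_pairing_regular_region`,
`B1Ineq18RegularRegion.gammaReg_pos`, r14 g9's `B1Cor23DerivZeroFieldRegion.bondInner_comm`, `B1Ineq233LowerZeroFieldTorus.bondInner_self_nonneg`,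
Mathlib's `sq_sum_le_card_mul_sum_sq`; (v1.2) r14 g9's `B1Cor23ZeroFieldRegion.tdist_le_of_blockIter_eq_real`, r14's
`B3Op116ScaleChains.{sum_exp_scale_le, sum_site_le_sum_idx, sum_mesh_rpow_le}`, the typer's `HiggsAveraging.{blockK, mem_blockK}`; (v1.3)
p40's `B3Op116Pieces.{norm_fTwo_apply_le, norm_U_apply, sum_inside_norm_mulM_sq_le}`, r14's `B3Op116SourceForm.{norm_mapE_avgSrc_le,
map_srcV, norm_mapE_srcMD_le, norm_mapE_srcMM_le, covDerivAt, norm_propagatorK_srcV_apply_le, op116_one_one_apply}`,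
`B3Op116ScaleChains.sq_col_le`, `B1Eq353SupNorm.card_blockK`, `B1.{aSeq_pos, aSeq_le}`, `HiggsCovariancePos.siteInner_self_eq`,
`HiggsCovariance.avgQkLin_apply`, `HiggsAveraging.avgQk_apply`, Mathlib's `Real.sum_mul_le_sqrt_mul_sqrt`.

## What is printed

[B3] p. 414 [PDF 4] (verbatim): *"for n, n′ sufficiently large, a kernel of the operator (1.16) is a sufficiently regular function of
both variables. More exactly the Hölder norms of the covariant derivatives of this kernel, the norms defined for example in the
inequalities (I.2.24) and (I.2.25) of Proposition I.2.1, are exponentially decaying with the distance of the arguments and are uniformly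
bounded by O(1)(e(L^kε)^{1−α})^{n+n′}, where α > 0 but can be arbitrarily small. This estimate follows easily from the properties of the
propagators G_k(Ω, A) proved in the next paper."*  [B3] p. 426 [PDF 16] (verbatim): *"For the propagators G^η_{(j)} we apply the
inequality |G^η_{(j)}(Ω, B̃; x, x′)| ≤ O(1)(L^jη)^{−d+2}e^{−δ₁(L^jη)^{−1}|x−x′|}, (2.10) and if the propagator is differentiated, then for
each differentiation, there is an additional factor (L^jη)^{−1} on the right side."*

## What this file proves (v1), and how

§1 THE (2.10) DICTIONARY for any region carrier satisfying r15's `Ineq210 δ₁ C` (at interior points): the COLUMN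
`Σ_i‖(G_k(Ω,X)e_{(y,i)})(x)‖ ≤ Σ_{j<k} ε^dC(L^jε)^{2−d}e^{−δ₁(L^jε)^{−1}ε|x−y|}` (`col_le_of_ineq210`: (2.6) `G_k = Σ_jG_{(j)}` =
`sum_pieceR` + (2.10) per piece) and the DIFFERENTIATED COLUMN (exponent `1−d`, `dcol_le_of_ineq210`); `D^ε_B` through `D^ε_{A+B}`
(`norm_covDeriv_le_add_split`, p40's split `D_{A+B} = D_B + M`).  §2 a majorant read at a shifted point costs a factor `e`
(`majorant_shift_le`, rates `δ/L^j ≤ 1`).  §3 on the torus: `col`, `dcol` (the column-sum norms of record) with `col_le`, `dcol_le`,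
`dcol_le_add_split`.  §4 **`chain_MM_MM_le`**: the chain of the two undifferentiated sources of THEOREM A through `G_B`, `G_{A+B}`, `G_B`
(exponents `(2,2,2)`): `Σ_bΣ_{b′} κ_B(x,b₊)κ_{A+B}(b₊,b′₊)κ_B(b′₊,x′) ≤ d²e⁴(ε^dC)³·K(N,d,δ₁)·Π·(ε^d)^{−2}(L^kε)^{6−d}e^{−(δ₁/4)|x−x′|/L^k}`
UNIFORMLY IN `k` (`bond_chain3_le`) — the pattern of all nine bond–bond chains of the value clause (DESIGN §4.1: eight have exponent
sums `≥ 4 > d`; the ninth, `M^*D ∘ D^*M`, goes through `L²`).  §5 **`sum_dip_apply`** / `inv_smul_sum_dip_eq_adjCovDeriv`: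
`Σ_b dip_b(g(b)) = ε·D^{ε*}_Bg` with the explicit (I.1.5)-adjoint of `B1Cor23DerivRegularRegion` (`U(A)* = U(−A)`) — the `D^*M` sources of
`V_k(A,B)w` ARE the divergence `−D^{ε*}_B(b ↦ M_bw(b₊))`, the entry point of the [13] Cor. 2.3 pairings for the ninth chain.
§6 (v1.1) THE FIVE SHAPES with an abstract outer row `R ≥ 0` majorised with exponent `p` (`chainConst`, `bond_chain3_le'`):
**`chainT5_le`** `R ∘ κ_{A+B}(b₊,b′₊) ∘ κ_B(b′₊,x′)` `(p,2,2)`; **`chainT3_le`** `R ∘ κ_{A+B}(b₊,b′₊) ∘ κ^D_{B,B}(b′,x′)` `(p,2,1)`;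
**`chainT2_le`** `R ∘ κ^D_{B,A+B}(b,b′₊) ∘ κ_B` `(p,1,2) + |e|s·(p,2,2)`; **`chainT1_le`** `R ∘ κ^D_{B,A+B}(b,b′₊) ∘ κ^D_{B,B}` `(p,1,1) + |e|s·(p,2,1)`
(`p + 2 > d`: the value clause `p = 2` in `d ≤ 3`); **`chainT4_le`** `R ∘ κ^D_{B,A+B}(b′,b₊) ∘ κ_B` `(p,1,2) + |e|s·(p,2,2)` — the
`D_B`-columns of `G_{A+B}` split by `D_B = D_{A+B} − M` (`dcol_le_add_split`, `sum2_split_le`).  §7 (v1.1) **`sqrt_bondInner_DGDt_le`**: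
on `T_ε`, for `m² > 0`, `a > 0`, `1 ≤ k ≤ K`, `A + B` (I.2.23)-regular with `d²ε|e|L^{2k}δ_{A+B} ≤ 1/3`, `sup_b|A_b| ≤ s`, every bond field `g`:
`‖D^ε_BG_k(T_ε,A+B)D^{ε*}_Bg‖ ≤ (4 + 2(2/√γ₀)(L^kε)ρ + (2/γ₀)(L^kε)²ρ²)‖g‖`, `ρ = (d(|e|s)²)^{1/2}`, `γ₀ = min{2, a(1−L^{−2})/4}` — by
`D^{ε*}_B = D^{ε*}_{A+B} − m′` (`adjD_split`, `m′` = p40's `mulM` at `(−A,−B)` collected at bond heads, `siteInner_mP_self_le`) and the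
FOUR pairings at the regular field `A + B` with `r = 0`, `δ = 0`: `pairing_DGDt_regular_region` (4), `pairing_GDt_regular_region` and
`pairing_DG_regular_region` (2/√γ₀·L^kε each), `B1Cor23RegularRegion.propagatorK_pairing_regular_region` (2/γ₀·(L^kε)²); the bound is
UNIFORM IN `k` (no `log`), which the sup-norm bookkeeping of this chain cannot give (DESIGN §4.1).  (v1.2) `exists_of_mP_ne_zero`
(`supp m′h ⊂` heads of `supp h`) and **`abs_bondInner_DGDt_le`**: for `δ ≥ 0` with `(4d+4a)δ ≤ γ₀` and bond fields `h, g` at support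
separation `r` (the four distances `|b_∓ − b′_∓| ≥ r`): `|⟨h, D^ε_BG_k(T_ε,A+B)D^{ε*}_Bg⟩| ≤ [(4 + 2δ(8d/γ₀)^{1/2})e^δ +
2(2/√γ₀ + 4√dδ/γ₀)(L^kε)e^δρ + (2/γ₀)(L^kε)²ρ²]·e^{−δr/L^k}‖h‖‖g‖` — the decay of the ninth chain (near/far split of the assembly).
§8 (v1.2) **`sum_block_exp_le`** (a `k`-block sum of a scale-`j` profile, `j ≤ k ≤ K`: half the decay kept at the block scale —
`|z − y| ≤ L^k − 1` in a block, `B1Cor23ZeroFieldRegion.tdist_le_of_blockIter_eq_real` — the other half pays `N(8d/δ)^dL^{jd}`,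
`sum_exp_scale_le`), `blockavg_scale_algebra`, **`block_avg_col_le`**: `L^{−kd}Σ_{y∈B^k(z̄)}κ_X(y,x′) ≤
[e^{δ₁/2}N(8d/δ₁)^d/(L²−1)]·ε^dC·(L^kε)²((L^kε)^d)^{−1}·e^{−(δ₁/2)(L^kε)^{−1}ε|z−x′|}` — the block-averaged column (what `Q_k(B)`, `F_{2,k}`
of the averaging sources of THEOREM A see, p40's `norm_fTwo_apply_le`) is ONE top-scale bump of exponent `2` (`Σ_{j<k}(L^jε)² ≤ (L^kε)²/(L²−1)`).

## v1.3 (§9–§19): the UNIFORM BOUND of the `n = n′ = 1` kernel on the torus, assembled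

§9 `norm_avgQkLin_apply_le_block`, **`norm_mapE_avgSrc_le_block`** (`‖T(avgSrc w)‖ ≤ m(2+m)Σ_yκ_T(y)·L^{−kd}Σ_{x∈B^k(ȳ)}‖w(x)‖`,
`m = |e|sεd(L^k−1)`; p40's `norm_fTwo_apply_le`).  §10 conversions (`sum_site_le_sum_bond_src`, `majorant_mono`, `top_bump_le_majorant_succ`,
`block_avg_col_le_majorant`).  §11 `gM` (`g_w(b′) = M_{b′}w(b′₊)`), **`map_srcV_univ_eq`** (`T(V_kw) = −Σ_{b′}[T srcMD + T srcMM] −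
T(D^{ε*}_Bg_w) − a_k(L^kε)^{−2}T(avgSrc w)` — the `ε^{−1}`-dipoles resummed into the divergence), `norm_covDeriv_G_srcV_le`.
§12 **`ninth_term_le`**: `Σ_bκ_B(x,b₊)‖(D^ε_BG_k(T,A+B)D^{ε*}_Bg_{w₀})(b)‖ ≤ K_bad·|e|s·d·ε^{−d}·(ε^dC)²K_sq(L^kε)^{4−d}` — Cauchy–Schwarz over
the bonds, §7, p40's `sum_inside_norm_mulM_sq_le`, and the two `ℓ²`-columns `sum_sq_col_le` (r14's `sq_col_le` at rate `δ₁/2`; `d ≤ 3`).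
§13 the rows in the `κ` vocabulary (`row_col_majorant` `p = 2`, `row_dcol_majorant` `p = 1`, **`inner_value_row_le`**,
**`inner_deriv_row_le`**).  §14 `value_chains_eq`, `deriv_chains_eq` (outer row × inner row = the chain sums in the shapes T1–T5),
`outer_row_le`.  §15 row/column SUMS (`sum_site_majorant_le`: `Σ_yΣ_{j<k}c(L^jε)^{a−d}e_j ≤ c·ε^{−d}N(8d/δ₁)^d(L^kε)^a/(L^a−1)`; `sum_col_le`,
`sum_dcol_le`).  §16 block-sum exchange `sum_mul_sum_blockK_comm`, `sum_block_avg_eq` (`|B^k| = L^{kd}`, `B1Eq353SupNorm.card_blockK`),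
`block_avg_col_le_unif`, `block_row_le_unif`.  §17 `avg_inner_value_le_unif`, `avg_inner_deriv_le_unif`.  §18 named constants `rowK`,
`blkK`, `mK`, `chainB`; **`termII_le`** (outer row `R` of exponent `p` against `‖w₁(b₊)‖`: `|e|s·T3 + |e|s·T4 + (|e|s)²·T5 + averaging`),
`consts_nonneg`, **`termI_le`** (outer `MD` source against `‖D_Bw₁(b)‖`: `|e|s·T1 + (|e|s)²·T2 + NINTH + averaging`), `sum_norm_w1_le`
(total mass of `w₁`), **`termIV_le`** (outer averaging source: block-sum exchange + smeared row).  §19 `termIBound`, `termIIBound`,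
`termIVBound` and **`kernel116_one_one_unif_le`**:
`‖(G_k(T,B)V_kG_k(T,A+B)V_kG_k(T,B)e_{(x′,i′)})(x)‖ ≤ |e|s·B_I + |e|s·B_II(1, ε^dC, d·rowK₁) + (|e|s)²B_II(2, e·ε^dC, d·rowK₂) + a(L^kε)^{−2}B_IV`,
every constant displayed and free of `x, x′` except through decay factors `≤ 1`; each summand is `ε^d·t^m·(L^kε)^{2−d}·O_{d,L,N,a,δ₁,C}(1)`
with `t = L^kε|e|s`, `m ∈ {2,3,4}` (read off the exponents: `chainB` carries `(L^kε)^{p+a₂+a₃−d}`, `rowK_e` carries `(L^kε)^e`, `blkK` carries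
`ε^dC(L^kε)^{2−d}`, `mK ≤ d·t`, `a_k ≤ a` by `B1.aSeq_le`).

## Honest scope

v1.3 PROVES the uniform bound of the VALUE of the `n = n′ = 1` kernel on the torus (`kernel116_one_one_unif_le`) with explicit
constants; it does NOT yet (a) extract the exponential decay `e^{−δ′|x−x′|/L^k}` (the chain terms carry `e^{−(δ₁/4)|x−x′|/L^k}` already;
the ninth term and the averaging terms are bounded here WITHOUT decay — next append: near/far split with `abs_bondInner_DGDt_le` +
`sq_col_weighted_le`, and the smeared row as a top bump `block_avg_col_le_majorant` in `bond_chain3_le'`), (b) simplify the displayed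
bound to `C·ε^d·t²(L^kε)^{2−d}` under `t ≤ 1`, `L^kε ≤ 1` (cosmetic), (c) treat `n + n′ ≥ 3` / the derivative and Hölder clauses (p35,
FILE 4) or regions `Ω ⊊ T_ε` (boxes: MODEL INSTANCES via p35's R₀-free (2.10) files), (d) state r15's `Ineq25At` (p40, FILE 5).
Torus `Ω = T_ε` from §3 on; §1/§2/§5 hold for every region resp. every bond field.  The (2.10) input enters as the
HYPOTHESIS `Ineq210 δ₁ C` on r15's carrier (discharged on the torus by `ineq210_regularRegion_univ_small`, not re-proved here); `m² > 0`,
`a > 0`, `1 ≤ k ≤ K` where `sum_pieceR` needs them.  No `def … : Prop`, no new named fact (`col`, `dcol`, `chainConst`, `adjD`, `mP`, `gM`, `rowK`, `blkK`, `mK`, `chainB`, `termIBound`,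
`termIIBound`, `termIVBound` are concrete definitions);
axioms standard.  Value = located engine of a by-reference step of B3, NOT summit progress.
-/

noncomputable section

open scoped BigOperators InnerProductSpace

namespace Literature.MathematicalPhysics.QuantumFieldTheory.Balaban1983to89.B3Op116KernelRegularTorus

open HiggsLattice (ChargeData ScalarField siteInner covDeriv)
open HiggsCovariance (propagatorK E)
open B1Eq230FluctCov (Ix cb)
open B1Ineq234Concrete (nCol)
open B3Ineq210RegularRegion (regRegionKernels Interior sum_pieceR scaleR_eq interior_univ pieceR)
open B3Op116Pieces (mulM covDeriv_add_split norm_mulM_apply_le)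
open B3Op116ScaleChains (exp_tdist_shift_le' bond_chain3_le)
open HiggsCovariancePos (shift_unshift unshift_shift sum_site_dir)
open B3Ineq210MixedRegularTorus (dip)
open HiggsLattice (bondInner)
open HiggsAveraging (blockIter)
open HiggsFluctMeasurePos (siteInner_comm siteInner_sub_right)
open B1Cor23DerivZeroFieldRegion (bondInner_comm)
open B1Cor23DerivRegularRegion (siteInner_adjCovDeriv pairing_DG_regular_region pairing_GDt_regular_region
  pairing_DGDt_regular_region)
open B1Cor23RegularRegion (propagatorK_pairing_regular_region)
open B1Ineq18RegularRegion (gammaReg_pos)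
open HiggsCovariancePos (Inside shiftEquiv)

variable {P : HiggsLattice.Params} {N : ℕ}

/-! ## §1 The (2.10) dictionary: columns and differentiated columns of `G_k(Ω,X)` as multi-scale majorants -/

section Dictionary

variable {hL1 : 1 < P.L} (C : ChargeData N) (Ω : Finset (HiggsLattice.Site P 0)) (X : HiggsLattice.VecField P 0)
  {msq a : ℝ} {k K₀ : ℕ} {δ₁ Cst : ℝ}

/-- kernel: `(L^jη)^{−1}·(ε|x − x′|) = |x − x′|/L^j`. [folklore] -/
private theorem scale_inv_mul_dist (j : ℕ) (t : ℝ) :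
    (P.mesh j)⁻¹ * (P.mesh 0 * t) = t / (P.L : ℝ) ^ j := by
  rw [show P.mesh j = (P.L : ℝ) ^ j * P.mesh 0 by simp [HiggsLattice.Params.mesh], mul_inv, mul_assoc,
    ← mul_assoc (P.mesh 0)⁻¹, inv_mul_cancel₀ (P.mesh_pos 0).ne', one_mul, div_eq_inv_mul]

/-- **The column of `G_k(Ω,X)` at interior points as a (2.10) majorant with exponent `2`**:
`Σ_i‖(G_k(Ω,X)e_{(y,i)})(x)‖ ≤ Σ_{j<k} ε^dC·(L^jε)^{2−d}e^{−δ₁(L^jε)^{−1}ε|x−y|}` ((2.6) `G_k = Σ_j G_{(j)}` + (2.10) per piece).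
[cite: Balaban1983Higgs3, (2.6) p.424, (2.10) p.426] -/
theorem col_le_of_ineq210 (h210 : (regRegionKernels hL1 C Ω X msq a k K₀).Ineq210 δ₁ Cst) (hmsq : 0 < msq) (ha : 0 < a)
    (hk : 1 ≤ k) (hkK : k ≤ P.K) {x y : HiggsLattice.Site P 0} (hx : Interior k K₀ Ω x) (hy : Interior k K₀ Ω y) :
    ∑ i : Ix N, ‖propagatorK C Ω X msq a k (cb P N 0 (y, i)) x‖
      ≤ ∑ j ∈ Finset.range k, (P.mesh 0 ^ P.d * Cst) * P.mesh j ^ ((2 : ℝ) - (P.d : ℝ)) *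
          Real.exp (-(δ₁ * (P.mesh j)⁻¹ * (P.mesh 0 * (HiggsLattice.Site.tdist x y : ℝ)))) := by
  have hm : 0 < P.mesh 0 ^ P.d := pow_pos (P.mesh_pos 0) _
  rw [← sum_pieceR (C := C) (Ω := Ω) (A := X) (a := a) hmsq ha hL1 hk hkK]
  calc ∑ i : Ix N, ‖(∑ j ∈ Finset.range k, pieceR C Ω X msq a k j) (cb P N 0 (y, i)) x‖
      = ∑ i : Ix N, ‖∑ j ∈ Finset.range k, pieceR C Ω X msq a k j (cb P N 0 (y, i)) x‖ := by
        refine Finset.sum_congr rfl fun i _ => ?_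
        rw [LinearMap.sum_apply, Finset.sum_apply]
    _ ≤ ∑ i : Ix N, ∑ j ∈ Finset.range k, ‖pieceR C Ω X msq a k j (cb P N 0 (y, i)) x‖ :=
        Finset.sum_le_sum fun i _ => norm_sum_le _ _
    _ = ∑ j ∈ Finset.range k, ∑ i : Ix N, ‖pieceR C Ω X msq a k j (cb P N 0 (y, i)) x‖ := Finset.sum_comm
    _ ≤ _ := Finset.sum_le_sum fun j _ => ?_
  have h := (h210 j ⟨x, hx⟩ ⟨y, hy⟩).1
  have e1 : (regRegionKernels hL1 C Ω X msq a k K₀).absG j ⟨x, hx⟩ ⟨y, hy⟩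
      = (P.mesh 0 ^ P.d)⁻¹ * ∑ i' : Ix N, ‖pieceR C Ω X msq a k j (cb P N 0 (y, i')) x‖ := rfl
  have e3 : (regRegionKernels hL1 C Ω X msq a k K₀).dist ⟨x, hx⟩ ⟨y, hy⟩ = P.mesh 0 * (HiggsLattice.Site.tdist x y : ℝ) := rfl
  have e4 : (regRegionKernels hL1 C Ω X msq a k K₀).d = P.d := rfl
  rw [scaleR_eq, e1, e3, e4, inv_mul_le_iff₀ hm] at h
  calc ∑ i : Ix N, ‖pieceR C Ω X msq a k j (cb P N 0 (y, i)) x‖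
      ≤ P.mesh 0 ^ P.d * (Cst * P.mesh j ^ ((2 : ℝ) - (P.d : ℝ)) *
          Real.exp (-(δ₁ * (P.mesh j)⁻¹ * (P.mesh 0 * (HiggsLattice.Site.tdist x y : ℝ))))) := h
    _ = _ := by ring

/-- **The differentiated column of `G_k(Ω,X)`** (covariant derivative `D^ε_X` at an interior bond in the row variable) as a (2.10)
majorant with exponent `1`: `Σ_i‖(D^ε_XG_k(Ω,X)e_{(y,i)})(b)‖ ≤ Σ_{j<k} ε^dC·(L^jε)^{1−d}e^{−δ₁(L^jε)^{−1}ε|b₋−y|}`.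
[cite: Balaban1983Higgs3, (2.6) p.424, (2.10) p.426] -/
theorem dcol_le_of_ineq210 (h210 : (regRegionKernels hL1 C Ω X msq a k K₀).Ineq210 δ₁ Cst) (hmsq : 0 < msq) (ha : 0 < a)
    (hk : 1 ≤ k) (hkK : k ≤ P.K) {b : HiggsLattice.PBond P 0} {y : HiggsLattice.Site P 0} (hb : Interior k K₀ Ω b.src)
    (hy : Interior k K₀ Ω y) :
    ∑ i : Ix N, ‖covDeriv C X (propagatorK C Ω X msq a k (cb P N 0 (y, i))) b‖
      ≤ ∑ j ∈ Finset.range k, (P.mesh 0 ^ P.d * Cst) * P.mesh j ^ ((1 : ℝ) - (P.d : ℝ)) *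
          Real.exp (-(δ₁ * (P.mesh j)⁻¹ * (P.mesh 0 * (HiggsLattice.Site.tdist b.src y : ℝ)))) := by
  have hm : 0 < P.mesh 0 ^ P.d := pow_pos (P.mesh_pos 0) _
  rw [← sum_pieceR (C := C) (Ω := Ω) (A := X) (a := a) hmsq ha hL1 hk hkK]
  calc ∑ i : Ix N, ‖covDeriv C X ((∑ j ∈ Finset.range k, pieceR C Ω X msq a k j) (cb P N 0 (y, i))) b‖
      = ∑ i : Ix N, ‖∑ j ∈ Finset.range k, covDeriv C X (pieceR C Ω X msq a k j (cb P N 0 (y, i))) b‖ := by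
        refine Finset.sum_congr rfl fun i _ => ?_
        rw [LinearMap.sum_apply, B3Ineq210RegularTorus.covDeriv_sum'']
    _ ≤ ∑ i : Ix N, ∑ j ∈ Finset.range k, ‖covDeriv C X (pieceR C Ω X msq a k j (cb P N 0 (y, i))) b‖ :=
        Finset.sum_le_sum fun i _ => norm_sum_le _ _
    _ = ∑ j ∈ Finset.range k, ∑ i : Ix N, ‖covDeriv C X (pieceR C Ω X msq a k j (cb P N 0 (y, i))) b‖ := Finset.sum_comm
    _ ≤ _ := Finset.sum_le_sum fun j _ => ?_
  have h := (h210 j ⟨b.src, hb⟩ ⟨y, hy⟩).2 b.dir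
  have e2 : (regRegionKernels hL1 C Ω X msq a k K₀).absDG j b.dir ⟨b.src, hb⟩ ⟨y, hy⟩
      = (P.mesh 0 ^ P.d)⁻¹ * ∑ i' : Ix N, ‖covDeriv C X (pieceR C Ω X msq a k j (cb P N 0 (y, i'))) ⟨b.src, b.dir⟩‖ := rfl
  have e3 : (regRegionKernels hL1 C Ω X msq a k K₀).dist ⟨b.src, hb⟩ ⟨y, hy⟩
      = P.mesh 0 * (HiggsLattice.Site.tdist b.src y : ℝ) := rfl
  have e4 : (regRegionKernels hL1 C Ω X msq a k K₀).d = P.d := rfl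
  rw [scaleR_eq, e2, e3, e4, inv_mul_le_iff₀ hm] at h
  calc ∑ i : Ix N, ‖covDeriv C X (pieceR C Ω X msq a k j (cb P N 0 (y, i))) b‖
      ≤ P.mesh 0 ^ P.d * (Cst * P.mesh j ^ ((1 : ℝ) - (P.d : ℝ)) *
          Real.exp (-(δ₁ * (P.mesh j)⁻¹ * (P.mesh 0 * (HiggsLattice.Site.tdist b.src y : ℝ))))) := h
    _ = _ := by ring

variable (A B : HiggsLattice.VecField P 0)

/-- **`D^ε_B` of a column of an `(A+B)`-object through the split `D^ε_{A+B} = D^ε_B + M`**: `‖D^ε_Bf(b)‖ ≤ ‖D^ε_{A+B}f(b)‖ + |e|s‖f(b₊)‖`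
for `|A_b| ≤ s` (p40's `covDeriv_add_split`, `norm_mulM_apply_le`). [cite: Balaban1982Higgs1, (3.14) p.614] -/
theorem norm_covDeriv_le_add_split {s : ℝ} {b : HiggsLattice.PBond P 0} (hA : |A b| ≤ s) (f : ScalarField P 0 N) :
    ‖covDeriv C B f b‖ ≤ ‖covDeriv C (A + B) f b‖ + |C.e| * s * ‖f b.tgt‖ := by
  have h := covDeriv_add_split C A B f b
  have h' : covDeriv C B f b = covDeriv C (A + B) f b - mulM C A B b (f b.tgt) := by rw [h]; abel
  rw [h']
  exact (norm_sub_le _ _).trans (add_le_add le_rfl (norm_mulM_apply_le C A B hA _))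

end Dictionary

/-! ## §2 Majorants at shifted points -/

section Shift

/-- A (2.10) majorant read at a shifted point costs a factor `e` (`δ ≤ 1`: the rates `δ/L^j ≤ 1`, one lattice step).
[cite: Balaban1983Higgs3, (2.10) p.426] -/
theorem majorant_shift_le {k : ℕ} {δ c a : ℝ} (hδ : 0 < δ) (hδ1 : δ ≤ 1) (hc : 0 ≤ c) (x y : HiggsLattice.Site P 0) (μ : Fin P.d) :
    ∑ j ∈ Finset.range k, c * P.mesh j ^ a *
        Real.exp (-(δ * (P.mesh j)⁻¹ * (P.mesh 0 * (HiggsLattice.Site.tdist x (y.shift μ) : ℝ))))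
      ≤ ∑ j ∈ Finset.range k, (Real.exp 1 * c) * P.mesh j ^ a *
        Real.exp (-(δ * (P.mesh j)⁻¹ * (P.mesh 0 * (HiggsLattice.Site.tdist x y : ℝ)))) := by
  refine Finset.sum_le_sum fun j _ => ?_
  simp only [B3Op116ScaleChains.rate_eq]
  have hL1 : (1 : ℝ) ≤ (P.L : ℝ) ^ j := one_le_pow₀ (by exact_mod_cast P.hL)
  have hr0 : 0 ≤ δ / (P.L : ℝ) ^ j := by positivity
  have hr1 : δ / (P.L : ℝ) ^ j ≤ 1 := (div_le_self hδ.le hL1).trans hδ1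
  have hℓ : 0 ≤ c * P.mesh j ^ a := mul_nonneg hc (Real.rpow_nonneg (P.mesh_pos j).le a)
  calc c * P.mesh j ^ a * Real.exp (-(δ / (P.L : ℝ) ^ j * (HiggsLattice.Site.tdist x (y.shift μ) : ℝ)))
      ≤ c * P.mesh j ^ a * (Real.exp (δ / (P.L : ℝ) ^ j) *
          Real.exp (-(δ / (P.L : ℝ) ^ j * (HiggsLattice.Site.tdist x y : ℝ)))) :=
        mul_le_mul_of_nonneg_left (exp_tdist_shift_le' hr0 x y μ) hℓ
    _ ≤ c * P.mesh j ^ a * (Real.exp 1 * Real.exp (-(δ / (P.L : ℝ) ^ j * (HiggsLattice.Site.tdist x y : ℝ)))) :=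
        mul_le_mul_of_nonneg_left (mul_le_mul_of_nonneg_right (Real.exp_le_exp.mpr hr1) (Real.exp_nonneg _)) hℓ
    _ = _ := by ring

/-- The same with the shift in the first argument. [cite: Balaban1983Higgs3, (2.10) p.426] -/
theorem majorant_shift_le' {k : ℕ} {δ c a : ℝ} (hδ : 0 < δ) (hδ1 : δ ≤ 1) (hc : 0 ≤ c) (x y : HiggsLattice.Site P 0) (μ : Fin P.d) :
    ∑ j ∈ Finset.range k, c * P.mesh j ^ a *
        Real.exp (-(δ * (P.mesh j)⁻¹ * (P.mesh 0 * (HiggsLattice.Site.tdist (x.shift μ) y : ℝ))))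
      ≤ ∑ j ∈ Finset.range k, (Real.exp 1 * c) * P.mesh j ^ a *
        Real.exp (-(δ * (P.mesh j)⁻¹ * (P.mesh 0 * (HiggsLattice.Site.tdist x y : ℝ)))) := by
  simp only [B1Ineq234LevelZero.tdist_comm (x.shift μ) y, B1Ineq234LevelZero.tdist_comm x y]
  exact majorant_shift_le hδ hδ1 hc y x μ

end Shift

/-! ## §3 The columns and differentiated columns of `G_k(T_ε,X)` -/

section Columns

variable (C : ChargeData N) (msq a : ℝ) (k : ℕ)

/-- **The column of `G_k(T_ε,X)`** in the norm of record: `κ_X(x,y) = Σ_i‖(G_k(T_ε,X)e_{(y,i)})(x)‖` (= `ε^d·absG` summed over the pieces).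
[cite: Balaban1983Higgs3, (2.10) p.426] -/
def col (X : HiggsLattice.VecField P 0) (x y : HiggsLattice.Site P 0) : ℝ :=
  ∑ i : Ix N, ‖propagatorK C Finset.univ X msq a k (cb P N 0 (y, i)) x‖

variable {C msq a k}

/-- `κ_X ≥ 0`. [cite: Balaban1983Higgs3, (2.10) p.426] -/
theorem col_nonneg (X : HiggsLattice.VecField P 0) (x y : HiggsLattice.Site P 0) : 0 ≤ col C msq a k X x y :=
  Finset.sum_nonneg fun _ _ => norm_nonneg _

/-- The torus dictionary: `κ_X(x,y) ≤ Σ_{j<k} ε^dC(L^jε)^{2−d}e^{−δ₁(L^jε)^{−1}ε|x−y|}` from (2.10) for `G_k(T_ε,X)`.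
[cite: Balaban1983Higgs3, (2.6) p.424, (2.10) p.426] -/
theorem col_le {hL1 : 1 < P.L} {X : HiggsLattice.VecField P 0} {K₀ : ℕ} {δ₁ Cst : ℝ}
    (h210 : (regRegionKernels hL1 C Finset.univ X msq a k K₀).Ineq210 δ₁ Cst) (hmsq : 0 < msq) (ha : 0 < a)
    (hk : 1 ≤ k) (hkK : k ≤ P.K) (x y : HiggsLattice.Site P 0) :
    col C msq a k X x y ≤ ∑ j ∈ Finset.range k, (P.mesh 0 ^ P.d * Cst) * P.mesh j ^ ((2 : ℝ) - (P.d : ℝ)) *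
          Real.exp (-(δ₁ * (P.mesh j)⁻¹ * (P.mesh 0 * (HiggsLattice.Site.tdist x y : ℝ)))) :=
  col_le_of_ineq210 C Finset.univ X h210 hmsq ha hk hkK (interior_univ x) (interior_univ y)

end Columns

section DColumns

variable (C : ChargeData N) (msq a : ℝ) (k : ℕ)

/-- **The differentiated column of `G_k(T_ε,X)`**, derivative `D^ε_Y` at the bond `b` in the row variable:
`κ^D_{Y,X}(b,y) = Σ_i‖(D^ε_YG_k(T_ε,X)e_{(y,i)})(b)‖`. [cite: Balaban1983Higgs3, (2.10) p.426] -/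
def dcol (Y X : HiggsLattice.VecField P 0) (b : HiggsLattice.PBond P 0) (y : HiggsLattice.Site P 0) : ℝ :=
  ∑ i : Ix N, ‖covDeriv C Y (propagatorK C Finset.univ X msq a k (cb P N 0 (y, i))) b‖

variable {C msq a k}

/-- `κ^D_{Y,X} ≥ 0`. [cite: Balaban1983Higgs3, (2.10) p.426] -/
theorem dcol_nonneg (Y X : HiggsLattice.VecField P 0) (b : HiggsLattice.PBond P 0) (y : HiggsLattice.Site P 0) :
    0 ≤ dcol C msq a k Y X b y :=
  Finset.sum_nonneg fun _ _ => norm_nonneg _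

/-- The torus dictionary, differentiated column in the propagator's own field: `κ^D_{X,X}(b,y) ≤ Σ_{j<k} ε^dC(L^jε)^{1−d}e^{−δ₁(L^jε)^{−1}ε|b₋−y|}`.
[cite: Balaban1983Higgs3, (2.6) p.424, (2.10) p.426] -/
theorem dcol_le {hL1 : 1 < P.L} {X : HiggsLattice.VecField P 0} {K₀ : ℕ} {δ₁ Cst : ℝ}
    (h210 : (regRegionKernels hL1 C Finset.univ X msq a k K₀).Ineq210 δ₁ Cst) (hmsq : 0 < msq) (ha : 0 < a)
    (hk : 1 ≤ k) (hkK : k ≤ P.K) (b : HiggsLattice.PBond P 0) (y : HiggsLattice.Site P 0) :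
    dcol C msq a k X X b y ≤ ∑ j ∈ Finset.range k, (P.mesh 0 ^ P.d * Cst) * P.mesh j ^ ((1 : ℝ) - (P.d : ℝ)) *
          Real.exp (-(δ₁ * (P.mesh j)⁻¹ * (P.mesh 0 * (HiggsLattice.Site.tdist b.src y : ℝ)))) :=
  dcol_le_of_ineq210 C Finset.univ X h210 hmsq ha hk hkK (interior_univ b.src) (interior_univ y)

/-- **`D^ε_B` of the column of `G_k(T_ε,A+B)`** through the split: `κ^D_{B,A+B}(b,y) ≤ κ^D_{A+B,A+B}(b,y) + |e|s·κ_{A+B}(b₊,y)` —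
two majorants, exponents `1` and `2`. [cite: Balaban1982Higgs1, (3.14) p.614] [cite: Balaban1983Higgs3, (2.10) p.426] -/
theorem dcol_le_add_split (A B : HiggsLattice.VecField P 0) {s : ℝ} {b : HiggsLattice.PBond P 0} (hA : |A b| ≤ s)
    (y : HiggsLattice.Site P 0) :
    dcol C msq a k B (A + B) b y ≤ dcol C msq a k (A + B) (A + B) b y + |C.e| * s * col C msq a k (A + B) b.tgt y := by
  unfold dcol col
  rw [Finset.mul_sum, ← Finset.sum_add_distrib]
  exact Finset.sum_le_sum fun i _ => norm_covDeriv_le_add_split C A B hA _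

end DColumns

/-! ## §4 The chain `M^*M ∘ M^*M` (exponents (2,2,2)), uniform in `k` -/

section SampleChain

variable {C : ChargeData N} {A B : HiggsLattice.VecField P 0} {msq a : ℝ} {k K₀ : ℕ} {hL1 : 1 < P.L} {δ₁ Cst : ℝ}

/-- **The chain `M^*M ∘ M^*M` of the (1.16) kernel at `n = n′ = 1`** (both sources undifferentiated: exponents `(2,2,2)`):
`Σ_bΣ_{b′} κ_B(x,b₊)κ_{A+B}(b₊,b′₊)κ_B(b′₊,x′) ≤ d²e⁴(ε^dC)³K·Π·(ε^d)^{−2}(L^kε)^{6−d}e^{−(δ₁/4)|x−x′|/L^k}`. [cite: Balaban1983Higgs3, (1.16) p.414, (2.10) p.426] -/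
theorem chain_MM_MM_le (hδ₁ : 0 < δ₁) (hδ₁1 : δ₁ ≤ 1) (hCst : 0 ≤ Cst)
    (h210B : (regRegionKernels hL1 C Finset.univ B msq a k K₀).Ineq210 δ₁ Cst)
    (h210AB : (regRegionKernels hL1 C Finset.univ (A + B) msq a k K₀).Ineq210 δ₁ Cst)
    (hmsq : 0 < msq) (ha : 0 < a) (hk : 1 ≤ k) (hkK : k ≤ P.K) (hd : (P.d : ℝ) < 6) (i₀ : Ix N)
    (x x' : HiggsLattice.Site P 0) :
    ∑ b : HiggsLattice.PBond P 0, ∑ b' : HiggsLattice.PBond P 0,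
        col C msq a k B x b.tgt * col C msq a k (A + B) b.tgt b'.tgt * col C msq a k B b'.tgt x'
      ≤ (P.d : ℝ) ^ 2 * ((Real.exp 1 * (P.mesh 0 ^ P.d * Cst)) * (Real.exp 1 * (Real.exp 1 * (P.mesh 0 ^ P.d * Cst))) *
            (Real.exp 1 * (P.mesh 0 ^ P.d * Cst)) *
          (((nCol N : ℝ) * (8 * P.d / δ₁) ^ P.d) * ((nCol N : ℝ) * (16 * P.d / δ₁) ^ P.d)) *
          ((1 / ((P.L : ℝ) ^ ((2 : ℝ) * (1 - (P.d : ℝ) / (2 + 2 + 2))) - 1)) *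
            (1 / ((P.L : ℝ) ^ ((2 : ℝ) * (1 - (P.d : ℝ) / (2 + 2 + 2))) - 1)) *
            (1 / ((P.L : ℝ) ^ ((2 : ℝ) * (1 - (P.d : ℝ) / (2 + 2 + 2))) - 1))) *
          ((P.mesh 0 ^ P.d)⁻¹) ^ 2 * P.mesh k ^ ((2 : ℝ) + 2 + 2 - (P.d : ℝ)) *
          Real.exp (-(δ₁ / 4 * (P.mesh k)⁻¹ * (P.mesh 0 * (HiggsLattice.Site.tdist x x' : ℝ))))) := by
  have hc : 0 ≤ P.mesh 0 ^ P.d * Cst := mul_nonneg (pow_nonneg (P.mesh_pos 0).le _) hCst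
  have hc1 : 0 ≤ Real.exp 1 * (P.mesh 0 ^ P.d * Cst) := mul_nonneg (Real.exp_nonneg _) hc
  refine bond_chain3_le (k := k) hL1 hδ₁ hδ₁1 (by norm_num) (by norm_num) (by norm_num) (by linarith) hc1
    (mul_nonneg (Real.exp_nonneg _) hc1) hc1 i₀ x x' _ _ _ (fun b => col_nonneg _ _ _) (fun b b' => col_nonneg _ _ _)
    (fun b' => col_nonneg _ _ _) (fun b => ?_) (fun b b' => ?_) (fun b' => ?_)
  · exact (col_le h210B hmsq ha hk hkK x b.tgt).trans (majorant_shift_le hδ₁ hδ₁1 hc x b.src b.dir)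
  · refine (col_le h210AB hmsq ha hk hkK b.tgt b'.tgt).trans ?_
    exact (majorant_shift_le hδ₁ hδ₁1 hc _ b'.src b'.dir).trans (majorant_shift_le' hδ₁ hδ₁1 hc1 b.src b'.src b.dir)
  · exact (col_le h210B hmsq ha hk hkK b'.tgt x').trans (majorant_shift_le' hδ₁ hδ₁1 hc b'.src x' b'.dir)

end SampleChain

/-! ## §5 The `D^*M` sources are a divergence: `Σ_b dip_b(g(b)) = ε·D^{ε*}_Bg` -/

section AdjointSource

variable (C : ChargeData N) (B : HiggsLattice.VecField P 0)

/-- **The dipole sources of all bonds, summed, ARE `ε` times the explicit adjoint covariant derivative** of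
`B1Cor23DerivRegularRegion` (*"−Δ^ε_A = D^{ε*}_AD^ε_A"*, `U(A)* = U(−A)`): for every bond field `g`,
`Σ_b dip_b(g(b)) = ε·D^{ε*}_Bg`, i.e. `(Σ_b dip_b(g(b)))(x) = Σ_ν(U(B_{⟨x−εe_ν,x⟩})^*g(⟨x−εe_ν,x⟩) − g(⟨x,x+εe_ν⟩))` —
the `D^*M` sources of `V_k(A,B)w` form the divergence `−D^{ε*}_B(b ↦ M_bw(b₊))`. [cite: Balaban1982Higgs1, (1.7)–(1.8) p.605] -/
theorem sum_dip_apply (g : HiggsLattice.PBond P 0 → E N) (x : HiggsLattice.Site P 0) :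
    (∑ b : HiggsLattice.PBond P 0, dip C B b (g b)) x
      = ∑ ν : Fin P.d, (star (C.U (P.mesh 0) (B ⟨x.unshift ν, ν⟩)) (g ⟨x.unshift ν, ν⟩) - g ⟨x, ν⟩) := by
  rw [Finset.sum_apply, ← sum_site_dir (fun y ν => dip C B ⟨y, ν⟩ (g ⟨y, ν⟩) x), Finset.sum_comm]
  refine Finset.sum_congr rfl fun ν _ => ?_
  have htgt : ∀ y : HiggsLattice.Site P 0, (⟨y, ν⟩ : HiggsLattice.PBond P 0).tgt = y.shift ν := fun y => rfl
  simp only [dip, Pi.sub_apply, Finset.sum_sub_distrib, htgt, ChargeData.star_U]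
  congr 1
  · -- Σ_y δ_{y+e_ν}(U(−B)g)(x) = U(−B_{⟨x−e_ν,ν⟩}) g ⟨x−e_ν, ν⟩
    rw [Finset.sum_eq_single (x.unshift ν)]
    · simp only [shift_unshift, Pi.single_eq_same]
    · intro y _ hy
      rw [Pi.single_eq_of_ne]
      intro hx
      apply hy
      rw [hx, unshift_shift]
    · intro h; exact absurd (Finset.mem_univ _) h
  · rw [Finset.sum_eq_single x]
    · simp only [Pi.single_eq_same]
    · intro y _ hy
      rw [Pi.single_eq_of_ne (Ne.symm hy)]
    · intro h; exact absurd (Finset.mem_univ _) h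

/-- The same with the factor `ε⁻¹` of `bondSrc`: `ε⁻¹Σ_b dip_b(g(b)) = D^{ε*}_Bg` (the explicit adjoint of `B1Cor23DerivRegularRegion`).
[cite: Balaban1982Higgs1, (1.7)–(1.8) p.605] -/
theorem inv_smul_sum_dip_eq_adjCovDeriv (g : HiggsLattice.PBond P 0 → E N) :
    (P.mesh 0)⁻¹ • (∑ b : HiggsLattice.PBond P 0, dip C B b (g b))
      = fun x => (P.mesh 0)⁻¹ • ∑ ν : Fin P.d,
          (star (C.U (P.mesh 0) (B ⟨x.unshift ν, ν⟩)) (g ⟨x.unshift ν, ν⟩) - g ⟨x, ν⟩) := by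
  funext x
  rw [Pi.smul_apply, sum_dip_apply]

end AdjointSource


/-! ## §6 (v1.1) The bond–bond chains of the value clause with an ABSTRACT OUTER ROW `R` (exponent `p`): the five shapes -/

section ChainsOuterRow

variable {C : ChargeData N} {A B : HiggsLattice.VecField P 0} {msq a : ℝ} {k K₀ : ℕ} {hL1 : 1 < P.L} {δ₁ Cst : ℝ}

/-- the common constant of the chains: `d²·K(N,d,δ₁)·Π_i(L^{a_i(1−d/Σa)} − 1)^{−1}·(ε^d)^{−2}`. [cite: Balaban1983Higgs3, (2.10) p.426] -/
def chainConst (P : HiggsLattice.Params) (N : ℕ) (δ₁ a₁ a₂ a₃ : ℝ) : ℝ :=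
  (P.d : ℝ) ^ 2 * ((((nCol N : ℝ) * (8 * P.d / δ₁) ^ P.d) * ((nCol N : ℝ) * (16 * P.d / δ₁) ^ P.d)) *
    ((1 / ((P.L : ℝ) ^ (a₁ * (1 - (P.d : ℝ) / (a₁ + a₂ + a₃))) - 1)) *
      (1 / ((P.L : ℝ) ^ (a₂ * (1 - (P.d : ℝ) / (a₁ + a₂ + a₃))) - 1)) *
      (1 / ((P.L : ℝ) ^ (a₃ * (1 - (P.d : ℝ) / (a₁ + a₂ + a₃))) - 1))) *
    ((P.mesh 0 ^ P.d)⁻¹) ^ 2)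

/-- `bond_chain3_le` with the constant packaged. [cite: Balaban1983Higgs3, (1.16) p.414, (2.10) p.426] -/
theorem bond_chain3_le' (hL : 1 < P.L) {δ : ℝ} (hδ : 0 < δ) (hδ1 : δ ≤ 1) {a₁ a₂ a₃ : ℝ} (ha₁ : 0 < a₁) (ha₂ : 0 < a₂)
    (ha₃ : 0 < a₃) (hsum : (P.d : ℝ) < a₁ + a₂ + a₃) {c₁ c₂ c₃ : ℝ} (hc₁ : 0 ≤ c₁) (hc₂ : 0 ≤ c₂) (hc₃ : 0 ≤ c₃) (i₀ : Ix N)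
    (x x' : HiggsLattice.Site P 0) (F₁ F₃ : HiggsLattice.PBond P 0 → ℝ) (F₂ : HiggsLattice.PBond P 0 → HiggsLattice.PBond P 0 → ℝ)
    (hF₁0 : ∀ b, 0 ≤ F₁ b) (hF₂0 : ∀ b b', 0 ≤ F₂ b b') (hF₃0 : ∀ b', 0 ≤ F₃ b')
    (hF₁ : ∀ b, F₁ b ≤ ∑ j ∈ Finset.range k, c₁ * P.mesh j ^ (a₁ - (P.d : ℝ)) *
      Real.exp (-(δ * (P.mesh j)⁻¹ * (P.mesh 0 * (HiggsLattice.Site.tdist x b.src : ℝ)))))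
    (hF₂ : ∀ b b', F₂ b b' ≤ ∑ j ∈ Finset.range k, c₂ * P.mesh j ^ (a₂ - (P.d : ℝ)) *
      Real.exp (-(δ * (P.mesh j)⁻¹ * (P.mesh 0 * (HiggsLattice.Site.tdist b.src b'.src : ℝ)))))
    (hF₃ : ∀ b', F₃ b' ≤ ∑ j ∈ Finset.range k, c₃ * P.mesh j ^ (a₃ - (P.d : ℝ)) *
      Real.exp (-(δ * (P.mesh j)⁻¹ * (P.mesh 0 * (HiggsLattice.Site.tdist b'.src x' : ℝ))))) :
    ∑ b : HiggsLattice.PBond P 0, ∑ b' : HiggsLattice.PBond P 0, F₁ b * F₂ b b' * F₃ b'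
      ≤ chainConst P N δ a₁ a₂ a₃ * (c₁ * c₂ * c₃) * P.mesh k ^ (a₁ + a₂ + a₃ - (P.d : ℝ)) *
          Real.exp (-(δ / 4 * (P.mesh k)⁻¹ * (P.mesh 0 * (HiggsLattice.Site.tdist x x' : ℝ)))) := by
  refine (bond_chain3_le (k := k) hL hδ hδ1 ha₁ ha₂ ha₃ hsum hc₁ hc₂ hc₃ i₀ x x' F₁ F₃ F₂ hF₁0 hF₂0 hF₃0 hF₁ hF₂ hF₃).trans
    (le_of_eq ?_)
  unfold chainConst
  ring

variable (hδ₁ : 0 < δ₁) (hδ₁1 : δ₁ ≤ 1) (hCst : 0 ≤ Cst)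
  (h210B : (regRegionKernels hL1 C Finset.univ B msq a k K₀).Ineq210 δ₁ Cst)
  (h210AB : (regRegionKernels hL1 C Finset.univ (A + B) msq a k K₀).Ineq210 δ₁ Cst)
  (hmsq : 0 < msq) (ha : 0 < a) (hk : 1 ≤ k) (hkK : k ≤ P.K) (i₀ : Ix N) (x x' : HiggsLattice.Site P 0)
  {p cR : ℝ} (hp : 0 < p) (hcR : 0 ≤ cR) (R : HiggsLattice.PBond P 0 → ℝ) (hR0 : ∀ b, 0 ≤ R b)
  (hR : ∀ b, R b ≤ ∑ j ∈ Finset.range k, cR * P.mesh j ^ (p - (P.d : ℝ)) *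
      Real.exp (-(δ₁ * (P.mesh j)⁻¹ * (P.mesh 0 * (HiggsLattice.Site.tdist x b.src : ℝ)))))
include hδ₁ hδ₁1 hCst h210B h210AB hmsq ha hk hkK i₀ hp hcR hR0 hR

/-- **Shape T5 — outer row ∘ `M^*M′`** (`DM`/`MM` outer sources read `‖w₁(b₊)‖`, inner source `M^*M`):
`Σ_bΣ_{b′} R(b)·κ_{A+B}(b₊,b′₊)·κ_B(b′₊,x′)`, exponents `(p,2,2)`, `p + 4 > d`. [cite: Balaban1983Higgs3, (1.16) p.414, (2.10) p.426] -/
theorem chainT5_le (hsum : (P.d : ℝ) < p + 2 + 2) :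
    ∑ b : HiggsLattice.PBond P 0, ∑ b' : HiggsLattice.PBond P 0,
        R b * col C msq a k (A + B) b.tgt b'.tgt * col C msq a k B b'.tgt x'
      ≤ chainConst P N δ₁ p 2 2 *
          (cR * (Real.exp 1 * (Real.exp 1 * (P.mesh 0 ^ P.d * Cst))) * (Real.exp 1 * (P.mesh 0 ^ P.d * Cst))) *
          P.mesh k ^ (p + 2 + 2 - (P.d : ℝ)) *
          Real.exp (-(δ₁ / 4 * (P.mesh k)⁻¹ * (P.mesh 0 * (HiggsLattice.Site.tdist x x' : ℝ)))) := by
  have hc : 0 ≤ P.mesh 0 ^ P.d * Cst := mul_nonneg (pow_nonneg (P.mesh_pos 0).le _) hCst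
  have hc1 : 0 ≤ Real.exp 1 * (P.mesh 0 ^ P.d * Cst) := mul_nonneg (Real.exp_nonneg _) hc
  refine bond_chain3_le' (k := k) hL1 hδ₁ hδ₁1 hp (by norm_num) (by norm_num) hsum hcR
    (mul_nonneg (Real.exp_nonneg _) hc1) hc1 i₀ x x' _ _ _ hR0 (fun b b' => col_nonneg _ _ _)
    (fun b' => col_nonneg _ _ _) hR (fun b b' => ?_) (fun b' => ?_)
  · refine (col_le h210AB hmsq ha hk hkK b.tgt b'.tgt).trans ?_
    exact (majorant_shift_le hδ₁ hδ₁1 hc _ b'.src b'.dir).trans (majorant_shift_le' hδ₁ hδ₁1 hc1 b.src b'.src b.dir)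
  · exact (col_le h210B hmsq ha hk hkK b'.tgt x').trans (majorant_shift_le' hδ₁ hδ₁1 hc b'.src x' b'.dir)

/-- **Shape T3 — outer row ∘ `M^*D′`** (inner source `M^*D` read through the undifferentiated column of `G_{A+B}`):
`Σ_bΣ_{b′} R(b)·κ_{A+B}(b₊,b′₊)·κ^D_{B,B}(b′,x′)`, exponents `(p,2,1)`, `p + 3 > d`. [cite: Balaban1983Higgs3, (1.16) p.414, (2.10) p.426] -/
theorem chainT3_le (hsum : (P.d : ℝ) < p + 2 + 1) :
    ∑ b : HiggsLattice.PBond P 0, ∑ b' : HiggsLattice.PBond P 0,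
        R b * col C msq a k (A + B) b.tgt b'.tgt * dcol C msq a k B B b' x'
      ≤ chainConst P N δ₁ p 2 1 *
          (cR * (Real.exp 1 * (Real.exp 1 * (P.mesh 0 ^ P.d * Cst))) * (P.mesh 0 ^ P.d * Cst)) *
          P.mesh k ^ (p + 2 + 1 - (P.d : ℝ)) *
          Real.exp (-(δ₁ / 4 * (P.mesh k)⁻¹ * (P.mesh 0 * (HiggsLattice.Site.tdist x x' : ℝ)))) := by
  have hc : 0 ≤ P.mesh 0 ^ P.d * Cst := mul_nonneg (pow_nonneg (P.mesh_pos 0).le _) hCst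
  have hc1 : 0 ≤ Real.exp 1 * (P.mesh 0 ^ P.d * Cst) := mul_nonneg (Real.exp_nonneg _) hc
  refine bond_chain3_le' (k := k) hL1 hδ₁ hδ₁1 hp (by norm_num) (by norm_num) hsum hcR
    (mul_nonneg (Real.exp_nonneg _) hc1) hc i₀ x x' _ _ _ hR0 (fun b b' => col_nonneg _ _ _)
    (fun b' => dcol_nonneg _ _ _ _) hR (fun b b' => ?_) (fun b' => ?_)
  · refine (col_le h210AB hmsq ha hk hkK b.tgt b'.tgt).trans ?_
    exact (majorant_shift_le hδ₁ hδ₁1 hc _ b'.src b'.dir).trans (majorant_shift_le' hδ₁ hδ₁1 hc1 b.src b'.src b.dir)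
  · exact dcol_le h210B hmsq ha hk hkK b' x'

omit hδ₁ hδ₁1 hCst h210B h210AB hmsq ha hk hkK i₀ hp hcR hR0 hR in
/-- splitting a middle kernel bounded by a sum of two. [folklore] -/
private theorem sum2_split_le (R K : HiggsLattice.PBond P 0 → ℝ) (F G H : HiggsLattice.PBond P 0 → HiggsLattice.PBond P 0 → ℝ)
    (s : ℝ) (hR0 : ∀ b, 0 ≤ R b) (hK0 : ∀ b', 0 ≤ K b') (hF : ∀ b b', F b b' ≤ G b b' + s * H b b') :
    ∑ b : HiggsLattice.PBond P 0, ∑ b' : HiggsLattice.PBond P 0, R b * F b b' * K b'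
      ≤ (∑ b : HiggsLattice.PBond P 0, ∑ b' : HiggsLattice.PBond P 0, R b * G b b' * K b')
        + s * ∑ b : HiggsLattice.PBond P 0, ∑ b' : HiggsLattice.PBond P 0, R b * H b b' * K b' := by
  rw [Finset.mul_sum, ← Finset.sum_add_distrib]
  refine Finset.sum_le_sum fun b _ => ?_
  rw [Finset.mul_sum, ← Finset.sum_add_distrib]
  refine Finset.sum_le_sum fun b' _ => ?_
  have h := mul_le_mul_of_nonneg_left (hF b b') (hR0 b)
  have h2 := mul_le_mul_of_nonneg_right h (hK0 b')
  refine h2.trans (le_of_eq ?_)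
  ring

omit hδ₁ hδ₁1 hCst h210B h210AB hmsq ha hk hkK i₀ hp hcR hR0 hR in
/-- a majorant is symmetric in the two points. [cite: Balaban1983Higgs3, (2.10) p.426] -/
theorem majorant_comm {δ c e : ℝ} (u v : HiggsLattice.Site P 0) :
    ∑ j ∈ Finset.range k, c * P.mesh j ^ e * Real.exp (-(δ * (P.mesh j)⁻¹ * (P.mesh 0 * (HiggsLattice.Site.tdist u v : ℝ))))
      = ∑ j ∈ Finset.range k, c * P.mesh j ^ e *
          Real.exp (-(δ * (P.mesh j)⁻¹ * (P.mesh 0 * (HiggsLattice.Site.tdist v u : ℝ)))) := by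
  simp_rw [B1Ineq234LevelZero.tdist_comm u v]

variable {s : ℝ} (hA : ∀ b : HiggsLattice.PBond P 0, |A b| ≤ s)
include hA

/-- **Shape T2 — outer `D`-row source ∘ `M^*M′`** (`MD` outer source reads `‖D_Bw₁(b)‖`; inner `M^*M`; the middle kernel
`κ^D_{B,A+B}(b,b′₊)` split by `D_B = D_{A+B} − M`): `Σ_bΣ_{b′} R(b)·κ^D_{B,A+B}(b,b′₊)·κ_B(b′₊,x′) ≤ [(p,1,2)] + |e|s·[(p,2,2)]`,
`p + 3 > d`. [cite: Balaban1983Higgs3, (1.16) p.414, (2.10) p.426] [cite: Balaban1982Higgs1, (3.14) p.614] -/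
theorem chainT2_le (hsum : (P.d : ℝ) < p + 1 + 2) :
    ∑ b : HiggsLattice.PBond P 0, ∑ b' : HiggsLattice.PBond P 0,
        R b * dcol C msq a k B (A + B) b b'.tgt * col C msq a k B b'.tgt x'
      ≤ chainConst P N δ₁ p 1 2 *
            (cR * (Real.exp 1 * (P.mesh 0 ^ P.d * Cst)) * (Real.exp 1 * (P.mesh 0 ^ P.d * Cst))) *
            P.mesh k ^ (p + 1 + 2 - (P.d : ℝ)) *
            Real.exp (-(δ₁ / 4 * (P.mesh k)⁻¹ * (P.mesh 0 * (HiggsLattice.Site.tdist x x' : ℝ))))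
        + |C.e| * s * (chainConst P N δ₁ p 2 2 *
            (cR * (Real.exp 1 * (Real.exp 1 * (P.mesh 0 ^ P.d * Cst))) * (Real.exp 1 * (P.mesh 0 ^ P.d * Cst))) *
            P.mesh k ^ (p + 2 + 2 - (P.d : ℝ)) *
            Real.exp (-(δ₁ / 4 * (P.mesh k)⁻¹ * (P.mesh 0 * (HiggsLattice.Site.tdist x x' : ℝ))))) := by
  have hc : 0 ≤ P.mesh 0 ^ P.d * Cst := mul_nonneg (pow_nonneg (P.mesh_pos 0).le _) hCst
  have hc1 : 0 ≤ Real.exp 1 * (P.mesh 0 ^ P.d * Cst) := mul_nonneg (Real.exp_nonneg _) hc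
  refine (sum2_split_le R (fun b' => col C msq a k B b'.tgt x') _ (fun b b' => dcol C msq a k (A + B) (A + B) b b'.tgt)
    (fun b b' => col C msq a k (A + B) b.tgt b'.tgt) (|C.e| * s) hR0 (fun b' => col_nonneg _ _ _)
    (fun b b' => dcol_le_add_split A B (hA b) b'.tgt)).trans ?_
  refine add_le_add ?_ (mul_le_mul_of_nonneg_left (chainT5_le hδ₁ hδ₁1 hCst h210B h210AB hmsq ha hk hkK i₀ x x' hp hcR R
    hR0 hR (by linarith)) (mul_nonneg (abs_nonneg _) ((abs_nonneg _).trans (hA ⟨x, ⟨0, P.hd⟩⟩))))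
  refine bond_chain3_le' (k := k) hL1 hδ₁ hδ₁1 hp (by norm_num) (by norm_num) hsum hcR hc1 hc1 i₀ x x' _ _ _ hR0
    (fun b b' => dcol_nonneg _ _ _ _) (fun b' => col_nonneg _ _ _) hR (fun b b' => ?_) (fun b' => ?_)
  · exact (dcol_le h210AB hmsq ha hk hkK b b'.tgt).trans (majorant_shift_le hδ₁ hδ₁1 hc _ b'.src b'.dir)
  · exact (col_le h210B hmsq ha hk hkK b'.tgt x').trans (majorant_shift_le' hδ₁ hδ₁1 hc b'.src x' b'.dir)

/-- **Shape T1 — outer `D`-row source ∘ `M^*D′`**: `Σ_bΣ_{b′} R(b)·κ^D_{B,A+B}(b,b′₊)·κ^D_{B,B}(b′,x′) ≤ [(p,1,1)] + |e|s·[(p,2,1)]`,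
`p + 2 > d` (for the value clause `p = 2`, `d ≤ 3`). [cite: Balaban1983Higgs3, (1.16) p.414, (2.10) p.426] [cite: Balaban1982Higgs1, (3.14) p.614] -/
theorem chainT1_le (hsum : (P.d : ℝ) < p + 1 + 1) :
    ∑ b : HiggsLattice.PBond P 0, ∑ b' : HiggsLattice.PBond P 0,
        R b * dcol C msq a k B (A + B) b b'.tgt * dcol C msq a k B B b' x'
      ≤ chainConst P N δ₁ p 1 1 *
            (cR * (Real.exp 1 * (P.mesh 0 ^ P.d * Cst)) * (P.mesh 0 ^ P.d * Cst)) *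
            P.mesh k ^ (p + 1 + 1 - (P.d : ℝ)) *
            Real.exp (-(δ₁ / 4 * (P.mesh k)⁻¹ * (P.mesh 0 * (HiggsLattice.Site.tdist x x' : ℝ))))
        + |C.e| * s * (chainConst P N δ₁ p 2 1 *
            (cR * (Real.exp 1 * (Real.exp 1 * (P.mesh 0 ^ P.d * Cst))) * (P.mesh 0 ^ P.d * Cst)) *
            P.mesh k ^ (p + 2 + 1 - (P.d : ℝ)) *
            Real.exp (-(δ₁ / 4 * (P.mesh k)⁻¹ * (P.mesh 0 * (HiggsLattice.Site.tdist x x' : ℝ))))) := by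
  have hc : 0 ≤ P.mesh 0 ^ P.d * Cst := mul_nonneg (pow_nonneg (P.mesh_pos 0).le _) hCst
  have hc1 : 0 ≤ Real.exp 1 * (P.mesh 0 ^ P.d * Cst) := mul_nonneg (Real.exp_nonneg _) hc
  refine (sum2_split_le R (fun b' => dcol C msq a k B B b' x') _ (fun b b' => dcol C msq a k (A + B) (A + B) b b'.tgt)
    (fun b b' => col C msq a k (A + B) b.tgt b'.tgt) (|C.e| * s) hR0 (fun b' => dcol_nonneg _ _ _ _)
    (fun b b' => dcol_le_add_split A B (hA b) b'.tgt)).trans ?_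
  refine add_le_add ?_ (mul_le_mul_of_nonneg_left (chainT3_le hδ₁ hδ₁1 hCst h210B h210AB hmsq ha hk hkK i₀ x x' hp hcR R
    hR0 hR (by linarith)) (mul_nonneg (abs_nonneg _) ((abs_nonneg _).trans (hA ⟨x, ⟨0, P.hd⟩⟩))))
  refine bond_chain3_le' (k := k) hL1 hδ₁ hδ₁1 hp (by norm_num) (by norm_num) hsum hcR hc1 hc i₀ x x' _ _ _ hR0
    (fun b b' => dcol_nonneg _ _ _ _) (fun b' => dcol_nonneg _ _ _ _) hR (fun b b' => ?_) (fun b' => ?_)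
  · exact (dcol_le h210AB hmsq ha hk hkK b b'.tgt).trans (majorant_shift_le hδ₁ hδ₁1 hc _ b'.src b'.dir)
  · exact dcol_le h210B hmsq ha hk hkK b' x'

/-- **Shape T4 — outer row ∘ `D^*M′`** (`DM`/`MM` outer sources read `‖w₁(b₊)‖`; the inner dipole source read through the
DIFFERENTIATED column of `G_{A+B}` at the inner bond, split by `D_B = D_{A+B} − M`):
`Σ_bΣ_{b′} R(b)·κ^D_{B,A+B}(b′,b₊)·κ_B(b′₊,x′) ≤ [(p,1,2)] + |e|s·[(p,2,2)]`, `p + 3 > d`. [cite: Balaban1983Higgs3, (1.16) p.414, (2.10) p.426] [cite: Balaban1982Higgs1, (3.14) p.614] -/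
theorem chainT4_le (hsum : (P.d : ℝ) < p + 1 + 2) :
    ∑ b : HiggsLattice.PBond P 0, ∑ b' : HiggsLattice.PBond P 0,
        R b * dcol C msq a k B (A + B) b' b.tgt * col C msq a k B b'.tgt x'
      ≤ chainConst P N δ₁ p 1 2 *
            (cR * (Real.exp 1 * (P.mesh 0 ^ P.d * Cst)) * (Real.exp 1 * (P.mesh 0 ^ P.d * Cst))) *
            P.mesh k ^ (p + 1 + 2 - (P.d : ℝ)) *
            Real.exp (-(δ₁ / 4 * (P.mesh k)⁻¹ * (P.mesh 0 * (HiggsLattice.Site.tdist x x' : ℝ))))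
        + |C.e| * s * (chainConst P N δ₁ p 2 2 *
            (cR * (Real.exp 1 * (Real.exp 1 * (P.mesh 0 ^ P.d * Cst))) * (Real.exp 1 * (P.mesh 0 ^ P.d * Cst))) *
            P.mesh k ^ (p + 2 + 2 - (P.d : ℝ)) *
            Real.exp (-(δ₁ / 4 * (P.mesh k)⁻¹ * (P.mesh 0 * (HiggsLattice.Site.tdist x x' : ℝ))))) := by
  have hc : 0 ≤ P.mesh 0 ^ P.d * Cst := mul_nonneg (pow_nonneg (P.mesh_pos 0).le _) hCst
  have hc1 : 0 ≤ Real.exp 1 * (P.mesh 0 ^ P.d * Cst) := mul_nonneg (Real.exp_nonneg _) hc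
  refine (sum2_split_le R (fun b' => col C msq a k B b'.tgt x') _ (fun b b' => dcol C msq a k (A + B) (A + B) b' b.tgt)
    (fun b b' => col C msq a k (A + B) b'.tgt b.tgt) (|C.e| * s) hR0 (fun b' => col_nonneg _ _ _)
    (fun b b' => dcol_le_add_split A B (hA b') b.tgt)).trans ?_
  have hes : 0 ≤ |C.e| * s := mul_nonneg (abs_nonneg _) ((abs_nonneg _).trans (hA ⟨x, ⟨0, P.hd⟩⟩))
  refine add_le_add ?_ (mul_le_mul_of_nonneg_left ?_ hes)
  · refine bond_chain3_le' (k := k) hL1 hδ₁ hδ₁1 hp (by norm_num) (by norm_num) hsum hcR hc1 hc1 i₀ x x' _ _ _ hR0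
      (fun b b' => dcol_nonneg _ _ _ _) (fun b' => col_nonneg _ _ _) hR (fun b b' => ?_) (fun b' => ?_)
    · -- κ^D_{A+B,A+B}(b′, b₊): majorant at |b′₋ − b₊| = |b₊ − b′₋| → shift in the first argument
      refine (dcol_le h210AB hmsq ha hk hkK b' b.tgt).trans ?_
      rw [majorant_comm]
      exact majorant_shift_le' hδ₁ hδ₁1 hc b.src b'.src b.dir
    · exact (col_le h210B hmsq ha hk hkK b'.tgt x').trans (majorant_shift_le' hδ₁ hδ₁1 hc b'.src x' b'.dir)
  · refine bond_chain3_le' (k := k) hL1 hδ₁ hδ₁1 hp (by norm_num) (by norm_num) (by linarith) hcR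
      (mul_nonneg (Real.exp_nonneg _) hc1) hc1 i₀ x x' _ _ _ hR0 (fun b b' => col_nonneg _ _ _)
      (fun b' => col_nonneg _ _ _) hR (fun b b' => ?_) (fun b' => ?_)
    · -- κ_{A+B}(b′₊, b₊): majorant at |b′₊ − b₊| = |b₊ − b′₊| → two shifts
      refine (col_le h210AB hmsq ha hk hkK b'.tgt b.tgt).trans ?_
      rw [majorant_comm]
      exact (majorant_shift_le hδ₁ hδ₁1 hc _ b'.src b'.dir).trans (majorant_shift_le' hδ₁ hδ₁1 hc1 b.src b'.src b.dir)
    · exact (col_le h210B hmsq ha hk hkK b'.tgt x').trans (majorant_shift_le' hδ₁ hδ₁1 hc b'.src x' b'.dir)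

end ChainsOuterRow

/-! ## §7 The `L²` bound of `D^ε_B G_k(T_ε, A+B) D^{ε*}_B` (the ninth chain), by the four pairings of [13] Cor. 2.3 -/

section BadChain

variable (C : ChargeData N) (A B : HiggsLattice.VecField P 0)

/-- **The explicit adjoint covariant derivative** of `B1Cor23DerivRegularRegion` at the field `Y`:
`(D^{ε*}_Yg)(x) = ε^{−1}Σ_ν(U(Y_{⟨x−εe_ν,x⟩})^*g(⟨x − εe_ν, x⟩) − g(⟨x, x + εe_ν⟩))`. [cite: Balaban1982Higgs1, (1.7)–(1.8) p.605] -/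
def adjD (Y : HiggsLattice.VecField P 0) (g : HiggsLattice.PBond P 0 → E N) : ScalarField P 0 N :=
  fun x => (P.mesh 0)⁻¹ • ∑ ν : Fin P.d,
    (star (C.U (P.mesh 0) (Y ⟨x.unshift ν, ν⟩)) (g ⟨x.unshift ν, ν⟩) - g ⟨x, ν⟩)

/-- `⟨φ, D^{ε*}_Yg⟩ = ⟨D^ε_Yφ, g⟩_{bonds}` (`siteInner_adjCovDeriv`). [cite: Balaban1982Higgs1, (1.7)–(1.8) p.605] -/
theorem siteInner_adjD (Y : HiggsLattice.VecField P 0) (φ : ScalarField P 0 N) (g : HiggsLattice.PBond P 0 → E N) :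
    siteInner φ (adjD C Y g) = bondInner (covDeriv C Y φ) g :=
  siteInner_adjCovDeriv C Y φ g

/-- **The multiplier collecting `M^*` at the head of each bond**: `(m′g)(x) = Σ_ν M′_{⟨x−εe_ν,x⟩}g(⟨x−εe_ν,x⟩)` with
`M′_b = ε^{−1}U(−B_b)(U(−A_b) − 1)` (= p40's `mulM` at `(−A, −B)` = the adjoint `M_b^*`). [cite: Balaban1982Higgs1, (3.14) p.614] -/
def mP (g : HiggsLattice.PBond P 0 → E N) : ScalarField P 0 N :=
  fun x => ∑ ν : Fin P.d, mulM C (-A) (-B) ⟨x.unshift ν, ν⟩ (g ⟨x.unshift ν, ν⟩)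

/-- **`D^{ε*}_B = D^{ε*}_{A+B} − m′`** on bond fields: the adjoint form of p40's split `D^ε_{A+B} = D^ε_B + M`.
[cite: Balaban1982Higgs1, (3.14) p.614, (1.7) p.605] -/
theorem adjD_split (g : HiggsLattice.PBond P 0 → E N) : adjD C B g = adjD C (A + B) g - mP C A B g := by
  funext x
  simp only [adjD, mP, Pi.sub_apply]
  rw [eq_sub_iff_add_eq]
  have hM : ∀ ν : Fin P.d, mulM C (-A) (-B) ⟨x.unshift ν, ν⟩ (g ⟨x.unshift ν, ν⟩)
      = (P.mesh 0)⁻¹ • (C.U (P.mesh 0) (-(A ⟨x.unshift ν, ν⟩) + -(B ⟨x.unshift ν, ν⟩)) (g ⟨x.unshift ν, ν⟩)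
          - C.U (P.mesh 0) (-(B ⟨x.unshift ν, ν⟩)) (g ⟨x.unshift ν, ν⟩)) := by
    intro ν
    simp only [mulM, smul_apply, mul_apply_eq_comp, sub_apply, one_apply_eq_self, map_sub, Pi.neg_apply]
    rw [← mul_apply_eq_comp, ← ChargeData.U_add, add_comm]
  simp_rw [hM, ← Finset.smul_sum, ← smul_add, ← Finset.sum_add_distrib, ChargeData.star_U, Pi.add_apply, neg_add]
  congr 1
  refine Finset.sum_congr rfl fun ν _ => ?_
  abel

/-- `‖(m′g)(x)‖² ≤ d·(|e|s)²·Σ_ν‖g(⟨x−εe_ν,x⟩)‖²` for `sup_b|A_b| ≤ s`. [cite: Balaban1982Higgs1, (3.14) p.614] -/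
theorem norm_mP_sq_le {s : ℝ} (hA : ∀ b : HiggsLattice.PBond P 0, |A b| ≤ s) (g : HiggsLattice.PBond P 0 → E N)
    (x : HiggsLattice.Site P 0) :
    ‖mP C A B g x‖ ^ 2 ≤ P.d * (|C.e| * s) ^ 2 * ∑ ν : Fin P.d, ‖g ⟨x.unshift ν, ν⟩‖ ^ 2 := by
  have hs : ∀ b : HiggsLattice.PBond P 0, |(-A) b| ≤ s := fun b => by rw [Pi.neg_apply, abs_neg]; exact hA b
  calc ‖mP C A B g x‖ ^ 2 ≤ (∑ ν : Fin P.d, ‖mulM C (-A) (-B) ⟨x.unshift ν, ν⟩ (g ⟨x.unshift ν, ν⟩)‖) ^ 2 := by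
        unfold mP
        exact pow_le_pow_left₀ (norm_nonneg _) (norm_sum_le _ _) 2
    _ ≤ (Finset.univ : Finset (Fin P.d)).card *
          ∑ ν : Fin P.d, ‖mulM C (-A) (-B) ⟨x.unshift ν, ν⟩ (g ⟨x.unshift ν, ν⟩)‖ ^ 2 := sq_sum_le_card_mul_sum_sq
    _ ≤ P.d * ∑ ν : Fin P.d, ((|C.e| * s) * ‖g ⟨x.unshift ν, ν⟩‖) ^ 2 := by
        rw [Finset.card_univ, Fintype.card_fin]
        refine mul_le_mul_of_nonneg_left (Finset.sum_le_sum fun ν _ => ?_) (Nat.cast_nonneg _)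
        exact pow_le_pow_left₀ (norm_nonneg _) (norm_mulM_apply_le C (-A) (-B) (hs _) _) 2
    _ = _ := by rw [Finset.mul_sum, Finset.mul_sum]; exact Finset.sum_congr rfl fun ν _ => by ring

/-- `‖m′g‖²_{T_ε} ≤ d(|e|s)²‖g‖²_{bonds}` (each bond is counted once as `⟨x−εe_ν,x⟩`). [cite: Balaban1982Higgs1, (3.14) p.614, (1.5) p.604] -/
theorem siteInner_mP_self_le {s : ℝ} (hA : ∀ b : HiggsLattice.PBond P 0, |A b| ≤ s) (g : HiggsLattice.PBond P 0 → E N) :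
    siteInner (mP C A B g) (mP C A B g) ≤ P.d * (|C.e| * s) ^ 2 * bondInner g g := by
  rw [HiggsCovariancePos.siteInner_self_eq]
  unfold bondInner
  simp_rw [real_inner_self_eq_norm_sq]
  rw [← sum_site_dir (fun y ν => P.mesh 0 ^ P.d * ‖g ⟨y, ν⟩‖ ^ 2), Finset.mul_sum]
  have hre : ∀ ν : Fin P.d, ∑ x : HiggsLattice.Site P 0, P.mesh 0 ^ P.d * ‖g ⟨x.unshift ν, ν⟩‖ ^ 2
      = ∑ y : HiggsLattice.Site P 0, P.mesh 0 ^ P.d * ‖g ⟨y, ν⟩‖ ^ 2 := by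
    intro ν
    exact (Fintype.sum_equiv (shiftEquiv P 0 ν) _ _ (fun y => by simp [shiftEquiv, unshift_shift])).symm
  calc ∑ x : HiggsLattice.Site P 0, P.mesh 0 ^ P.d * ‖mP C A B g x‖ ^ 2
      ≤ ∑ x : HiggsLattice.Site P 0, P.mesh 0 ^ P.d * (P.d * (|C.e| * s) ^ 2 * ∑ ν : Fin P.d, ‖g ⟨x.unshift ν, ν⟩‖ ^ 2) :=
        Finset.sum_le_sum fun x _ => mul_le_mul_of_nonneg_left (norm_mP_sq_le C A B hA g x) (pow_nonneg (P.mesh_pos 0).le _)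
    _ = P.d * (|C.e| * s) ^ 2 * ∑ ν : Fin P.d, ∑ x : HiggsLattice.Site P 0, P.mesh 0 ^ P.d * ‖g ⟨x.unshift ν, ν⟩‖ ^ 2 := by
        rw [Finset.sum_comm]
        simp_rw [Finset.mul_sum]
        exact Finset.sum_congr rfl fun x _ => Finset.sum_congr rfl fun ν _ => by ring
    _ = _ := by
        simp_rw [hre]
        rw [Finset.sum_comm, Finset.mul_sum]

variable {C A B}

/-- `√⟨m′h, m′h⟩ ≤ √(d(|e|s)²)·√⟨h,h⟩_{bonds}`. [cite: Balaban1982Higgs1, (3.14) p.614] -/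
theorem sqrt_siteInner_mP_le {s : ℝ} (hA : ∀ b : HiggsLattice.PBond P 0, |A b| ≤ s) (h : HiggsLattice.PBond P 0 → E N) :
    Real.sqrt (siteInner (mP C A B h) (mP C A B h))
      ≤ Real.sqrt (P.d * (|C.e| * s) ^ 2) * Real.sqrt (bondInner h h) := by
  rw [← Real.sqrt_mul (by positivity)]
  exact Real.sqrt_le_sqrt (siteInner_mP_self_le C A B hA h)

/-- kernel: `√x² ≤ K√x√y`-type conclusion from `x ≤ K′`: if `X = ⟨Z,Z⟩ ≤ K·√X·√Y` with `K ≥ 0` then `√X ≤ K√Y`. [folklore] -/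
private theorem sqrt_le_of_self_le {X Y K : ℝ} (hX : 0 ≤ X) (hK : 0 ≤ K) (h : X ≤ K * Real.sqrt X * Real.sqrt Y) :
    Real.sqrt X ≤ K * Real.sqrt Y := by
  by_cases h0 : Real.sqrt X = 0
  · rw [h0]; positivity
  · have hpos : 0 < Real.sqrt X := lt_of_le_of_ne (Real.sqrt_nonneg X) (Ne.symm h0)
    have h1 : Real.sqrt X * Real.sqrt X ≤ Real.sqrt X * (K * Real.sqrt Y) := by
      rw [Real.mul_self_sqrt hX]; linarith
    exact le_of_mul_le_mul_left h1 hpos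

/-- **THE `L²` BOUND OF THE NINTH CHAIN**: on the torus, for `m² > 0`, `a > 0`, `1 ≤ k ≤ K`, the field `A + B` (I.2.23)-regular with
`d²ε|e|L^{2k}δ_{A+B} ≤ 1/3` and `sup_b|A_b| ≤ s`, for every bond field `g`:
`‖D^ε_B G_k(T_ε,A+B) D^{ε*}_B g‖_{bonds} ≤ (4 + 2(2/√γ₀)(L^kε)ρ + (2/γ₀)(L^kε)²ρ²)·‖g‖_{bonds}`, `ρ = √d·|e|s`,
`γ₀ = min{2, a(1−L^{−2})/4}` — from the FOUR pairings of [13] Cor. 2.3 at the regular field `A+B` (r = 0, δ = 0) after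
`D_B = D_{A+B} − M`, `D^*_B = D^*_{A+B} − m′`; no logarithm of `k`. [cite: Balaban1983RegularityDecay, Cor. 2.3 (2.30) p.580] [cite: Balaban1983Higgs3, (1.16) p.414] [cite: Balaban1982Higgs1, (3.14) p.614] -/
theorem sqrt_bondInner_DGDt_le {msq a : ℝ} {k : ℕ} (ha : 0 < a) (hL : 1 < P.L) (hmsq : 0 < msq) (hk1 : 1 ≤ k) (hk : k ≤ P.K)
    {δX : ℝ} (hreg : ∀ (z : HiggsLattice.Site P 0) (μ ν : Fin P.d), |(A + B) ⟨z.shift ν, μ⟩ - (A + B) ⟨z, μ⟩| ≤ δX)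
    (hsmall : (P.d : ℝ) ^ 2 * (P.mesh 0 * |C.e|) * ((P.L : ℝ) ^ k) ^ 2 * δX ≤ 1 / 3)
    {s : ℝ} (hA : ∀ b : HiggsLattice.PBond P 0, |A b| ≤ s) (g : HiggsLattice.PBond P 0 → E N) :
    Real.sqrt (bondInner (covDeriv C B (propagatorK C Finset.univ (A + B) msq a k (adjD C B g)))
        (covDeriv C B (propagatorK C Finset.univ (A + B) msq a k (adjD C B g))))
      ≤ (4 + 2 * (2 / Real.sqrt (min 2 (a * (1 - ((P.L : ℝ) ^ 2)⁻¹) / 4)) * P.mesh k) * Real.sqrt (P.d * (|C.e| * s) ^ 2)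
          + (2 / min 2 (a * (1 - ((P.L : ℝ) ^ 2)⁻¹) / 4) * P.mesh k ^ 2) * Real.sqrt (P.d * (|C.e| * s) ^ 2) ^ 2) *
        Real.sqrt (bondInner g g) := by
  -- abbreviations
  set X : HiggsLattice.VecField P 0 := A + B with hXdef
  set G' := propagatorK C Finset.univ X msq a k with hG'
  set Z : HiggsLattice.PBond P 0 → E N := covDeriv C B (G' (adjD C B g)) with hZ
  set γ₀ : ℝ := min 2 (a * (1 - ((P.L : ℝ) ^ 2)⁻¹) / 4) with hγ₀
  set ρ : ℝ := Real.sqrt (P.d * (|C.e| * s) ^ 2) with hρ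
  have hγ : 0 < γ₀ := gammaReg_pos (P := P) ha hL
  have hΩ : ∀ x x' : HiggsLattice.Site P 0, blockIter k x = blockIter k x' →
      (x ∈ (Finset.univ : Finset (HiggsLattice.Site P 0)) ↔ x' ∈ (Finset.univ : Finset (HiggsLattice.Site P 0))) :=
    fun x x' _ => by simp
  have hreg' : ∀ z ∈ (Finset.univ : Finset (HiggsLattice.Site P 0)), ∀ μ ν : Fin P.d,
      |X ⟨z.shift ν, μ⟩ - X ⟨z, μ⟩| ≤ δX := fun z _ μ ν => hreg z μ ν
  have hδ : (4 * (P.d : ℝ) + 4 * a) * 0 ≤ γ₀ := by rw [mul_zero]; exact hγ.le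
  have hIn : ∀ b : HiggsLattice.PBond P 0, ¬ Inside (Finset.univ : Finset (HiggsLattice.Site P 0)) b → False :=
    fun b hb => hb ⟨Finset.mem_univ _, Finset.mem_univ _⟩
  -- nonnegativity
  have hZZ : 0 ≤ bondInner Z Z := B1Ineq233LowerZeroFieldTorus.bondInner_self_nonneg Z
  have hgg : 0 ≤ bondInner g g := B1Ineq233LowerZeroFieldTorus.bondInner_self_nonneg g
  have hρ0 : 0 ≤ ρ := Real.sqrt_nonneg _
  have hmk : 0 < P.mesh k := P.mesh_pos k
  -- the four pieces
  set P₁ := G' (adjD C X g) with hP₁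
  set P₂ := G' (mP C A B g) with hP₂
  set Q₁ := adjD C X Z with hQ₁
  set Q₂ := mP C A B Z with hQ₂
  have hdecomp : bondInner Z Z = siteInner P₁ Q₁ - siteInner P₁ Q₂ - siteInner P₂ Q₁ + siteInner P₂ Q₂ := by
    have h1 : bondInner Z Z = siteInner (G' (adjD C B g)) (adjD C B Z) := by
      rw [siteInner_adjD]
    rw [h1, adjD_split C A B g, adjD_split C A B Z, map_sub]
    rw [siteInner_sub_right, siteInner_comm (P₁ - P₂) Q₁, siteInner_comm (P₁ - P₂) Q₂, siteInner_sub_right,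
      siteInner_sub_right, siteInner_comm Q₁ P₁, siteInner_comm Q₁ P₂, siteInner_comm Q₂ P₁, siteInner_comm Q₂ P₂]
    ring
  -- T1: the fourth pairing
  have hT1 : |siteInner P₁ Q₁| ≤ 4 * Real.sqrt (bondInner Z Z) * Real.sqrt (bondInner g g) := by
    have e1 : siteInner P₁ Q₁ = bondInner Z (covDeriv C X (G' (adjD C X g))) := by
      rw [hQ₁, siteInner_adjD, bondInner_comm]
    have h := pairing_DGDt_regular_region C X ha hL hmsq hk1 hk Finset.univ hΩ hreg' hsmall le_rfl hδ Z g
      (fun b hb => (hIn b hb).elim) (fun b hb => (hIn b hb).elim) 0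
      (fun b b' _ _ => ⟨Nat.cast_nonneg _, Nat.cast_nonneg _⟩)
    rw [e1]
    refine h.trans (le_of_eq ?_)
    simp only [mul_zero, zero_mul, zero_div, Real.exp_zero, neg_zero, add_zero, mul_one]
  -- T2: the third pairing with the site source `m′Z`
  have hT2 : |siteInner P₁ Q₂| ≤ 2 / Real.sqrt γ₀ * P.mesh k * (ρ * Real.sqrt (bondInner Z Z)) * Real.sqrt (bondInner g g) := by
    have e2 : siteInner P₁ Q₂ = siteInner (mP C A B Z) (G' (adjD C X g)) := by rw [hQ₂, siteInner_comm]
    have h := pairing_GDt_regular_region C ha hL hmsq hk1 hk Finset.univ hΩ X hreg' hsmall le_rfl hδ (mP C A B Z) g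
      (fun b hb => (hIn b hb).elim) 0 (fun b x _ _ => Nat.cast_nonneg _)
    rw [e2]
    refine h.trans ?_
    simp only [mul_zero, zero_div, Real.exp_zero, neg_zero, add_zero, mul_one]
    have hm := sqrt_siteInner_mP_le (C := C) (A := A) (B := B) hA Z
    have hc : 0 ≤ 2 / Real.sqrt γ₀ * P.mesh k := by positivity
    exact mul_le_mul_of_nonneg_right (mul_le_mul_of_nonneg_left hm hc) (Real.sqrt_nonneg _)
  -- T3: the second pairing with the site source `m′g`
  have hT3 : |siteInner P₂ Q₁| ≤ 2 / Real.sqrt γ₀ * P.mesh k * Real.sqrt (bondInner Z Z) * (ρ * Real.sqrt (bondInner g g)) := by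
    have e3 : siteInner P₂ Q₁ = bondInner Z (covDeriv C X (G' (mP C A B g))) := by
      rw [hQ₁, siteInner_adjD, bondInner_comm]
    have h := pairing_DG_regular_region C ha hL hmsq hk1 hk Finset.univ hΩ X hreg' hsmall le_rfl hδ Z
      (fun b hb => (hIn b hb).elim) (mP C A B g) 0 (fun b x _ _ => Nat.cast_nonneg _)
    rw [e3]
    refine h.trans ?_
    simp only [mul_zero, zero_div, Real.exp_zero, neg_zero, add_zero, mul_one]
    have hm := sqrt_siteInner_mP_le (C := C) (A := A) (B := B) hA g
    have hc : 0 ≤ 2 / Real.sqrt γ₀ * P.mesh k * Real.sqrt (bondInner Z Z) := by positivity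
    exact mul_le_mul_of_nonneg_left hm hc
  -- T4: the first pairing with two site sources
  have hT4 : |siteInner P₂ Q₂| ≤ 2 / γ₀ * P.mesh k ^ 2 * (ρ * Real.sqrt (bondInner Z Z)) * (ρ * Real.sqrt (bondInner g g)) := by
    have e4 : siteInner P₂ Q₂ = siteInner (mP C A B Z) (G' (mP C A B g)) := by rw [hQ₂, siteInner_comm]
    have h := propagatorK_pairing_regular_region C ha hL hmsq hk1 hk Finset.univ hΩ X hreg' hsmall le_rfl hδ
      (mP C A B Z) (mP C A B g) (fun x hx => absurd (Finset.mem_univ x) hx) 0 (fun x x' _ _ => Nat.cast_nonneg _)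
    rw [e4]
    refine h.trans ?_
    simp only [zero_div, mul_zero, Real.exp_zero, neg_zero, mul_one]
    have hmZ := sqrt_siteInner_mP_le (C := C) (A := A) (B := B) hA Z
    have hmg := sqrt_siteInner_mP_le (C := C) (A := A) (B := B) hA g
    have hc : 0 ≤ 2 / γ₀ * P.mesh k ^ 2 := by positivity
    exact mul_le_mul (mul_le_mul_of_nonneg_left hmZ hc) hmg (Real.sqrt_nonneg _) (by positivity)
  -- assemble
  have hsum : bondInner Z Z ≤ (4 + 2 * (2 / Real.sqrt γ₀ * P.mesh k) * ρ + (2 / γ₀ * P.mesh k ^ 2) * ρ ^ 2) *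
      Real.sqrt (bondInner Z Z) * Real.sqrt (bondInner g g) := by
    have habs : bondInner Z Z ≤ |siteInner P₁ Q₁| + |siteInner P₁ Q₂| + |siteInner P₂ Q₁| + |siteInner P₂ Q₂| := by
      rw [hdecomp]
      have h1 := le_abs_self (siteInner P₁ Q₁)
      have h2 := neg_abs_le (siteInner P₁ Q₂)
      have h3 := neg_abs_le (siteInner P₂ Q₁)
      have h4 := le_abs_self (siteInner P₂ Q₂)
      linarith
    refine habs.trans ?_
    have := add_le_add (add_le_add (add_le_add hT1 hT2) hT3) hT4
    refine this.trans (le_of_eq ?_)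
    ring
  exact sqrt_le_of_self_le hZZ (by positivity) hsum

/-- the support of `m′h` lies in the heads of the support of `h`. [cite: Balaban1982Higgs1, (3.14) p.614] -/
theorem exists_of_mP_ne_zero (h : HiggsLattice.PBond P 0 → E N) {x : HiggsLattice.Site P 0} (hx : mP C A B h x ≠ 0) :
    ∃ b : HiggsLattice.PBond P 0, h b ≠ 0 ∧ b.tgt = x := by
  by_contra hno
  push Not at hno
  apply hx
  unfold mP
  refine Finset.sum_eq_zero fun ν _ => ?_
  have hb := hno ⟨x.unshift ν, ν⟩
  by_cases hz : h ⟨x.unshift ν, ν⟩ = 0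
  · rw [hz, map_zero]
  · exact absurd (shift_unshift x ν) (hb hz)

/-- **THE NINTH CHAIN AS A PAIRING WITH SEPARATED SUPPORTS** (decay): same data as `sqrt_bondInner_DGDt_le`, `δ ≥ 0` with
`(4d + 4a)δ ≤ γ₀`; for bond fields `h, g` and every `r` below the four distances `|b_∓ − b′_∓|` on `supp h × supp g`:
`|⟨h, D^ε_BG_k(T_ε,A+B)D^{ε*}_Bg⟩| ≤ [(4 + 2δ(8d/γ₀)^{1/2})e^δ + 2(2/√γ₀ + 4√dδ/γ₀)(L^kε)e^δρ + (2/γ₀)(L^kε)²ρ²]·e^{−δr/L^k}‖h‖‖g‖` —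
the four pairings of [13] Cor. 2.3 at the regular field `A+B` with their decay. [cite: Balaban1983RegularityDecay, Cor. 2.3 (2.30) p.580] [cite: Balaban1983Higgs3, (1.16) p.414, (2.5) p.424] -/
theorem abs_bondInner_DGDt_le {msq a : ℝ} {k : ℕ} (ha : 0 < a) (hL : 1 < P.L) (hmsq : 0 < msq) (hk1 : 1 ≤ k) (hk : k ≤ P.K)
    {δX : ℝ} (hreg : ∀ (z : HiggsLattice.Site P 0) (μ ν : Fin P.d), |(A + B) ⟨z.shift ν, μ⟩ - (A + B) ⟨z, μ⟩| ≤ δX)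
    (hsmall : (P.d : ℝ) ^ 2 * (P.mesh 0 * |C.e|) * ((P.L : ℝ) ^ k) ^ 2 * δX ≤ 1 / 3)
    {s : ℝ} (hA : ∀ b : HiggsLattice.PBond P 0, |A b| ≤ s)
    {δ : ℝ} (hδ0 : 0 ≤ δ) (hδ : (4 * P.d + 4 * a) * δ ≤ min 2 (a * (1 - ((P.L : ℝ) ^ 2)⁻¹) / 4))
    (h g : HiggsLattice.PBond P 0 → E N) (r : ℝ)
    (hsep : ∀ b b' : HiggsLattice.PBond P 0, h b ≠ 0 → g b' ≠ 0 →
      r ≤ (HiggsLattice.Site.tdist b.src b'.src : ℝ) ∧ r ≤ (HiggsLattice.Site.tdist b.src b'.tgt : ℝ) ∧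
      r ≤ (HiggsLattice.Site.tdist b.tgt b'.src : ℝ) ∧ r ≤ (HiggsLattice.Site.tdist b.tgt b'.tgt : ℝ)) :
    |bondInner h (covDeriv C B (propagatorK C Finset.univ (A + B) msq a k (adjD C B g)))|
      ≤ ((4 + 2 * δ * Real.sqrt (8 * P.d / min 2 (a * (1 - ((P.L : ℝ) ^ 2)⁻¹) / 4))) * Real.exp δ
          + 2 * ((2 / Real.sqrt (min 2 (a * (1 - ((P.L : ℝ) ^ 2)⁻¹) / 4))
              + 4 * Real.sqrt P.d * δ / min 2 (a * (1 - ((P.L : ℝ) ^ 2)⁻¹) / 4)) * P.mesh k * Real.exp δ) *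
              Real.sqrt (P.d * (|C.e| * s) ^ 2)
          + (2 / min 2 (a * (1 - ((P.L : ℝ) ^ 2)⁻¹) / 4) * P.mesh k ^ 2) * Real.sqrt (P.d * (|C.e| * s) ^ 2) ^ 2) *
        Real.exp (-(δ * (r / (P.L : ℝ) ^ k))) * Real.sqrt (bondInner h h) * Real.sqrt (bondInner g g) := by
  set X : HiggsLattice.VecField P 0 := A + B with hXdef
  set G' := propagatorK C Finset.univ X msq a k with hG'
  set γ₀ : ℝ := min 2 (a * (1 - ((P.L : ℝ) ^ 2)⁻¹) / 4) with hγ₀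
  set ρ : ℝ := Real.sqrt (P.d * (|C.e| * s) ^ 2) with hρ
  set Er : ℝ := Real.exp (-(δ * (r / (P.L : ℝ) ^ k))) with hEr
  have hγ : 0 < γ₀ := gammaReg_pos (P := P) ha hL
  have hΩ : ∀ x x' : HiggsLattice.Site P 0, blockIter k x = blockIter k x' →
      (x ∈ (Finset.univ : Finset (HiggsLattice.Site P 0)) ↔ x' ∈ (Finset.univ : Finset (HiggsLattice.Site P 0))) :=
    fun x x' _ => by simp
  have hreg' : ∀ z ∈ (Finset.univ : Finset (HiggsLattice.Site P 0)), ∀ μ ν : Fin P.d,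
      |X ⟨z.shift ν, μ⟩ - X ⟨z, μ⟩| ≤ δX := fun z _ μ ν => hreg z μ ν
  have hIn : ∀ b : HiggsLattice.PBond P 0, ¬ Inside (Finset.univ : Finset (HiggsLattice.Site P 0)) b → False :=
    fun b hb => hb ⟨Finset.mem_univ _, Finset.mem_univ _⟩
  have hhh : 0 ≤ bondInner h h := B1Ineq233LowerZeroFieldTorus.bondInner_self_nonneg h
  have hgg : 0 ≤ bondInner g g := B1Ineq233LowerZeroFieldTorus.bondInner_self_nonneg g
  have hρ0 : 0 ≤ ρ := Real.sqrt_nonneg _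
  have hmk : 0 < P.mesh k := P.mesh_pos k
  have hEr0 : 0 ≤ Er := Real.exp_nonneg _
  -- separations of the derived site sources
  have hsep2 : ∀ (b' : HiggsLattice.PBond P 0) (x : HiggsLattice.Site P 0), g b' ≠ 0 → mP C A B h x ≠ 0 →
      r ≤ (HiggsLattice.Site.tdist b'.src x : ℝ) := by
    intro b' x hb' hx
    obtain ⟨b, hb, rfl⟩ := exists_of_mP_ne_zero (C := C) (A := A) (B := B) h hx
    rw [B1Ineq234LevelZero.tdist_comm]
    exact (hsep b b' hb hb').2.2.1
  have hsep3 : ∀ (b : HiggsLattice.PBond P 0) (x' : HiggsLattice.Site P 0), h b ≠ 0 → mP C A B g x' ≠ 0 →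
      r ≤ (HiggsLattice.Site.tdist b.src x' : ℝ) := by
    intro b x' hb hx'
    obtain ⟨b', hb', rfl⟩ := exists_of_mP_ne_zero (C := C) (A := A) (B := B) g hx'
    exact (hsep b b' hb hb').2.1
  have hsep4 : ∀ x x' : HiggsLattice.Site P 0, mP C A B h x ≠ 0 → mP C A B g x' ≠ 0 →
      r ≤ (HiggsLattice.Site.tdist x x' : ℝ) := by
    intro x x' hx hx'
    obtain ⟨b, hb, rfl⟩ := exists_of_mP_ne_zero (C := C) (A := A) (B := B) h hx
    obtain ⟨b', hb', rfl⟩ := exists_of_mP_ne_zero (C := C) (A := A) (B := B) g hx'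
    exact (hsep b b' hb hb').2.2.2
  -- the four pieces
  set P₁ := G' (adjD C X g) with hP₁
  set P₂ := G' (mP C A B g) with hP₂
  set Q₁ := adjD C X h with hQ₁
  set Q₂ := mP C A B h with hQ₂
  have hdecomp : bondInner h (covDeriv C B (G' (adjD C B g)))
      = siteInner P₁ Q₁ - siteInner P₁ Q₂ - siteInner P₂ Q₁ + siteInner P₂ Q₂ := by
    have h1 : bondInner h (covDeriv C B (G' (adjD C B g))) = siteInner (G' (adjD C B g)) (adjD C B h) := by
      rw [siteInner_adjD, bondInner_comm]
    rw [h1, adjD_split C A B g, adjD_split C A B h, map_sub]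
    rw [siteInner_sub_right, siteInner_comm (P₁ - P₂) Q₁, siteInner_comm (P₁ - P₂) Q₂, siteInner_sub_right,
      siteInner_sub_right, siteInner_comm Q₁ P₁, siteInner_comm Q₁ P₂, siteInner_comm Q₂ P₁, siteInner_comm Q₂ P₂]
    ring
  have hT1 : |siteInner P₁ Q₁| ≤ (4 + 2 * δ * Real.sqrt (8 * P.d / γ₀)) * Real.exp δ * Er *
      Real.sqrt (bondInner h h) * Real.sqrt (bondInner g g) := by
    have e1 : siteInner P₁ Q₁ = bondInner h (covDeriv C X (G' (adjD C X g))) := by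
      rw [hQ₁, siteInner_adjD, bondInner_comm]
    rw [e1]
    exact pairing_DGDt_regular_region C X ha hL hmsq hk1 hk Finset.univ hΩ hreg' hsmall hδ0 hδ h g
      (fun b hb => (hIn b hb).elim) (fun b hb => (hIn b hb).elim) r (fun b b' hb hb' => ⟨(hsep b b' hb hb').1, (hsep b b' hb hb').2.1⟩)
  have hT2 : |siteInner P₁ Q₂| ≤ (2 / Real.sqrt γ₀ + 4 * Real.sqrt P.d * δ / γ₀) * P.mesh k * Real.exp δ * Er *
      (ρ * Real.sqrt (bondInner h h)) * Real.sqrt (bondInner g g) := by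
    have e2 : siteInner P₁ Q₂ = siteInner (mP C A B h) (G' (adjD C X g)) := by rw [hQ₂, siteInner_comm]
    have hp := pairing_GDt_regular_region C ha hL hmsq hk1 hk Finset.univ hΩ X hreg' hsmall hδ0 hδ (mP C A B h) g
      (fun b hb => (hIn b hb).elim) r hsep2
    rw [e2]
    refine hp.trans ?_
    have hm := sqrt_siteInner_mP_le (C := C) (A := A) (B := B) hA h
    have hc : 0 ≤ (2 / Real.sqrt γ₀ + 4 * Real.sqrt P.d * δ / γ₀) * P.mesh k * Real.exp δ * Er := by positivity
    exact mul_le_mul_of_nonneg_right (mul_le_mul_of_nonneg_left hm hc) (Real.sqrt_nonneg _)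
  have hT3 : |siteInner P₂ Q₁| ≤ (2 / Real.sqrt γ₀ + 4 * Real.sqrt P.d * δ / γ₀) * P.mesh k * Real.exp δ * Er *
      Real.sqrt (bondInner h h) * (ρ * Real.sqrt (bondInner g g)) := by
    have e3 : siteInner P₂ Q₁ = bondInner h (covDeriv C X (G' (mP C A B g))) := by
      rw [hQ₁, siteInner_adjD, bondInner_comm]
    have hp := pairing_DG_regular_region C ha hL hmsq hk1 hk Finset.univ hΩ X hreg' hsmall hδ0 hδ h
      (fun b hb => (hIn b hb).elim) (mP C A B g) r hsep3
    rw [e3]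
    refine hp.trans ?_
    have hm := sqrt_siteInner_mP_le (C := C) (A := A) (B := B) hA g
    have hc : 0 ≤ (2 / Real.sqrt γ₀ + 4 * Real.sqrt P.d * δ / γ₀) * P.mesh k * Real.exp δ * Er *
        Real.sqrt (bondInner h h) := by positivity
    exact mul_le_mul_of_nonneg_left hm hc
  have hT4 : |siteInner P₂ Q₂| ≤ 2 / γ₀ * P.mesh k ^ 2 * Er * (ρ * Real.sqrt (bondInner h h)) * (ρ * Real.sqrt (bondInner g g)) := by
    have e4 : siteInner P₂ Q₂ = siteInner (mP C A B h) (G' (mP C A B g)) := by rw [hQ₂, siteInner_comm]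
    have hp := propagatorK_pairing_regular_region C ha hL hmsq hk1 hk Finset.univ hΩ X hreg' hsmall hδ0 hδ
      (mP C A B h) (mP C A B g) (fun x hx => absurd (Finset.mem_univ x) hx) r hsep4
    rw [e4]
    refine hp.trans ?_
    have hmh := sqrt_siteInner_mP_le (C := C) (A := A) (B := B) hA h
    have hmg := sqrt_siteInner_mP_le (C := C) (A := A) (B := B) hA g
    have hc : 0 ≤ 2 / γ₀ * P.mesh k ^ 2 * Er := by positivity
    exact mul_le_mul (mul_le_mul_of_nonneg_left hmh hc) hmg (Real.sqrt_nonneg _) (by positivity)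
  rw [hdecomp]
  have habs : |siteInner P₁ Q₁ - siteInner P₁ Q₂ - siteInner P₂ Q₁ + siteInner P₂ Q₂|
      ≤ |siteInner P₁ Q₁| + |siteInner P₁ Q₂| + |siteInner P₂ Q₁| + |siteInner P₂ Q₂| := by
    have h1 := abs_sub (siteInner P₁ Q₁ - siteInner P₁ Q₂ - siteInner P₂ Q₁) (-(siteInner P₂ Q₂))
    have h2 := abs_sub (siteInner P₁ Q₁ - siteInner P₁ Q₂) (siteInner P₂ Q₁)
    have h3 := abs_sub (siteInner P₁ Q₁) (siteInner P₁ Q₂)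
    rw [sub_neg_eq_add] at h1
    rw [abs_neg] at h1
    linarith
  refine habs.trans ?_
  have := add_le_add (add_le_add (add_le_add hT1 hT2) hT3) hT4
  refine this.trans (le_of_eq ?_)
  ring

end BadChain


/-! ## §8 (v1.2) Block sums of the columns: the averaging sources see a single top-scale bump -/

section Blocks

variable {k : ℕ}

/-- **A `k`-block sum of a scale-`j` profile** (`j ≤ k ≤ K`, `0 < δ ≤ 1`): `Σ_{y ∈ B^k(z̄)} e^{−(δ/L^j)|y−x′|} ≤
e^{δ/2}·N(8d/δ)^d·L^{jd}·e^{−(δ/(2L^k))|z−x′|}` — half of the decay is kept at the block scale (`|z − y| ≤ L^k − 1` inside a block,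
`B1Cor23ZeroFieldRegion.tdist_le_of_blockIter_eq_real`), the other half pays the volume `K_d(δ/(2L^j))` (`sum_exp_scale_le`).
[cite: Balaban1982Higgs1, (1.20) p.607] [cite: Balaban1983Higgs3, (2.10) p.426] -/
theorem sum_block_exp_le (hk : k ≤ P.K) {δ : ℝ} (hδ : 0 < δ) (hδ1 : δ ≤ 1) {j : ℕ} (hj : j ≤ k)
    (z x' : HiggsLattice.Site P 0) (i₀ : Ix N) :
    ∑ y ∈ HiggsAveraging.blockK k (blockIter k z), Real.exp (-(δ / (P.L : ℝ) ^ j * (HiggsLattice.Site.tdist y x' : ℝ)))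
      ≤ Real.exp (δ / 2) * ((nCol N : ℝ) * (4 * P.d / (δ / 2)) ^ P.d * ((P.L : ℝ) ^ j) ^ P.d) *
          Real.exp (-(δ / 2 / (P.L : ℝ) ^ k * (HiggsLattice.Site.tdist z x' : ℝ))) := by
  have hL1 : (1 : ℝ) ≤ (P.L : ℝ) := by exact_mod_cast P.hL
  have hLj : (0 : ℝ) < (P.L : ℝ) ^ j := by positivity
  have hLk : (0 : ℝ) < (P.L : ℝ) ^ k := by positivity
  have hjk : (P.L : ℝ) ^ j ≤ (P.L : ℝ) ^ k := pow_le_pow_right₀ hL1 hj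
  -- pointwise: e^{−(δ/L^j)t(y,x′)} ≤ e^{δ/2}·e^{−(δ/2L^k)t(z,x′)}·e^{−(δ/2L^j)t(y,x′)} for y in the block of z
  have hpt : ∀ y ∈ HiggsAveraging.blockK k (blockIter k z),
      Real.exp (-(δ / (P.L : ℝ) ^ j * (HiggsLattice.Site.tdist y x' : ℝ)))
        ≤ Real.exp (δ / 2) * Real.exp (-(δ / 2 / (P.L : ℝ) ^ k * (HiggsLattice.Site.tdist z x' : ℝ))) *
            Real.exp (-(δ / 2 / (P.L : ℝ) ^ j * (HiggsLattice.Site.tdist y x' : ℝ))) := by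
    intro y hy
    rw [HiggsAveraging.mem_blockK] at hy
    have hzy : (HiggsLattice.Site.tdist z y : ℝ) ≤ (P.L : ℝ) ^ k - 1 :=
      B1Cor23ZeroFieldRegion.tdist_le_of_blockIter_eq_real hk hy.symm
    have htri : (HiggsLattice.Site.tdist z x' : ℝ) ≤ (HiggsLattice.Site.tdist z y : ℝ) + (HiggsLattice.Site.tdist y x' : ℝ) :=
      B1Ineq234LevelZero.tdist_triangle_real z y x'
    have ht0 : (0 : ℝ) ≤ (HiggsLattice.Site.tdist y x' : ℝ) := Nat.cast_nonneg _
    rw [← Real.exp_add, ← Real.exp_add]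
    apply Real.exp_le_exp.mpr
    -- −(δ/L^j)t ≤ δ/2 − (δ/2L^k) t(z,x′) − (δ/2L^j) t
    have h1 : δ / 2 / (P.L : ℝ) ^ k * (HiggsLattice.Site.tdist z x' : ℝ)
        ≤ δ / 2 / (P.L : ℝ) ^ k * ((P.L : ℝ) ^ k - 1) + δ / 2 / (P.L : ℝ) ^ k * (HiggsLattice.Site.tdist y x' : ℝ) := by
      rw [← mul_add]; exact mul_le_mul_of_nonneg_left (htri.trans (by linarith)) (by positivity)
    have h2 : δ / 2 / (P.L : ℝ) ^ k * ((P.L : ℝ) ^ k - 1) ≤ δ / 2 := by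
      rw [div_mul_eq_mul_div, div_le_iff₀ hLk]; nlinarith
    have h3 : δ / 2 / (P.L : ℝ) ^ k * (HiggsLattice.Site.tdist y x' : ℝ) ≤ δ / 2 / (P.L : ℝ) ^ j * (HiggsLattice.Site.tdist y x' : ℝ) :=
      mul_le_mul_of_nonneg_right (div_le_div_of_nonneg_left (by positivity) hLj hjk) ht0
    have h4 : δ / (P.L : ℝ) ^ j * (HiggsLattice.Site.tdist y x' : ℝ)
        = δ / 2 / (P.L : ℝ) ^ j * (HiggsLattice.Site.tdist y x' : ℝ) + δ / 2 / (P.L : ℝ) ^ j * (HiggsLattice.Site.tdist y x' : ℝ) := by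
      ring
    linarith
  have hδ2 : δ / 2 ≤ 1 / 2 := by linarith
  calc ∑ y ∈ HiggsAveraging.blockK k (blockIter k z), Real.exp (-(δ / (P.L : ℝ) ^ j * (HiggsLattice.Site.tdist y x' : ℝ)))
      ≤ ∑ y ∈ HiggsAveraging.blockK k (blockIter k z),
          Real.exp (δ / 2) * Real.exp (-(δ / 2 / (P.L : ℝ) ^ k * (HiggsLattice.Site.tdist z x' : ℝ))) *
            Real.exp (-(δ / 2 / (P.L : ℝ) ^ j * (HiggsLattice.Site.tdist y x' : ℝ))) := Finset.sum_le_sum hpt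
    _ = Real.exp (δ / 2) * Real.exp (-(δ / 2 / (P.L : ℝ) ^ k * (HiggsLattice.Site.tdist z x' : ℝ))) *
          ∑ y ∈ HiggsAveraging.blockK k (blockIter k z),
            Real.exp (-(δ / 2 / (P.L : ℝ) ^ j * (HiggsLattice.Site.tdist y x' : ℝ))) := by rw [Finset.mul_sum]
    _ ≤ Real.exp (δ / 2) * Real.exp (-(δ / 2 / (P.L : ℝ) ^ k * (HiggsLattice.Site.tdist z x' : ℝ))) *
          ∑ y : HiggsLattice.Site P 0, Real.exp (-(δ / 2 / (P.L : ℝ) ^ j * (HiggsLattice.Site.tdist y x' : ℝ))) := by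
        refine mul_le_mul_of_nonneg_left ?_ (by positivity)
        exact Finset.sum_le_sum_of_subset_of_nonneg (Finset.subset_univ _) fun _ _ _ => Real.exp_nonneg _
    _ ≤ Real.exp (δ / 2) * Real.exp (-(δ / 2 / (P.L : ℝ) ^ k * (HiggsLattice.Site.tdist z x' : ℝ))) *
          ((nCol N : ℝ) * (4 * P.d / (δ / 2)) ^ P.d * ((P.L : ℝ) ^ j) ^ P.d) := by
        refine mul_le_mul_of_nonneg_left ?_ (by positivity)
        have hs := B3Op116ScaleChains.sum_site_le_sum_idx
          (fun y : HiggsLattice.Site P 0 => Real.exp (-(δ / 2 / (P.L : ℝ) ^ j * (HiggsLattice.Site.tdist y x' : ℝ))))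
          (fun _ => Real.exp_nonneg _) i₀
        refine hs.trans ?_
        simp_rw [B1Ineq234LevelZero.tdist_comm _ x']
        exact B3Op116ScaleChains.sum_exp_scale_le (half_pos hδ) hδ2 j x' i₀
    _ = _ := by ring

/-- scale algebra of a block average: `(L^jε)^{2−d}·(L^j)^d·(L^{kd})^{−1} = (L^jε)²·((L^kε)^d)^{−1}`. [cite: Balaban1983Higgs3, (2.10) p.426] -/
theorem blockavg_scale_algebra (j k : ℕ) :
    P.mesh j ^ ((2 : ℝ) - (P.d : ℝ)) * ((P.L : ℝ) ^ j) ^ P.d * (((P.L : ℝ) ^ (k * P.d))⁻¹)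
      = P.mesh j ^ (2 : ℝ) * (P.mesh k ^ P.d)⁻¹ := by
  have hL0 : (0 : ℝ) < (P.L : ℝ) := by have := P.hL; positivity
  have hm0 : 0 < P.mesh 0 := P.mesh_pos 0
  rw [Real.rpow_sub (P.mesh_pos j), Real.rpow_natCast,
    show P.mesh j = (P.L : ℝ) ^ j * P.mesh 0 by simp [HiggsLattice.Params.mesh],
    show P.mesh k = (P.L : ℝ) ^ k * P.mesh 0 by simp [HiggsLattice.Params.mesh], mul_pow, mul_pow, pow_mul]
  have h1 : ((P.L : ℝ) ^ j) ^ P.d ≠ 0 := by positivity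
  have h2 : ((P.L : ℝ) ^ k) ^ P.d ≠ 0 := by positivity
  have h3 : P.mesh 0 ^ P.d ≠ 0 := by positivity
  field_simp

variable {C : ChargeData N} {msq a : ℝ} {K₀ : ℕ} {hL1 : 1 < P.L} {δ₁ Cst : ℝ}

/-- **THE BLOCK-AVERAGED COLUMN IS A SINGLE TOP-SCALE BUMP** (`1 ≤ k ≤ K`, `0 < δ₁ ≤ 1`):
`L^{−kd}Σ_{y∈B^k(z̄)} κ_X(y,x′) ≤ [e^{δ₁/2}N(8d/δ₁)^d/(L²−1)]·ε^dC·(L^kε)^{2−d}·e^{−(δ₁/2)(L^kε)^{−1}ε|z−x′|}` — the averaging operators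
`Q_k`, `F_{2,k}` of the sources of THEOREM A read the columns of `G_k` through block averages, and a scale-`j` bump averaged over an
`L^k`-block is worth `(L^jε)²(L^kε)^{−d}` (`sum_block_exp_le`, `col_le`, `sum_mesh_rpow_le`). [cite: Balaban1982Higgs1, (1.20) p.607, (3.15) p.614] [cite: Balaban1983Higgs3, (2.10) p.426] -/
theorem block_avg_col_le {X : HiggsLattice.VecField P 0}
    (h210 : (regRegionKernels hL1 C Finset.univ X msq a k K₀).Ineq210 δ₁ Cst) (hmsq : 0 < msq) (ha : 0 < a)
    (hk : 1 ≤ k) (hkK : k ≤ P.K) (hδ₁ : 0 < δ₁) (hδ₁1 : δ₁ ≤ 1) (hCst : 0 ≤ Cst) (i₀ : Ix N)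
    (z x' : HiggsLattice.Site P 0) :
    ((P.L : ℝ) ^ (k * P.d))⁻¹ * ∑ y ∈ HiggsAveraging.blockK k (blockIter k z), col C msq a k X y x'
      ≤ (Real.exp (δ₁ / 2) * ((nCol N : ℝ) * (4 * P.d / (δ₁ / 2)) ^ P.d) / ((P.L : ℝ) ^ (2 : ℝ) - 1)) *
          (P.mesh 0 ^ P.d * Cst) * (P.mesh k ^ (2 : ℝ) * (P.mesh k ^ P.d)⁻¹) *
          Real.exp (-(δ₁ / 2 * (P.mesh k)⁻¹ * (P.mesh 0 * (HiggsLattice.Site.tdist z x' : ℝ)))) := by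
  have hL1' : (1 : ℝ) < (P.L : ℝ) := by exact_mod_cast hL1
  have hLk0 : (0 : ℝ) < ((P.L : ℝ) ^ (k * P.d))⁻¹ := by positivity
  have hc : 0 ≤ P.mesh 0 ^ P.d * Cst := mul_nonneg (pow_nonneg (P.mesh_pos 0).le _) hCst
  set E : ℝ := Real.exp (-(δ₁ / 2 * (P.mesh k)⁻¹ * (P.mesh 0 * (HiggsLattice.Site.tdist z x' : ℝ)))) with hE
  set Kb : ℝ := Real.exp (δ₁ / 2) * ((nCol N : ℝ) * (4 * P.d / (δ₁ / 2)) ^ P.d) with hKb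
  have hKb0 : 0 ≤ Kb := by
    have : 0 ≤ (4 * (P.d : ℝ) / (δ₁ / 2)) ^ P.d := pow_nonneg (by positivity) _
    rw [hKb]; positivity
  -- step 1: the columns by their majorants, sums exchanged
  have step1 : ∑ y ∈ HiggsAveraging.blockK k (blockIter k z), col C msq a k X y x'
      ≤ ∑ j ∈ Finset.range k, (P.mesh 0 ^ P.d * Cst) * P.mesh j ^ ((2 : ℝ) - (P.d : ℝ)) *
          ∑ y ∈ HiggsAveraging.blockK k (blockIter k z),
            Real.exp (-(δ₁ / (P.L : ℝ) ^ j * (HiggsLattice.Site.tdist y x' : ℝ))) := by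
    calc ∑ y ∈ HiggsAveraging.blockK k (blockIter k z), col C msq a k X y x'
        ≤ ∑ y ∈ HiggsAveraging.blockK k (blockIter k z), ∑ j ∈ Finset.range k,
            (P.mesh 0 ^ P.d * Cst) * P.mesh j ^ ((2 : ℝ) - (P.d : ℝ)) *
              Real.exp (-(δ₁ / (P.L : ℝ) ^ j * (HiggsLattice.Site.tdist y x' : ℝ))) := by
          refine Finset.sum_le_sum fun y _ => (col_le h210 hmsq ha hk hkK y x').trans (le_of_eq ?_)
          simp only [B3Op116ScaleChains.rate_eq]
      _ = _ := by rw [Finset.sum_comm]; simp_rw [Finset.mul_sum]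
  -- step 2: each block sum
  have step2 : ∀ j ∈ Finset.range k,
      (P.mesh 0 ^ P.d * Cst) * P.mesh j ^ ((2 : ℝ) - (P.d : ℝ)) *
          ∑ y ∈ HiggsAveraging.blockK k (blockIter k z), Real.exp (-(δ₁ / (P.L : ℝ) ^ j * (HiggsLattice.Site.tdist y x' : ℝ)))
        ≤ (P.mesh 0 ^ P.d * Cst) * Kb * E * (P.mesh j ^ ((2 : ℝ) - (P.d : ℝ)) * ((P.L : ℝ) ^ j) ^ P.d) := by
    intro j hj
    have hjk : j ≤ k := (Finset.mem_range.1 hj).le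
    have hb := sum_block_exp_le (N := N) hkK hδ₁ hδ₁1 hjk z x' i₀
    have hE' : Real.exp (-(δ₁ / 2 / (P.L : ℝ) ^ k * (HiggsLattice.Site.tdist z x' : ℝ))) = E := by
      rw [hE, ← B3Op116ScaleChains.rate_eq]
    rw [hE'] at hb
    have hℓ : 0 ≤ (P.mesh 0 ^ P.d * Cst) * P.mesh j ^ ((2 : ℝ) - (P.d : ℝ)) :=
      mul_nonneg hc (Real.rpow_nonneg (P.mesh_pos j).le _)
    refine (mul_le_mul_of_nonneg_left hb hℓ).trans (le_of_eq ?_)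
    rw [hKb]; ring
  -- step 3: the scale sum
  have step3 : ∑ j ∈ Finset.range k, P.mesh j ^ ((2 : ℝ) - (P.d : ℝ)) * ((P.L : ℝ) ^ j) ^ P.d * ((P.L : ℝ) ^ (k * P.d))⁻¹
      ≤ P.mesh k ^ (2 : ℝ) / ((P.L : ℝ) ^ (2 : ℝ) - 1) * (P.mesh k ^ P.d)⁻¹ := by
    simp_rw [blockavg_scale_algebra]
    rw [← Finset.sum_mul]
    refine mul_le_mul_of_nonneg_right (B3Op116ScaleChains.sum_mesh_rpow_le (by norm_num) hL1 k)
      (inv_nonneg.mpr (pow_nonneg (P.mesh_pos k).le _))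
  -- assemble
  calc ((P.L : ℝ) ^ (k * P.d))⁻¹ * ∑ y ∈ HiggsAveraging.blockK k (blockIter k z), col C msq a k X y x'
      ≤ ((P.L : ℝ) ^ (k * P.d))⁻¹ * ∑ j ∈ Finset.range k,
          (P.mesh 0 ^ P.d * Cst) * Kb * E * (P.mesh j ^ ((2 : ℝ) - (P.d : ℝ)) * ((P.L : ℝ) ^ j) ^ P.d) :=
        mul_le_mul_of_nonneg_left (step1.trans (Finset.sum_le_sum step2)) hLk0.le
    _ = (P.mesh 0 ^ P.d * Cst) * Kb * E *
          ∑ j ∈ Finset.range k, P.mesh j ^ ((2 : ℝ) - (P.d : ℝ)) * ((P.L : ℝ) ^ j) ^ P.d * ((P.L : ℝ) ^ (k * P.d))⁻¹ := by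
        rw [Finset.mul_sum, Finset.mul_sum]
        exact Finset.sum_congr rfl fun j _ => by ring
    _ ≤ (P.mesh 0 ^ P.d * Cst) * Kb * E * (P.mesh k ^ (2 : ℝ) / ((P.L : ℝ) ^ (2 : ℝ) - 1) * (P.mesh k ^ P.d)⁻¹) :=
        mul_le_mul_of_nonneg_left step3 (by positivity)
    _ = _ := by rw [hKb]; ring

end Blocks


/-! ## §9 (v1.3) The averaging sources through a linear functional: block averages of `‖w‖` -/

section Averaging

variable (C : ChargeData N) (A B : HiggsLattice.VecField P 0) (k : ℕ)

/-- `‖(Q_k(X)w)(ȳ)‖ ≤ L^{−kd}Σ_{x∈B^k(ȳ)}‖w(x)‖` (unitary transports). [cite: Balaban1982Higgs1, (2.11) p.609] -/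
theorem norm_avgQkLin_apply_le_block (X : HiggsLattice.VecField P 0) (w : ScalarField P 0 N) (y : HiggsLattice.Site P k) :
    ‖HiggsCovariance.avgQkLin C X k w y‖ ≤ ((P.L : ℝ) ^ (k * P.d))⁻¹ * ∑ x ∈ HiggsAveraging.blockK k y, ‖w x‖ := by
  have hLpos : (0 : ℝ) < ((P.L : ℝ) ^ (k * P.d))⁻¹ := inv_pos.mpr (pow_pos (by exact_mod_cast P.hL) _)
  rw [HiggsCovariance.avgQkLin_apply, HiggsAveraging.avgQk_apply, norm_smul, Real.norm_eq_abs, abs_of_pos hLpos]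
  refine mul_le_mul_of_nonneg_left ((norm_sum_le _ _).trans (Finset.sum_le_sum fun x _ => ?_)) hLpos.le
  rw [B3Op116Pieces.norm_U_apply]

variable {C A B k}

/-- **The averaging sources through a vector-valued linear functional, by block averages**: for `sup_b|A_b| ≤ s`, `k ≤ K`,
`m = |e|sεd(L^k−1)`: `‖T(avgSrc w)‖ ≤ m(2 + m)·Σ_y κ_T(y)·L^{−kd}Σ_{x∈B^k(ȳ)}‖w(x)‖` (`norm_mapE_avgSrc_le` + p40's
`norm_fTwo_apply_le` + `norm_avgQkLin_apply_le_block`). [cite: Balaban1982Higgs1, (3.15)–(3.16) pp.614–615] -/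
theorem norm_mapE_avgSrc_le_block {M' : Type*} [NormedAddCommGroup M'] [NormedSpace ℝ M']
    (T : ScalarField P 0 N →ₗ[ℝ] M') (hk : k ≤ P.K) {s : ℝ} (hs : 0 ≤ s)
    (hA : ∀ b : HiggsLattice.PBond P 0, |A b| ≤ s) (w : ScalarField P 0 N) :
    ‖T (B3Op116SourceForm.avgSrc C A B k w)‖
      ≤ ∑ y : HiggsLattice.Site P 0,
          ((|C.e| * s * P.mesh 0 * (P.d * ((P.L : ℝ) ^ k - 1))) * (2 + |C.e| * s * P.mesh 0 * (P.d * ((P.L : ℝ) ^ k - 1))) *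
            (((P.L : ℝ) ^ (k * P.d))⁻¹ * ∑ x ∈ HiggsAveraging.blockK k (blockIter k y), ‖w x‖)) *
          ∑ i : Ix N, ‖T (cb P N 0 (y, i))‖ := by
  set m : ℝ := |C.e| * s * P.mesh 0 * (P.d * ((P.L : ℝ) ^ k - 1)) with hm
  have hL1 : (1 : ℝ) ≤ (P.L : ℝ) ^ k := one_le_pow₀ (by exact_mod_cast P.hL)
  have hm0 : 0 ≤ m := by
    have : (0 : ℝ) ≤ (P.L : ℝ) ^ k - 1 := by linarith
    have := P.mesh_pos 0
    rw [hm]; positivity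
  refine (B3Op116SourceForm.norm_mapE_avgSrc_le C A B k T hk hs hA w).trans (Finset.sum_le_sum fun y _ => ?_)
  refine mul_le_mul_of_nonneg_right ?_ (Finset.sum_nonneg fun _ _ => norm_nonneg _)
  set avg : ℝ := ((P.L : ℝ) ^ (k * P.d))⁻¹ * ∑ x ∈ HiggsAveraging.blockK k (blockIter k y), ‖w x‖ with havg
  have havg0 : 0 ≤ avg := mul_nonneg (inv_nonneg.mpr (pow_nonneg (Nat.cast_nonneg _) _))
    (Finset.sum_nonneg fun _ _ => norm_nonneg _)
  have hQ : ‖HiggsCovariance.avgQkLin C B k w (blockIter k y)‖ ≤ avg := norm_avgQkLin_apply_le_block C k B w _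
  have hF : ‖B3Op116Pieces.fTwo C A B k w (blockIter k y)‖ ≤ m * avg := B3Op116Pieces.norm_fTwo_apply_le C A B k hk hs hA w _
  have h3 := add_le_add (add_le_add (mul_le_mul_of_nonneg_left hQ hm0) hF) (mul_le_mul_of_nonneg_left hF hm0)
  refine h3.trans (le_of_eq ?_)
  ring

end Averaging


/-! ## §10 (v1.3) Conversions for the assembly: sites to bonds, weaker rates, more scales, the top bump as a majorant -/

section Conversions

variable {k : ℕ}

/-- A site sum of a nonnegative function is below the bond sum read at the base points (`d ≥ 1`: every site is the base of `d` bonds).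
[cite: Balaban1982Higgs1, (1.4) p.604] -/
theorem sum_site_le_sum_bond_src (f : HiggsLattice.Site P 0 → ℝ) (hf : ∀ y, 0 ≤ f y) :
    ∑ y : HiggsLattice.Site P 0, f y ≤ ∑ b : HiggsLattice.PBond P 0, f b.src := by
  rw [← sum_site_dir (fun y (_ : Fin P.d) => f y)]
  refine Finset.sum_le_sum fun y _ => ?_
  rw [Finset.sum_const, Finset.card_univ, Fintype.card_fin, nsmul_eq_mul]
  have h1 : (1 : ℝ) ≤ (P.d : ℝ) := by exact_mod_cast P.hd
  nlinarith [hf y]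

/-- **Monotonicity of the majorants**: a smaller rate and more scales give a larger majorant (`c ≥ 0`).
[cite: Balaban1983Higgs3, (2.10) p.426] -/
theorem majorant_mono {c a δ δ' : ℝ} (hc : 0 ≤ c) (hδ : δ' ≤ δ) {k k' : ℕ} (hk : k ≤ k')
    (u v : HiggsLattice.Site P 0) :
    ∑ j ∈ Finset.range k, c * P.mesh j ^ a * Real.exp (-(δ * (P.mesh j)⁻¹ * (P.mesh 0 * (HiggsLattice.Site.tdist u v : ℝ))))
      ≤ ∑ j ∈ Finset.range k', c * P.mesh j ^ a *
          Real.exp (-(δ' * (P.mesh j)⁻¹ * (P.mesh 0 * (HiggsLattice.Site.tdist u v : ℝ)))) := by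
  have hterm : ∀ j, 0 ≤ c * P.mesh j ^ a * Real.exp (-(δ' * (P.mesh j)⁻¹ * (P.mesh 0 * (HiggsLattice.Site.tdist u v : ℝ)))) :=
    fun j => mul_nonneg (mul_nonneg hc (Real.rpow_nonneg (P.mesh_pos j).le a)) (Real.exp_nonneg _)
  calc ∑ j ∈ Finset.range k, c * P.mesh j ^ a * Real.exp (-(δ * (P.mesh j)⁻¹ * (P.mesh 0 * (HiggsLattice.Site.tdist u v : ℝ))))
      ≤ ∑ j ∈ Finset.range k, c * P.mesh j ^ a *
          Real.exp (-(δ' * (P.mesh j)⁻¹ * (P.mesh 0 * (HiggsLattice.Site.tdist u v : ℝ)))) := by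
        refine Finset.sum_le_sum fun j _ => mul_le_mul_of_nonneg_left ?_ (mul_nonneg hc (Real.rpow_nonneg (P.mesh_pos j).le a))
        apply Real.exp_le_exp.mpr
        have ht : 0 ≤ (P.mesh j)⁻¹ * (P.mesh 0 * (HiggsLattice.Site.tdist u v : ℝ)) := by
          have := P.mesh_pos j; have := P.mesh_pos 0; positivity
        nlinarith
    _ ≤ _ := Finset.sum_le_sum_of_subset_of_nonneg (Finset.range_subset_range.mpr hk) fun j _ _ => hterm j

/-- **The top-scale bump is below the majorant with one more scale**: a single term `c(L^kε)^a e^{−δ(L^kε)^{−1}ε|u−v|}` is one of the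
summands of `Σ_{j<k+1}` (`c ≥ 0`). [cite: Balaban1983Higgs3, (2.10) p.426] -/
theorem top_bump_le_majorant_succ {c a δ : ℝ} (hc : 0 ≤ c) (u v : HiggsLattice.Site P 0) :
    c * P.mesh k ^ a * Real.exp (-(δ * (P.mesh k)⁻¹ * (P.mesh 0 * (HiggsLattice.Site.tdist u v : ℝ))))
      ≤ ∑ j ∈ Finset.range (k + 1), c * P.mesh j ^ a *
          Real.exp (-(δ * (P.mesh j)⁻¹ * (P.mesh 0 * (HiggsLattice.Site.tdist u v : ℝ)))) := by
  have hterm : ∀ j ∈ Finset.range (k + 1),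
      0 ≤ c * P.mesh j ^ a * Real.exp (-(δ * (P.mesh j)⁻¹ * (P.mesh 0 * (HiggsLattice.Site.tdist u v : ℝ)))) :=
    fun j _ => mul_nonneg (mul_nonneg hc (Real.rpow_nonneg (P.mesh_pos j).le a)) (Real.exp_nonneg _)
  exact Finset.single_le_sum hterm (Finset.self_mem_range_succ k)

/-- `(L^kε)²·((L^kε)^d)^{−1} = (L^kε)^{2−d}` (the exponent of `block_avg_col_le` as a real power). [cite: Balaban1983Higgs3, (2.10) p.426] -/
theorem mesh_sq_mul_inv_pow_eq (k : ℕ) : P.mesh k ^ (2 : ℝ) * (P.mesh k ^ P.d)⁻¹ = P.mesh k ^ ((2 : ℝ) - (P.d : ℝ)) := by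
  rw [Real.rpow_sub (P.mesh_pos k), Real.rpow_natCast, div_eq_mul_inv]

/-- **The block-averaged column as a majorant with one more scale at half the rate** — the form in which the chain lemmas
(`bond_chain3_le'`, applied with `k + 1` and `δ₁/2`) consume the averaging sources. [cite: Balaban1983Higgs3, (1.16) p.414, (2.10) p.426] -/
theorem block_avg_col_le_majorant {C : ChargeData N} {msq a : ℝ} {K₀ : ℕ} {hL1 : 1 < P.L} {δ₁ Cst : ℝ} {X : HiggsLattice.VecField P 0}
    (h210 : (regRegionKernels hL1 C Finset.univ X msq a k K₀).Ineq210 δ₁ Cst) (hmsq : 0 < msq) (ha : 0 < a)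
    (hk : 1 ≤ k) (hkK : k ≤ P.K) (hδ₁ : 0 < δ₁) (hδ₁1 : δ₁ ≤ 1) (hCst : 0 ≤ Cst) (i₀ : Ix N)
    (z x' : HiggsLattice.Site P 0) :
    ((P.L : ℝ) ^ (k * P.d))⁻¹ * ∑ y ∈ HiggsAveraging.blockK k (blockIter k z), col C msq a k X y x'
      ≤ ∑ j ∈ Finset.range (k + 1),
          ((Real.exp (δ₁ / 2) * ((nCol N : ℝ) * (4 * P.d / (δ₁ / 2)) ^ P.d) / ((P.L : ℝ) ^ (2 : ℝ) - 1)) *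
            (P.mesh 0 ^ P.d * Cst)) * P.mesh j ^ ((2 : ℝ) - (P.d : ℝ)) *
          Real.exp (-(δ₁ / 2 * (P.mesh j)⁻¹ * (P.mesh 0 * (HiggsLattice.Site.tdist z x' : ℝ)))) := by
  have hL1' : (1 : ℝ) < (P.L : ℝ) := by exact_mod_cast hL1
  have hc : 0 ≤ (Real.exp (δ₁ / 2) * ((nCol N : ℝ) * (4 * P.d / (δ₁ / 2)) ^ P.d) / ((P.L : ℝ) ^ (2 : ℝ) - 1)) *
      (P.mesh 0 ^ P.d * Cst) := by
    have h1 : 0 < (P.L : ℝ) ^ (2 : ℝ) - 1 := by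
      have : (1 : ℝ) < (P.L : ℝ) ^ (2 : ℝ) := Real.one_lt_rpow hL1' (by norm_num)
      linarith
    have h2 : 0 ≤ (4 * (P.d : ℝ) / (δ₁ / 2)) ^ P.d := pow_nonneg (by positivity) _
    have h3 := P.mesh_pos 0
    positivity
  refine (block_avg_col_le h210 hmsq ha hk hkK hδ₁ hδ₁1 hCst i₀ z x').trans ?_
  rw [mesh_sq_mul_inv_pow_eq]
  exact top_bump_le_majorant_succ hc z x'

end Conversions


/-! ## §11 (v1.3) The derivative row of `G_k(T,X)V_k(A,B)w` with the dipole sources resummed into `D^{ε*}_B` -/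

section DRow

variable (C : ChargeData N) (A B X : HiggsLattice.VecField P 0) (msq a : ℝ) (k : ℕ)

/-- the bond field of the `D^*M` charges of `w`: `g_w(b′) = M_{b′}w(b′₊)`. [cite: Balaban1982Higgs1, (3.16) p.615] -/
def gM (w : ScalarField P 0 N) : HiggsLattice.PBond P 0 → E N := fun b' => mulM C A B b' (w b'.tgt)

/-- **The derivative row identity on the torus**: for every linear functional `T`,
`T(V_k(A,B)w) = −Σ_{b′}[T srcMD_{b′}w + T srcMM_{b′}w] − T(D^{ε*}_B g_w) − a_k(L^kε)^{−2}T(avgSrc w)` — the `ε^{−1}`-dipole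
sources of THEOREM A resummed into the divergence (`inv_smul_sum_dip_eq_adjCovDeriv`). [cite: Balaban1982Higgs1, (3.16) p.615] [cite: Balaban1983Higgs3, (1.16) p.414] -/
theorem map_srcV_univ_eq {M' : Type*} [AddCommGroup M'] [Module ℝ M'] (T : ScalarField P 0 N →ₗ[ℝ] M') (w : ScalarField P 0 N) :
    T (B3Op116SourceForm.srcV C A B k Finset.univ a w)
      = -(∑ b' : HiggsLattice.PBond P 0,
            (T (B3Op116SourceForm.srcMD C A B b' w) + T (B3Op116SourceForm.srcMM C A B b' w)))
        - T (adjD C B (gM C A B w))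
        - (B1.aSeq a P.L k * ((P.mesh k)⁻¹ ^ 2)) • T (B3Op116SourceForm.avgSrc C A B k w) := by
  rw [B3Op116SourceForm.map_srcV]
  have hIn : ∀ b : HiggsLattice.PBond P 0, Inside (Finset.univ : Finset (HiggsLattice.Site P 0)) b :=
    fun b => ⟨Finset.mem_univ _, Finset.mem_univ _⟩
  simp only [if_pos (hIn _)]
  -- the adjoint derivative of the charges IS ε⁻¹ Σ_b dip_b
  have hadj : adjD C B (gM C A B w) = (P.mesh 0)⁻¹ • ∑ b' : HiggsLattice.PBond P 0, B3Op116SourceForm.srcDM C A B b' w := by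
    unfold adjD B3Op116SourceForm.srcDM gM
    rw [inv_smul_sum_dip_eq_adjCovDeriv]
  have hdip : ∑ b' : HiggsLattice.PBond P 0, (P.mesh 0)⁻¹ • T (B3Op116SourceForm.srcDM C A B b' w)
      = T (adjD C B (gM C A B w)) := by
    rw [hadj, map_smul, map_sum, Finset.smul_sum]
  rw [← hdip]
  simp only [Finset.sum_add_distrib]
  abel

/-- **The derivative row of `G_k(T,X)V_k(A,B)w` with the ninth-chain field isolated**: for `sup_b|A_b| ≤ s`,
`‖(D^ε_BG_k(T,X)V_kw)(b)‖ ≤ Σ_{b′}[|e|s‖D_Bw(b′)‖ + (|e|s)²‖w(b′₊)‖]·κ^D_{B,X}(b,b′₊) + ‖(D^ε_BG_k(T,X)D^{ε*}_Bg_w)(b)‖ +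
|a_k|(L^kε)^{−2}‖(D^ε_BG_k(T,X)avgSrc w)(b)‖`. [cite: Balaban1983Higgs3, (1.16) p.414] [cite: Balaban1982Higgs1, (3.16) p.615] -/
theorem norm_covDeriv_G_srcV_le {s : ℝ} (hA : ∀ b : HiggsLattice.PBond P 0, |A b| ≤ s) (w : ScalarField P 0 N)
    (b : HiggsLattice.PBond P 0) :
    ‖covDeriv C B (propagatorK C Finset.univ X msq a k (B3Op116SourceForm.srcV C A B k Finset.univ a w)) b‖
      ≤ (∑ b' : HiggsLattice.PBond P 0,
          (|C.e| * s * ‖covDeriv C B w b'‖ + (|C.e| * s) ^ 2 * ‖w b'.tgt‖) * dcol C msq a k B X b b'.tgt)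
        + ‖covDeriv C B (propagatorK C Finset.univ X msq a k (adjD C B (gM C A B w))) b‖
        + |B1.aSeq a P.L k| * (P.mesh k)⁻¹ ^ 2 *
            ‖covDeriv C B (propagatorK C Finset.univ X msq a k (B3Op116SourceForm.avgSrc C A B k w)) b‖ := by
  have h := map_srcV_univ_eq C A B a k
    (B3Op116SourceForm.covDerivAt C B b ∘ₗ (propagatorK C Finset.univ X msq a k : ScalarField P 0 N →ₗ[ℝ] ScalarField P 0 N)) w
  simp only [LinearMap.coe_comp, Function.comp_apply, B3Op116SourceForm.covDerivAt_apply] at h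
  rw [h]
  refine (norm_sub_le _ _).trans (add_le_add ((norm_sub_le _ _).trans (add_le_add ?_ le_rfl)) ?_)
  · rw [norm_neg]
    refine (norm_sum_le _ _).trans (Finset.sum_le_sum fun b' _ => (norm_add_le _ _).trans ?_)
    rw [add_mul]
    refine add_le_add ?_ ?_
    · have h1 := B3Op116SourceForm.norm_mapE_srcMD_le C A B
        (B3Op116SourceForm.covDerivAt C B b ∘ₗ (propagatorK C Finset.univ X msq a k : ScalarField P 0 N →ₗ[ℝ] ScalarField P 0 N))
        (hA b') w
      simp only [LinearMap.coe_comp, Function.comp_apply, B3Op116SourceForm.covDerivAt_apply] at h1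
      exact h1
    · have h1 := B3Op116SourceForm.norm_mapE_srcMM_le C A B
        (B3Op116SourceForm.covDerivAt C B b ∘ₗ (propagatorK C Finset.univ X msq a k : ScalarField P 0 N →ₗ[ℝ] ScalarField P 0 N))
        (hA b') w
      simp only [LinearMap.coe_comp, Function.comp_apply, B3Op116SourceForm.covDerivAt_apply] at h1
      exact h1
  · rw [norm_smul, Real.norm_eq_abs, abs_mul, abs_of_nonneg (pow_nonneg (inv_nonneg.mpr (P.mesh_pos k).le) 2)]

end DRow


/-! ## §12 (v1.3) The ninth term of the outer row by Cauchy–Schwarz (uniform bound, no decay) -/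

section NinthTerm

variable {C : ChargeData N} {A B : HiggsLattice.VecField P 0} {msq a : ℝ} {k K₀ : ℕ} {hL1 : 1 < P.L} {δ₁ Cst : ℝ}

/-- `Σ_b‖Z(b)‖² = ε^{−d}⟨Z, Z⟩_{bonds}`. [cite: Balaban1982Higgs1, (1.5) p.604] -/
theorem sum_norm_sq_eq_inv_mul_bondInner (Z : HiggsLattice.PBond P 0 → E N) :
    ∑ b : HiggsLattice.PBond P 0, ‖Z b‖ ^ 2 = (P.mesh 0 ^ P.d)⁻¹ * bondInner Z Z := by
  have hε : P.mesh 0 ^ P.d ≠ 0 := (pow_pos (P.mesh_pos 0) _).ne'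
  unfold bondInner
  rw [Finset.mul_sum]
  refine Finset.sum_congr rfl fun b _ => ?_
  rw [real_inner_self_eq_norm_sq, ← mul_assoc, inv_mul_cancel₀ hε, one_mul]

/-- `Σ_b F(b₊) = d·Σ_y F(y)` (heads: the shift is a bijection in every direction). [cite: Balaban1982Higgs1, (1.4) p.604] -/
theorem sum_bond_tgt_eq (F : HiggsLattice.Site P 0 → ℝ) :
    ∑ b : HiggsLattice.PBond P 0, F b.tgt = (P.d : ℝ) * ∑ y : HiggsLattice.Site P 0, F y := by
  have h0 : ∑ b : HiggsLattice.PBond P 0, F b.tgt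
      = ∑ b : HiggsLattice.PBond P 0, (fun (y : HiggsLattice.Site P 0) (μ : Fin P.d) => F (y.shift μ)) b.src b.dir :=
    Finset.sum_congr rfl fun b _ => rfl
  rw [h0, ← sum_site_dir (fun y μ => F (y.shift μ)), Finset.sum_comm]
  have h : ∀ μ : Fin P.d, ∑ y : HiggsLattice.Site P 0, F (y.shift μ) = ∑ y : HiggsLattice.Site P 0, F y :=
    fun μ => Fintype.sum_equiv (shiftEquiv P 0 μ) _ _ fun _ => rfl
  simp only [h, Finset.sum_const, Finset.card_univ, Fintype.card_fin, nsmul_eq_mul]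

/-- **The `ℓ²`-column of `G_k(T_ε,X)`** (`d ≤ 3`, `1 ≤ k ≤ K`, `0 < δ₁ ≤ 1`): `Σ_y ε^d κ_X(y,x′)² ≤ (ε^dC)²K_sq(L^kε)^{4−d}` and the same
for `Σ_y ε^d κ_X(x,y)²` — r14's `sq_col_le` at the rate `δ₁/2`. [cite: Balaban1983Higgs3, (2.10) p.426] -/
theorem sum_sq_col_le {X : HiggsLattice.VecField P 0}
    (h210 : (regRegionKernels hL1 C Finset.univ X msq a k K₀).Ineq210 δ₁ Cst) (hmsq : 0 < msq) (ha : 0 < a)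
    (hk : 1 ≤ k) (hkK : k ≤ P.K) (hδ₁ : 0 < δ₁) (hδ₁1 : δ₁ ≤ 1) (hCst : 0 ≤ Cst) (hd3 : P.d ≤ 3) (i₀ : Ix N)
    (x' : HiggsLattice.Site P 0) :
    (∑ y : HiggsLattice.Site P 0, P.mesh 0 ^ P.d * col C msq a k X y x' ^ 2
      ≤ (P.mesh 0 ^ P.d * Cst) ^ 2 * ((nCol N : ℝ) * (4 * P.d / (δ₁ / 2)) ^ P.d) /
          ((P.L : ℝ) ^ (((4 : ℝ) - (P.d : ℝ)) / 2) - 1) ^ 2 * P.mesh k ^ ((4 : ℝ) - (P.d : ℝ))) ∧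
    (∑ y : HiggsLattice.Site P 0, P.mesh 0 ^ P.d * col C msq a k X x' y ^ 2
      ≤ (P.mesh 0 ^ P.d * Cst) ^ 2 * ((nCol N : ℝ) * (4 * P.d / (δ₁ / 2)) ^ P.d) /
          ((P.L : ℝ) ^ (((4 : ℝ) - (P.d : ℝ)) / 2) - 1) ^ 2 * P.mesh k ^ ((4 : ℝ) - (P.d : ℝ))) := by
  have hc : 0 ≤ P.mesh 0 ^ P.d * Cst := mul_nonneg (pow_nonneg (P.mesh_pos 0).le _) hCst
  have hδ2 : 0 < δ₁ / 2 := half_pos hδ₁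
  have hδ22 : δ₁ / 2 ≤ 1 / 2 := by linarith
  set K : HiggsLattice.Site P 0 → ℕ → HiggsLattice.Site P 0 → ℝ := fun u j y =>
    (P.mesh 0 ^ P.d * Cst) * P.mesh j ^ ((2 : ℝ) - (P.d : ℝ)) *
      Real.exp (-(δ₁ / 2 * (P.mesh j)⁻¹ * (P.mesh 0 * (HiggsLattice.Site.tdist y u : ℝ)))) with hKdef
  have hK0 : ∀ u j y, 0 ≤ K u j y := fun u j y =>
    mul_nonneg (mul_nonneg hc (Real.rpow_nonneg (P.mesh_pos j).le _)) (Real.exp_nonneg _)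
  have hKle : ∀ u j, j < k → ∀ y, |K u j y| ≤ (P.mesh 0 ^ P.d * Cst) * P.mesh j ^ ((2 : ℝ) - (P.d : ℝ)) *
      Real.exp (-(δ₁ / 2 * (P.mesh j)⁻¹ * (P.mesh 0 * (HiggsLattice.Site.tdist y u : ℝ)))) :=
    fun u j _ y => by rw [abs_of_nonneg (hK0 u j y)]
  have hsq := fun u => B3Op116ScaleChains.sq_col_le (N := N) (k := k) hL1 hd3 hc hδ2 hδ22 u i₀ (K u) (hKle u)
  -- the columns below Σ_j |K j y| (rate halved)
  have hcol1 : ∀ y, col C msq a k X y x' ≤ ∑ j ∈ Finset.range k, |K x' j y| := by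
    intro y
    refine ((col_le h210 hmsq ha hk hkK y x').trans (majorant_mono (δ := δ₁) (δ' := δ₁ / 2) hc (by linarith) le_rfl y x')).trans
      (le_of_eq ?_)
    exact Finset.sum_congr rfl fun j _ => by rw [abs_of_nonneg (hK0 x' j y)]
  have hcol2 : ∀ y, col C msq a k X x' y ≤ ∑ j ∈ Finset.range k, |K x' j y| := by
    intro y
    refine ((col_le h210 hmsq ha hk hkK x' y).trans (majorant_mono (δ := δ₁) (δ' := δ₁ / 2) hc (by linarith) le_rfl x' y)).trans
      (le_of_eq ?_)
    refine Finset.sum_congr rfl fun j _ => ?_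
    rw [abs_of_nonneg (hK0 x' j y), hKdef]
    simp only [B1Ineq234LevelZero.tdist_comm x' y]
  have hε : 0 ≤ P.mesh 0 ^ P.d := pow_nonneg (P.mesh_pos 0).le _
  constructor
  · refine le_trans (Finset.sum_le_sum fun y _ => mul_le_mul_of_nonneg_left
      (pow_le_pow_left₀ (col_nonneg (C := C) (msq := msq) (a := a) (k := k) X y x') (hcol1 y) 2) hε) (hsq x')
  · refine le_trans (Finset.sum_le_sum fun y _ => mul_le_mul_of_nonneg_left
      (pow_le_pow_left₀ (col_nonneg (C := C) (msq := msq) (a := a) (k := k) X x' y) (hcol2 y) 2) hε) (hsq x')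

/-- **THE NINTH TERM OF THE OUTER ROW, UNIFORMLY IN `k`** (VALUE clause, `n = n′ = 1`, torus; `d ≤ 3`): with `w₀ = G_k(T_ε,B)e_{(x′,i′)}`,
`g(b′) = M_{b′}w₀(b′₊)` and `Z = D^ε_BG_k(T_ε,A+B)D^{ε*}_Bg`:
`Σ_b κ_B(x,b₊)‖Z(b)‖ ≤ K_bad·|e|s·d·ε^{−d}·(ε^dC)²K_sq(L^kε)^{4−d}` — Cauchy–Schwarz over bonds, `sqrt_bondInner_DGDt_le`, p40's
`sum_inside_norm_mulM_sq_le`, and the two `ℓ²`-columns `sum_sq_col_le`; multiplied by the outer `|e|s` this is `ε^d·t²·(L^kε)^{2−d}·O(1)`,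
`t = L^kε|e|s` — no logarithm of `k`. [cite: Balaban1983Higgs3, (1.16) p.414] [cite: Balaban1983RegularityDecay, Cor. 2.3 p.580] -/
theorem ninth_term_le
    (h210B : (regRegionKernels hL1 C Finset.univ B msq a k K₀).Ineq210 δ₁ Cst) (hmsq : 0 < msq) (ha : 0 < a)
    (hk : 1 ≤ k) (hkK : k ≤ P.K) (hδ₁ : 0 < δ₁) (hδ₁1 : δ₁ ≤ 1) (hCst : 0 ≤ Cst) (hd3 : P.d ≤ 3) (i₀ : Ix N)
    {δX : ℝ} (hreg : ∀ (z : HiggsLattice.Site P 0) (μ ν : Fin P.d), |(A + B) ⟨z.shift ν, μ⟩ - (A + B) ⟨z, μ⟩| ≤ δX)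
    (hsmall : (P.d : ℝ) ^ 2 * (P.mesh 0 * |C.e|) * ((P.L : ℝ) ^ k) ^ 2 * δX ≤ 1 / 3)
    {s : ℝ} (hs : 0 ≤ s) (hA : ∀ b : HiggsLattice.PBond P 0, |A b| ≤ s)
    (x x' : HiggsLattice.Site P 0) (i' : Ix N) :
    ∑ b : HiggsLattice.PBond P 0, col C msq a k B x b.tgt *
        ‖covDeriv C B (propagatorK C Finset.univ (A + B) msq a k
          (adjD C B (gM C A B (propagatorK C Finset.univ B msq a k (cb P N 0 (x', i')))))) b‖
      ≤ (4 + 2 * (2 / Real.sqrt (min 2 (a * (1 - ((P.L : ℝ) ^ 2)⁻¹) / 4)) * P.mesh k) * Real.sqrt (P.d * (|C.e| * s) ^ 2)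
            + (2 / min 2 (a * (1 - ((P.L : ℝ) ^ 2)⁻¹) / 4) * P.mesh k ^ 2) * Real.sqrt (P.d * (|C.e| * s) ^ 2) ^ 2) *
          (|C.e| * s) * P.d * (P.mesh 0 ^ P.d)⁻¹ *
          ((P.mesh 0 ^ P.d * Cst) ^ 2 * ((nCol N : ℝ) * (4 * P.d / (δ₁ / 2)) ^ P.d) /
            ((P.L : ℝ) ^ (((4 : ℝ) - (P.d : ℝ)) / 2) - 1) ^ 2 * P.mesh k ^ ((4 : ℝ) - (P.d : ℝ))) := by
  set w₀ := propagatorK C Finset.univ B msq a k (cb P N 0 (x', i')) with hw₀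
  set g := gM C A B w₀ with hg
  set Z := covDeriv C B (propagatorK C Finset.univ (A + B) msq a k (adjD C B g)) with hZ
  set Kbad : ℝ := 4 + 2 * (2 / Real.sqrt (min 2 (a * (1 - ((P.L : ℝ) ^ 2)⁻¹) / 4)) * P.mesh k) * Real.sqrt (P.d * (|C.e| * s) ^ 2)
      + (2 / min 2 (a * (1 - ((P.L : ℝ) ^ 2)⁻¹) / 4) * P.mesh k ^ 2) * Real.sqrt (P.d * (|C.e| * s) ^ 2) ^ 2 with hKbad
  set Y : ℝ := (P.mesh 0 ^ P.d * Cst) ^ 2 * ((nCol N : ℝ) * (4 * P.d / (δ₁ / 2)) ^ P.d) /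
      ((P.L : ℝ) ^ (((4 : ℝ) - (P.d : ℝ)) / 2) - 1) ^ 2 * P.mesh k ^ ((4 : ℝ) - (P.d : ℝ)) with hY
  have hγ : 0 < min 2 (a * (1 - ((P.L : ℝ) ^ 2)⁻¹) / 4) := gammaReg_pos (P := P) ha hL1
  have hmk : 0 < P.mesh k := P.mesh_pos k
  have hKbad0 : 0 ≤ Kbad := by rw [hKbad]; positivity
  have hε : 0 < P.mesh 0 ^ P.d := pow_pos (P.mesh_pos 0) _
  have hes : 0 ≤ |C.e| * s := mul_nonneg (abs_nonneg _) hs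
  have hsq1 := (sum_sq_col_le (X := B) h210B hmsq ha hk hkK hδ₁ hδ₁1 hCst hd3 i₀ x').1
  have hsq2 := (sum_sq_col_le (X := B) h210B hmsq ha hk hkK hδ₁ hδ₁1 hCst hd3 i₀ x).2
  have hY0 : 0 ≤ Y := le_trans (Finset.sum_nonneg fun y _ => mul_nonneg hε.le (sq_nonneg _)) hsq1
  -- Cauchy–Schwarz over the bonds
  have hCS := Real.sum_mul_le_sqrt_mul_sqrt (Finset.univ : Finset (HiggsLattice.PBond P 0))
    (fun b => col C msq a k B x b.tgt) (fun b => ‖Z b‖)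
  -- the first factor: Σ_b κ(x,b₊)² = d Σ_y κ(x,y)² ≤ d ε^{-d} Y
  have hS1 : ∑ b : HiggsLattice.PBond P 0, col C msq a k B x b.tgt ^ 2 ≤ P.d * ((P.mesh 0 ^ P.d)⁻¹ * Y) := by
    rw [sum_bond_tgt_eq (fun y => col C msq a k B x y ^ 2)]
    refine mul_le_mul_of_nonneg_left ?_ (Nat.cast_nonneg _)
    calc ∑ y : HiggsLattice.Site P 0, col C msq a k B x y ^ 2
        = (P.mesh 0 ^ P.d)⁻¹ * ∑ y : HiggsLattice.Site P 0, P.mesh 0 ^ P.d * col C msq a k B x y ^ 2 := by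
          rw [Finset.mul_sum]; exact Finset.sum_congr rfl fun y _ => by rw [← mul_assoc, inv_mul_cancel₀ hε.ne', one_mul]
      _ ≤ (P.mesh 0 ^ P.d)⁻¹ * Y := mul_le_mul_of_nonneg_left hsq2 (inv_nonneg.mpr hε.le)
  -- the second factor: Σ_b ‖Z b‖² = ε^{-d} bI Z Z ≤ ε^{-d} Kbad² bI g g ≤ ε^{-d} Kbad² (|e|s)² d siteInner w₀ w₀ ≤ ε^{-d} Kbad² (|e|s)² d ε^{-d}... 
  have hZZ : 0 ≤ bondInner Z Z := B1Ineq233LowerZeroFieldTorus.bondInner_self_nonneg Z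
  have hgg : 0 ≤ bondInner g g := B1Ineq233LowerZeroFieldTorus.bondInner_self_nonneg g
  have hbad : Real.sqrt (bondInner Z Z) ≤ Kbad * Real.sqrt (bondInner g g) :=
    sqrt_bondInner_DGDt_le (C := C) (A := A) (B := B) ha hL1 hmsq hk hkK hreg hsmall hA g
  have hZle : bondInner Z Z ≤ Kbad ^ 2 * bondInner g g := by
    have h1 : bondInner Z Z = Real.sqrt (bondInner Z Z) ^ 2 := (Real.sq_sqrt hZZ).symm
    have h2 : (Kbad * Real.sqrt (bondInner g g)) ^ 2 = Kbad ^ 2 * bondInner g g := by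
      rw [mul_pow, Real.sq_sqrt hgg]
    rw [h1, ← h2]
    exact pow_le_pow_left₀ (Real.sqrt_nonneg _) hbad 2
  -- ⟨g, g⟩ ≤ (|e|s)² d ⟨w₀, w₀⟩ ≤ (|e|s)² d Y
  have hgle : bondInner g g ≤ (|C.e| * s) ^ 2 * (P.d * Y) := by
    have h1 := B3Op116Pieces.sum_inside_norm_mulM_sq_le (Ω := (Finset.univ : Finset (HiggsLattice.Site P 0))) C A B hA w₀
    have hIn : ∀ b : HiggsLattice.PBond P 0, Inside (Finset.univ : Finset (HiggsLattice.Site P 0)) b :=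
      fun b => ⟨Finset.mem_univ _, Finset.mem_univ _⟩
    simp only [if_pos (hIn _)] at h1
    have h2 : bondInner g g = ∑ b : HiggsLattice.PBond P 0, P.mesh 0 ^ P.d * ‖mulM C A B b (w₀ b.tgt)‖ ^ 2 := by
      unfold bondInner
      exact Finset.sum_congr rfl fun b _ => by rw [real_inner_self_eq_norm_sq, hg, gM]
    rw [h2]
    refine h1.trans (mul_le_mul_of_nonneg_left (mul_le_mul_of_nonneg_left ?_ (Nat.cast_nonneg _)) (sq_nonneg _))
    rw [HiggsCovariancePos.siteInner_self_eq]
    refine le_trans (Finset.sum_le_sum fun y _ => mul_le_mul_of_nonneg_left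
      (pow_le_pow_left₀ (norm_nonneg _) ?_ 2) hε.le) hsq1
    -- ‖w₀ y‖ ≤ κ_B(y, x′): one term of the column
    exact Finset.single_le_sum (f := fun i => ‖propagatorK C Finset.univ B msq a k (cb P N 0 (x', i)) y‖)
      (fun _ _ => norm_nonneg _) (Finset.mem_univ i')
  have hS2 : ∑ b : HiggsLattice.PBond P 0, ‖Z b‖ ^ 2 ≤ (P.mesh 0 ^ P.d)⁻¹ * (Kbad ^ 2 * ((|C.e| * s) ^ 2 * (P.d * Y))) := by
    rw [sum_norm_sq_eq_inv_mul_bondInner]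
    exact mul_le_mul_of_nonneg_left (hZle.trans (mul_le_mul_of_nonneg_left hgle (sq_nonneg _))) (inv_nonneg.mpr hε.le)
  -- combine
  have hU1 : 0 ≤ (P.d : ℝ) * ((P.mesh 0 ^ P.d)⁻¹ * Y) := by positivity
  set R : ℝ := Kbad * (|C.e| * s) * P.d * (P.mesh 0 ^ P.d)⁻¹ * Y with hR
  have hR0 : 0 ≤ R := by rw [hR]; positivity
  have hprod : (P.d * ((P.mesh 0 ^ P.d)⁻¹ * Y)) * ((P.mesh 0 ^ P.d)⁻¹ * (Kbad ^ 2 * ((|C.e| * s) ^ 2 * (P.d * Y)))) = R ^ 2 := by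
    rw [hR]; ring
  calc ∑ b : HiggsLattice.PBond P 0, col C msq a k B x b.tgt * ‖Z b‖
      ≤ Real.sqrt (∑ b : HiggsLattice.PBond P 0, col C msq a k B x b.tgt ^ 2) *
          Real.sqrt (∑ b : HiggsLattice.PBond P 0, ‖Z b‖ ^ 2) := hCS
    _ ≤ Real.sqrt (P.d * ((P.mesh 0 ^ P.d)⁻¹ * Y)) *
          Real.sqrt ((P.mesh 0 ^ P.d)⁻¹ * (Kbad ^ 2 * ((|C.e| * s) ^ 2 * (P.d * Y)))) :=
        mul_le_mul (Real.sqrt_le_sqrt hS1) (Real.sqrt_le_sqrt hS2) (Real.sqrt_nonneg _) (Real.sqrt_nonneg _)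
    _ = R := by rw [← Real.sqrt_mul hU1, hprod, Real.sqrt_sq hR0]

end NinthTerm


/-! ## §13 (v1.3) The two rows of the assembly in the `κ` vocabulary: outer majorants, inner value row, inner derivative row -/

section Rows

variable {C : ChargeData N} {A B : HiggsLattice.VecField P 0} {msq a : ℝ} {k K₀ : ℕ} {hL1 : 1 < P.L} {δ₁ Cst : ℝ}

/-- one entry of a column is below the column: `‖(G_k(T,X)e_{(x′,i′)})(y)‖ ≤ κ_X(y,x′)`. [cite: Balaban1983Higgs3, (2.10) p.426] -/
theorem norm_G_cb_le_col (C : ChargeData N) (msq a : ℝ) (k : ℕ) (X : HiggsLattice.VecField P 0)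
    (x' y : HiggsLattice.Site P 0) (i' : Ix N) :
    ‖propagatorK C Finset.univ X msq a k (cb P N 0 (x', i')) y‖ ≤ col C msq a k X y x' :=
  Finset.single_le_sum (f := fun i => ‖propagatorK C Finset.univ X msq a k (cb P N 0 (x', i)) y‖)
    (fun _ _ => norm_nonneg _) (Finset.mem_univ i')

/-- `‖(D^ε_YG_k(T,X)e_{(x′,i′)})(b)‖ ≤ κ^D_{Y,X}(b,x′)`. [cite: Balaban1983Higgs3, (2.10) p.426] -/
theorem norm_covDeriv_G_cb_le_dcol (C : ChargeData N) (msq a : ℝ) (k : ℕ) (Y X : HiggsLattice.VecField P 0)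
    (x' : HiggsLattice.Site P 0) (b : HiggsLattice.PBond P 0) (i' : Ix N) :
    ‖covDeriv C Y (propagatorK C Finset.univ X msq a k (cb P N 0 (x', i'))) b‖ ≤ dcol C msq a k Y X b x' :=
  Finset.single_le_sum (f := fun i => ‖covDeriv C Y (propagatorK C Finset.univ X msq a k (cb P N 0 (x', i))) b‖)
    (fun _ _ => norm_nonneg _) (Finset.mem_univ i')

/-- **The outer VALUE row's majorant at the base point**: `κ_B(x,b₊) ≤ Σ_{j<k} e·ε^dC(L^jε)^{2−d}e^{−δ₁(L^jε)^{−1}ε|x−b₋|}` (exponent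
`p = 2`; the head costs a factor `e`, `majorant_shift_le`). [cite: Balaban1983Higgs3, (2.10) p.426] -/
theorem row_col_majorant (h210B : (regRegionKernels hL1 C Finset.univ B msq a k K₀).Ineq210 δ₁ Cst) (hmsq : 0 < msq)
    (ha : 0 < a) (hk : 1 ≤ k) (hkK : k ≤ P.K) (hδ₁ : 0 < δ₁) (hδ₁1 : δ₁ ≤ 1) (hCst : 0 ≤ Cst)
    (x : HiggsLattice.Site P 0) (b : HiggsLattice.PBond P 0) :
    col C msq a k B x b.tgt ≤ ∑ j ∈ Finset.range k, (Real.exp 1 * (P.mesh 0 ^ P.d * Cst)) * P.mesh j ^ ((2 : ℝ) - (P.d : ℝ)) *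
        Real.exp (-(δ₁ * (P.mesh j)⁻¹ * (P.mesh 0 * (HiggsLattice.Site.tdist x b.src : ℝ)))) :=
  (col_le h210B hmsq ha hk hkK x b.tgt).trans
    (majorant_shift_le hδ₁ hδ₁1 (mul_nonneg (pow_nonneg (P.mesh_pos 0).le _) hCst) x b.src b.dir)

/-- **The outer DERIVATIVE-source row's majorant**: `κ^D_{B,B}(b,x) ≤ Σ_{j<k} ε^dC(L^jε)^{1−d}e^{−δ₁(L^jε)^{−1}ε|x−b₋|}` (exponent `p = 1`).
[cite: Balaban1983Higgs3, (2.10) p.426] -/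
theorem row_dcol_majorant (h210B : (regRegionKernels hL1 C Finset.univ B msq a k K₀).Ineq210 δ₁ Cst) (hmsq : 0 < msq)
    (ha : 0 < a) (hk : 1 ≤ k) (hkK : k ≤ P.K) (x : HiggsLattice.Site P 0) (b : HiggsLattice.PBond P 0) :
    dcol C msq a k B B b x ≤ ∑ j ∈ Finset.range k, (P.mesh 0 ^ P.d * Cst) * P.mesh j ^ ((1 : ℝ) - (P.d : ℝ)) *
        Real.exp (-(δ₁ * (P.mesh j)⁻¹ * (P.mesh 0 * (HiggsLattice.Site.tdist x b.src : ℝ)))) := by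
  rw [majorant_comm]
  exact dcol_le h210B hmsq ha hk hkK b x

variable (C A B msq a k)

/-- **The inner VALUE row in the `κ` vocabulary**: for `w₀ = G_k(T,B)e_{(x′,i′)}`, `w₁ = G_k(T,A+B)V_k(A,B)w₀`, `sup_b|A_b| ≤ s`, every `y`:
`‖w₁(y)‖ ≤ Σ_{b′}[|e|s·κ^D_{B,B}(b′,x′)·κ_{A+B}(y,b′₊) + |e|s·κ_B(b′₊,x′)·κ^D_{B,A+B}(b′,y) + (|e|s)²κ_B(b′₊,x′)κ_{A+B}(y,b′₊)] +
|a_k|(L^kε)^{−2}‖(G_k(T,A+B)avgSrc w₀)(y)‖` (`norm_propagatorK_srcV_apply_le` on the torus). [cite: Balaban1983Higgs3, (1.16) p.414] -/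
theorem inner_value_row_le {s : ℝ} (hA : ∀ b : HiggsLattice.PBond P 0, |A b| ≤ s) (hs : 0 ≤ s)
    (x' y : HiggsLattice.Site P 0) (i' : Ix N) :
    ‖propagatorK C Finset.univ (A + B) msq a k
        (B3Op116SourceForm.srcV C A B k Finset.univ a (propagatorK C Finset.univ B msq a k (cb P N 0 (x', i')))) y‖
      ≤ (∑ b' : HiggsLattice.PBond P 0,
          (|C.e| * s * dcol C msq a k B B b' x' * col C msq a k (A + B) y b'.tgt
            + |C.e| * s * col C msq a k B b'.tgt x' * dcol C msq a k B (A + B) b' y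
            + (|C.e| * s) ^ 2 * col C msq a k B b'.tgt x' * col C msq a k (A + B) y b'.tgt))
        + |B1.aSeq a P.L k| * (P.mesh k)⁻¹ ^ 2 *
            ‖propagatorK C Finset.univ (A + B) msq a k
              (B3Op116SourceForm.avgSrc C A B k (propagatorK C Finset.univ B msq a k (cb P N 0 (x', i')))) y‖ := by
  set w₀ := propagatorK C Finset.univ B msq a k (cb P N 0 (x', i')) with hw₀
  have hIn : ∀ b : HiggsLattice.PBond P 0, Inside (Finset.univ : Finset (HiggsLattice.Site P 0)) b :=
    fun b => ⟨Finset.mem_univ _, Finset.mem_univ _⟩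
  have h := B3Op116SourceForm.norm_propagatorK_srcV_apply_le C Finset.univ A B a k (A + B) msq hA w₀ y
  simp only [if_pos (hIn _)] at h
  refine h.trans (add_le_add (Finset.sum_le_sum fun b' _ => ?_) le_rfl)
  have hes : 0 ≤ |C.e| * s := mul_nonneg (abs_nonneg _) hs
  have h1 : ‖covDeriv C B w₀ b'‖ ≤ dcol C msq a k B B b' x' := norm_covDeriv_G_cb_le_dcol C msq a k B B x' b' i'
  have h2 : ‖w₀ b'.tgt‖ ≤ col C msq a k B b'.tgt x' := norm_G_cb_le_col C msq a k B x' b'.tgt i'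
  have hc1 := col_nonneg (C := C) (msq := msq) (a := a) (k := k) (A + B) y b'.tgt
  have hc2 := dcol_nonneg (C := C) (msq := msq) (a := a) (k := k) B (A + B) b' y
  refine add_le_add (add_le_add ?_ ?_) ?_
  · exact mul_le_mul_of_nonneg_right (mul_le_mul_of_nonneg_left h1 hes) hc1
  · exact mul_le_mul_of_nonneg_right (mul_le_mul_of_nonneg_left h2 hes) hc2
  · exact mul_le_mul_of_nonneg_right (mul_le_mul_of_nonneg_left h2 (sq_nonneg _)) hc1

/-- **The inner DERIVATIVE row in the `κ` vocabulary** (the `MD` outer source reads `‖D_Bw₁(b)‖`):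
`‖(D^ε_Bw₁)(b)‖ ≤ Σ_{b′}[|e|s·κ^D_{B,B}(b′,x′) + (|e|s)²κ_B(b′₊,x′)]·κ^D_{B,A+B}(b,b′₊) + ‖Z(b)‖ + |a_k|(L^kε)^{−2}‖(D^ε_BG_k(T,A+B)avgSrc w₀)(b)‖`,
`Z = D^ε_BG_k(T,A+B)D^{ε*}_Bg_{w₀}` the ninth-chain field (`norm_covDeriv_G_srcV_le`). [cite: Balaban1983Higgs3, (1.16) p.414] -/
theorem inner_deriv_row_le {s : ℝ} (hA : ∀ b : HiggsLattice.PBond P 0, |A b| ≤ s) (hs : 0 ≤ s)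
    (x' : HiggsLattice.Site P 0) (b : HiggsLattice.PBond P 0) (i' : Ix N) :
    ‖covDeriv C B (propagatorK C Finset.univ (A + B) msq a k
        (B3Op116SourceForm.srcV C A B k Finset.univ a (propagatorK C Finset.univ B msq a k (cb P N 0 (x', i'))))) b‖
      ≤ (∑ b' : HiggsLattice.PBond P 0,
          (|C.e| * s * dcol C msq a k B B b' x' + (|C.e| * s) ^ 2 * col C msq a k B b'.tgt x') *
            dcol C msq a k B (A + B) b b'.tgt)
        + ‖covDeriv C B (propagatorK C Finset.univ (A + B) msq a k
            (adjD C B (gM C A B (propagatorK C Finset.univ B msq a k (cb P N 0 (x', i')))))) b‖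
        + |B1.aSeq a P.L k| * (P.mesh k)⁻¹ ^ 2 *
            ‖covDeriv C B (propagatorK C Finset.univ (A + B) msq a k
              (B3Op116SourceForm.avgSrc C A B k (propagatorK C Finset.univ B msq a k (cb P N 0 (x', i'))))) b‖ := by
  set w₀ := propagatorK C Finset.univ B msq a k (cb P N 0 (x', i')) with hw₀
  refine (norm_covDeriv_G_srcV_le C A B (A + B) msq a k hA w₀ b).trans
    (add_le_add (add_le_add (Finset.sum_le_sum fun b' _ => ?_) le_rfl) le_rfl)
  have hes : 0 ≤ |C.e| * s := mul_nonneg (abs_nonneg _) hs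
  have h1 : ‖covDeriv C B w₀ b'‖ ≤ dcol C msq a k B B b' x' := norm_covDeriv_G_cb_le_dcol C msq a k B B x' b' i'
  have h2 : ‖w₀ b'.tgt‖ ≤ col C msq a k B b'.tgt x' := norm_G_cb_le_col C msq a k B x' b'.tgt i'
  exact mul_le_mul_of_nonneg_right (add_le_add (mul_le_mul_of_nonneg_left h1 hes) (mul_le_mul_of_nonneg_left h2 (sq_nonneg _)))
    (dcol_nonneg (C := C) (msq := msq) (a := a) (k := k) B (A + B) b b'.tgt)

end Rows


/-! ## §14 (v1.3) Distributing an outer row over the inner rows: the chain sums in the shapes T1–T5 -/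

section Distribute

variable (C : ChargeData N) (A B : HiggsLattice.VecField P 0) (msq a : ℝ) (k : ℕ) (s : ℝ)
  (R : HiggsLattice.PBond P 0 → ℝ) (x' : HiggsLattice.Site P 0)

/-- **Outer row × inner VALUE row = `|e|s·T3 + |e|s·T4 + (|e|s)²·T5`** (the shapes of `chainT3_le`, `chainT4_le`, `chainT5_le`).
[cite: Balaban1983Higgs3, (1.16) p.414] -/
theorem value_chains_eq :
    ∑ b : HiggsLattice.PBond P 0, R b * ∑ b' : HiggsLattice.PBond P 0,
        (|C.e| * s * dcol C msq a k B B b' x' * col C msq a k (A + B) b.tgt b'.tgt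
          + |C.e| * s * col C msq a k B b'.tgt x' * dcol C msq a k B (A + B) b' b.tgt
          + (|C.e| * s) ^ 2 * col C msq a k B b'.tgt x' * col C msq a k (A + B) b.tgt b'.tgt)
      = |C.e| * s * ∑ b : HiggsLattice.PBond P 0, ∑ b' : HiggsLattice.PBond P 0,
            R b * col C msq a k (A + B) b.tgt b'.tgt * dcol C msq a k B B b' x'
        + |C.e| * s * ∑ b : HiggsLattice.PBond P 0, ∑ b' : HiggsLattice.PBond P 0,
            R b * dcol C msq a k B (A + B) b' b.tgt * col C msq a k B b'.tgt x'
        + (|C.e| * s) ^ 2 * ∑ b : HiggsLattice.PBond P 0, ∑ b' : HiggsLattice.PBond P 0,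
            R b * col C msq a k (A + B) b.tgt b'.tgt * col C msq a k B b'.tgt x' := by
  simp only [Finset.mul_sum, Finset.sum_add_distrib, mul_add]
  refine congrArg₂ _ (congrArg₂ _ ?_ ?_) ?_ <;> refine Finset.sum_congr rfl fun b _ => Finset.sum_congr rfl fun b' _ => by ring

/-- **Outer row × inner DERIVATIVE row (chain part) = `|e|s·T1 + (|e|s)²·T2`** (the shapes of `chainT1_le`, `chainT2_le`).
[cite: Balaban1983Higgs3, (1.16) p.414] -/
theorem deriv_chains_eq :
    ∑ b : HiggsLattice.PBond P 0, R b * ∑ b' : HiggsLattice.PBond P 0,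
        (|C.e| * s * dcol C msq a k B B b' x' + (|C.e| * s) ^ 2 * col C msq a k B b'.tgt x') * dcol C msq a k B (A + B) b b'.tgt
      = |C.e| * s * ∑ b : HiggsLattice.PBond P 0, ∑ b' : HiggsLattice.PBond P 0,
            R b * dcol C msq a k B (A + B) b b'.tgt * dcol C msq a k B B b' x'
        + (|C.e| * s) ^ 2 * ∑ b : HiggsLattice.PBond P 0, ∑ b' : HiggsLattice.PBond P 0,
            R b * dcol C msq a k B (A + B) b b'.tgt * col C msq a k B b'.tgt x' := by
  simp only [Finset.mul_sum, Finset.sum_add_distrib, mul_add, add_mul]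
  refine congrArg₂ _ ?_ ?_ <;> refine Finset.sum_congr rfl fun b _ => Finset.sum_congr rfl fun b' _ => by ring

/-- **The outer VALUE row in the `κ` vocabulary** (torus): for `sup_b|A_b| ≤ s` and every `w`,
`‖(G_k(T,B)V_k(A,B)w)(x)‖ ≤ Σ_b[|e|s·κ_B(x,b₊)‖D_Bw(b)‖ + |e|s·‖w(b₊)‖κ^D_{B,B}(b,x) + (|e|s)²‖w(b₊)‖κ_B(x,b₊)] + |a_k|(L^kε)^{−2}‖(G_k(T,B)avgSrc w)(x)‖`.
[cite: Balaban1983Higgs3, (1.16) p.414] -/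
theorem outer_row_le {s : ℝ} (hA : ∀ b : HiggsLattice.PBond P 0, |A b| ≤ s) (w : ScalarField P 0 N)
    (x : HiggsLattice.Site P 0) :
    ‖propagatorK C Finset.univ B msq a k (B3Op116SourceForm.srcV C A B k Finset.univ a w) x‖
      ≤ (∑ b : HiggsLattice.PBond P 0,
          (|C.e| * s * ‖covDeriv C B w b‖ * col C msq a k B x b.tgt
            + |C.e| * s * ‖w b.tgt‖ * dcol C msq a k B B b x
            + (|C.e| * s) ^ 2 * ‖w b.tgt‖ * col C msq a k B x b.tgt))
        + |B1.aSeq a P.L k| * (P.mesh k)⁻¹ ^ 2 *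
            ‖propagatorK C Finset.univ B msq a k (B3Op116SourceForm.avgSrc C A B k w) x‖ := by
  have hIn : ∀ b : HiggsLattice.PBond P 0, Inside (Finset.univ : Finset (HiggsLattice.Site P 0)) b :=
    fun b => ⟨Finset.mem_univ _, Finset.mem_univ _⟩
  have h := B3Op116SourceForm.norm_propagatorK_srcV_apply_le C Finset.univ A B a k B msq hA w x
  simp only [if_pos (hIn _)] at h
  exact h

end Distribute


/-! ## §15 (v1.3) Row and column SUMS of the kernels (Schur bookkeeping for the uniform bound) -/

section RowSums

variable {k : ℕ}

/-- `Σ_b F(b₋) = d·Σ_y F(y)`. [cite: Balaban1982Higgs1, (1.4) p.604] -/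
theorem sum_bond_src_eq (F : HiggsLattice.Site P 0 → ℝ) :
    ∑ b : HiggsLattice.PBond P 0, F b.src = (P.d : ℝ) * ∑ y : HiggsLattice.Site P 0, F y := by
  rw [← sum_site_dir (fun y (_ : Fin P.d) => F y)]
  simp only [Finset.sum_const, Finset.card_univ, Fintype.card_fin, nsmul_eq_mul, Finset.mul_sum]

/-- **A site sum of a majorant**: `Σ_y Σ_{j<k} c(L^jε)^{a−d}e^{−δ(L^jε)^{−1}ε|u−y|} ≤ c·ε^{−d}N(8d/δ)^d·(L^kε)^a/(L^a−1)` (`0 < δ ≤ 1`,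
`a > 0`, `c ≥ 0`; the profile at half rate, `sum_exp_scale_le`, and the geometric scale sum `sum_mesh_rpow_le`).
[cite: Balaban1983Higgs3, (2.10) p.426] -/
theorem sum_site_majorant_le (hL : 1 < P.L) {c δ a : ℝ} (hc : 0 ≤ c) (hδ : 0 < δ) (hδ1 : δ ≤ 1) (ha : 0 < a)
    (u : HiggsLattice.Site P 0) (i₀ : Ix N) :
    ∑ y : HiggsLattice.Site P 0, ∑ j ∈ Finset.range k, c * P.mesh j ^ (a - (P.d : ℝ)) *
        Real.exp (-(δ * (P.mesh j)⁻¹ * (P.mesh 0 * (HiggsLattice.Site.tdist u y : ℝ))))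
      ≤ c * (P.mesh 0 ^ P.d)⁻¹ * ((nCol N : ℝ) * (4 * P.d / (δ / 2)) ^ P.d) * (P.mesh k ^ a / ((P.L : ℝ) ^ a - 1)) := by
  have hm0 : 0 < P.mesh 0 := P.mesh_pos 0
  have hδ2 : 0 < δ / 2 := half_pos hδ
  have hδ22 : δ / 2 ≤ 1 / 2 := by linarith
  rw [Finset.sum_comm]
  -- each scale: the profile at half rate
  have hj : ∀ j ∈ Finset.range k, ∑ y : HiggsLattice.Site P 0, c * P.mesh j ^ (a - (P.d : ℝ)) *
      Real.exp (-(δ * (P.mesh j)⁻¹ * (P.mesh 0 * (HiggsLattice.Site.tdist u y : ℝ))))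
        ≤ c * (P.mesh 0 ^ P.d)⁻¹ * ((nCol N : ℝ) * (4 * P.d / (δ / 2)) ^ P.d) * P.mesh j ^ a := by
    intro j _
    have hcj : 0 ≤ c * P.mesh j ^ (a - (P.d : ℝ)) := mul_nonneg hc (Real.rpow_nonneg (P.mesh_pos j).le _)
    rw [← Finset.mul_sum]
    have hprof : ∑ y : HiggsLattice.Site P 0, Real.exp (-(δ * (P.mesh j)⁻¹ * (P.mesh 0 * (HiggsLattice.Site.tdist u y : ℝ))))
        ≤ (nCol N : ℝ) * (4 * P.d / (δ / 2)) ^ P.d * ((P.L : ℝ) ^ j) ^ P.d := by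
      have h1 : ∀ y : HiggsLattice.Site P 0,
          Real.exp (-(δ * (P.mesh j)⁻¹ * (P.mesh 0 * (HiggsLattice.Site.tdist u y : ℝ))))
            ≤ Real.exp (-(δ / 2 / (P.L : ℝ) ^ j * (HiggsLattice.Site.tdist u y : ℝ))) := by
        intro y
        rw [B3Op116ScaleChains.rate_eq]
        apply Real.exp_le_exp.mpr
        have : 0 ≤ δ / (P.L : ℝ) ^ j * (HiggsLattice.Site.tdist u y : ℝ) := by positivity
        have h' : δ / 2 / (P.L : ℝ) ^ j * (HiggsLattice.Site.tdist u y : ℝ) = (δ / (P.L : ℝ) ^ j * (HiggsLattice.Site.tdist u y : ℝ)) / 2 := by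
          ring
        rw [h']; linarith
      refine (Finset.sum_le_sum fun y _ => h1 y).trans ?_
      refine (B3Op116ScaleChains.sum_site_le_sum_idx
        (fun y : HiggsLattice.Site P 0 => Real.exp (-(δ / 2 / (P.L : ℝ) ^ j * (HiggsLattice.Site.tdist u y : ℝ))))
        (fun _ => Real.exp_nonneg _) i₀).trans ?_
      exact B3Op116ScaleChains.sum_exp_scale_le hδ2 hδ22 j u i₀
    refine (mul_le_mul_of_nonneg_left hprof hcj).trans (le_of_eq ?_)
    -- scale algebra: ℓ_j^{a-d} (L^j)^d = ε^{-d} ℓ_j^a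
    have hε : P.mesh 0 ^ P.d ≠ 0 := (pow_pos hm0 _).ne'
    rw [Real.rpow_sub (P.mesh_pos j), Real.rpow_natCast,
      show P.mesh j ^ P.d = ((P.L : ℝ) ^ j) ^ P.d * P.mesh 0 ^ P.d by
        rw [← mul_pow]; simp [HiggsLattice.Params.mesh]]
    have hLj : ((P.L : ℝ) ^ j) ^ P.d ≠ 0 := by have := P.hL; positivity
    field_simp
  refine (Finset.sum_le_sum hj).trans ?_
  rw [← Finset.mul_sum]
  have hK : 0 ≤ c * (P.mesh 0 ^ P.d)⁻¹ * ((nCol N : ℝ) * (4 * P.d / (δ / 2)) ^ P.d) := by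
    have : 0 ≤ (4 * (P.d : ℝ) / (δ / 2)) ^ P.d := pow_nonneg (by positivity) _
    positivity
  exact mul_le_mul_of_nonneg_left (B3Op116ScaleChains.sum_mesh_rpow_le ha hL k) hK

variable {C : ChargeData N} {msq a : ℝ} {K₀ : ℕ} {hL1 : 1 < P.L} {δ₁ Cst : ℝ} {X : HiggsLattice.VecField P 0}

/-- **Row and column sums of `κ_X`** (`1 ≤ k ≤ K`, `0 < δ₁ ≤ 1`): `Σ_y κ_X(u,y)`, `Σ_y κ_X(y,u) ≤ C·N(8d/δ₁)^d(L^kε)²/(L²−1)`.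
[cite: Balaban1983Higgs3, (2.10) p.426] -/
theorem sum_col_le (h210 : (regRegionKernels hL1 C Finset.univ X msq a k K₀).Ineq210 δ₁ Cst) (hmsq : 0 < msq) (ha : 0 < a)
    (hk : 1 ≤ k) (hkK : k ≤ P.K) (hδ₁ : 0 < δ₁) (hδ₁1 : δ₁ ≤ 1) (hCst : 0 ≤ Cst) (i₀ : Ix N) (u : HiggsLattice.Site P 0) :
    (∑ y : HiggsLattice.Site P 0, col C msq a k X u y
      ≤ (P.mesh 0 ^ P.d * Cst) * (P.mesh 0 ^ P.d)⁻¹ * ((nCol N : ℝ) * (4 * P.d / (δ₁ / 2)) ^ P.d) *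
          (P.mesh k ^ (2 : ℝ) / ((P.L : ℝ) ^ (2 : ℝ) - 1))) ∧
    (∑ y : HiggsLattice.Site P 0, col C msq a k X y u
      ≤ (P.mesh 0 ^ P.d * Cst) * (P.mesh 0 ^ P.d)⁻¹ * ((nCol N : ℝ) * (4 * P.d / (δ₁ / 2)) ^ P.d) *
          (P.mesh k ^ (2 : ℝ) / ((P.L : ℝ) ^ (2 : ℝ) - 1))) := by
  have hc : 0 ≤ P.mesh 0 ^ P.d * Cst := mul_nonneg (pow_nonneg (P.mesh_pos 0).le _) hCst
  have hS := sum_site_majorant_le (N := N) (k := k) (a := 2) hL1 hc hδ₁ hδ₁1 (by norm_num) u i₀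
  constructor
  · exact (Finset.sum_le_sum fun y _ => col_le h210 hmsq ha hk hkK u y).trans hS
  · refine (Finset.sum_le_sum fun y _ => (col_le h210 hmsq ha hk hkK y u).trans (le_of_eq ?_)).trans hS
    simp_rw [B1Ineq234LevelZero.tdist_comm _ u]

/-- **Row and column sums of `κ^D_{X,X}`**: `Σ_y κ^D_{X,X}(b,y) ≤ C·N(8d/δ₁)^d(L^kε)/(L−1)` and `Σ_b κ^D_{X,X}(b,u) ≤ d·(the same)`.
[cite: Balaban1983Higgs3, (2.10) p.426] -/
theorem sum_dcol_le (h210 : (regRegionKernels hL1 C Finset.univ X msq a k K₀).Ineq210 δ₁ Cst) (hmsq : 0 < msq) (ha : 0 < a)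
    (hk : 1 ≤ k) (hkK : k ≤ P.K) (hδ₁ : 0 < δ₁) (hδ₁1 : δ₁ ≤ 1) (hCst : 0 ≤ Cst) (i₀ : Ix N) :
    (∀ b : HiggsLattice.PBond P 0, ∑ y : HiggsLattice.Site P 0, dcol C msq a k X X b y
      ≤ (P.mesh 0 ^ P.d * Cst) * (P.mesh 0 ^ P.d)⁻¹ * ((nCol N : ℝ) * (4 * P.d / (δ₁ / 2)) ^ P.d) *
          (P.mesh k ^ (1 : ℝ) / ((P.L : ℝ) ^ (1 : ℝ) - 1))) ∧
    (∀ u : HiggsLattice.Site P 0, ∑ b : HiggsLattice.PBond P 0, dcol C msq a k X X b u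
      ≤ (P.d : ℝ) * ((P.mesh 0 ^ P.d * Cst) * (P.mesh 0 ^ P.d)⁻¹ * ((nCol N : ℝ) * (4 * P.d / (δ₁ / 2)) ^ P.d) *
          (P.mesh k ^ (1 : ℝ) / ((P.L : ℝ) ^ (1 : ℝ) - 1)))) := by
  have hc : 0 ≤ P.mesh 0 ^ P.d * Cst := mul_nonneg (pow_nonneg (P.mesh_pos 0).le _) hCst
  have hS := fun u => sum_site_majorant_le (N := N) (k := k) (a := 1) hL1 hc hδ₁ hδ₁1 (by norm_num) u i₀
  constructor
  · intro b
    exact (Finset.sum_le_sum fun y _ => dcol_le h210 hmsq ha hk hkK b y).trans (hS b.src)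
  · intro u
    calc ∑ b : HiggsLattice.PBond P 0, dcol C msq a k X X b u
        ≤ ∑ b : HiggsLattice.PBond P 0, ∑ j ∈ Finset.range k, (P.mesh 0 ^ P.d * Cst) * P.mesh j ^ ((1 : ℝ) - (P.d : ℝ)) *
            Real.exp (-(δ₁ * (P.mesh j)⁻¹ * (P.mesh 0 * (HiggsLattice.Site.tdist u b.src : ℝ)))) := by
          refine Finset.sum_le_sum fun b _ => (dcol_le h210 hmsq ha hk hkK b u).trans (le_of_eq ?_)
          simp_rw [B1Ineq234LevelZero.tdist_comm _ u]
      _ = (P.d : ℝ) * ∑ y : HiggsLattice.Site P 0, ∑ j ∈ Finset.range k,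
            (P.mesh 0 ^ P.d * Cst) * P.mesh j ^ ((1 : ℝ) - (P.d : ℝ)) *
              Real.exp (-(δ₁ * (P.mesh j)⁻¹ * (P.mesh 0 * (HiggsLattice.Site.tdist u y : ℝ)))) :=
          sum_bond_src_eq (fun y => ∑ j ∈ Finset.range k, (P.mesh 0 ^ P.d * Cst) * P.mesh j ^ ((1 : ℝ) - (P.d : ℝ)) *
            Real.exp (-(δ₁ * (P.mesh j)⁻¹ * (P.mesh 0 * (HiggsLattice.Site.tdist u y : ℝ)))))
      _ ≤ _ := mul_le_mul_of_nonneg_left (hS u) (Nat.cast_nonneg _)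

end RowSums


/-! ## §16 (v1.3) Block-sum exchange and the uniform (sup) bounds of the averaging terms -/

section BlockExchange

variable {k : ℕ}

/-- **Block-sum exchange**: `Σ_z F(z)·Σ_{y∈B^k(z̄)} g(y) = Σ_y g(y)·Σ_{z∈B^k(ȳ)} F(z)` (the relation `ȳ = z̄` is symmetric).
[cite: Balaban1982Higgs1, (1.20) p.607] -/
theorem sum_mul_sum_blockK_comm (F g : HiggsLattice.Site P 0 → ℝ) :
    ∑ z : HiggsLattice.Site P 0, F z * ∑ y ∈ HiggsAveraging.blockK k (blockIter k z), g y
      = ∑ y : HiggsLattice.Site P 0, g y * ∑ z ∈ HiggsAveraging.blockK k (blockIter k y), F z := by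
  simp only [HiggsAveraging.blockK, Finset.sum_filter, Finset.mul_sum]
  rw [Finset.sum_comm]
  refine Finset.sum_congr rfl fun y _ => Finset.sum_congr rfl fun z _ => ?_
  by_cases h : blockIter k y = blockIter k z
  · rw [if_pos h, if_pos h.symm, mul_comm]
  · rw [if_neg h, if_neg (Ne.symm h), mul_zero, mul_zero]

/-- **Block averaging preserves the total sum**: `Σ_z L^{−kd}Σ_{y∈B^k(z̄)} g(y) = Σ_y g(y)` (`k ≤ K`, `|B^k| = L^{kd}`).
[cite: Balaban1982Higgs1, (1.20) p.607] -/
theorem sum_block_avg_eq (hk : k ≤ P.K) (g : HiggsLattice.Site P 0 → ℝ) :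
    ∑ z : HiggsLattice.Site P 0, ((P.L : ℝ) ^ (k * P.d))⁻¹ * ∑ y ∈ HiggsAveraging.blockK k (blockIter k z), g y
      = ∑ y : HiggsLattice.Site P 0, g y := by
  have hL : ((P.L : ℝ) ^ (k * P.d)) ≠ 0 := by have := P.hL; positivity
  have h := sum_mul_sum_blockK_comm (k := k) (fun _ => ((P.L : ℝ) ^ (k * P.d))⁻¹) g
  rw [h]
  refine Finset.sum_congr rfl fun y _ => ?_
  rw [Finset.sum_const, B1Eq353SupNorm.card_blockK hk, nsmul_eq_mul, Nat.cast_pow, mul_inv_cancel₀ hL, mul_one]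

variable {C : ChargeData N} {msq a : ℝ} {K₀ : ℕ} {hL1 : 1 < P.L} {δ₁ Cst : ℝ} {X : HiggsLattice.VecField P 0}

/-- **The block-averaged column, uniformly**: `L^{−kd}Σ_{y∈B^k(z̄)}κ_X(y,x′) ≤ K_b·ε^dC·(L^kε)²((L^kε)^d)^{−1}` (the decay factor dropped
from `block_avg_col_le`). [cite: Balaban1983Higgs3, (2.10) p.426] -/
theorem block_avg_col_le_unif (h210 : (regRegionKernels hL1 C Finset.univ X msq a k K₀).Ineq210 δ₁ Cst) (hmsq : 0 < msq)
    (ha : 0 < a) (hk : 1 ≤ k) (hkK : k ≤ P.K) (hδ₁ : 0 < δ₁) (hδ₁1 : δ₁ ≤ 1) (hCst : 0 ≤ Cst) (i₀ : Ix N)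
    (z x' : HiggsLattice.Site P 0) :
    ((P.L : ℝ) ^ (k * P.d))⁻¹ * ∑ y ∈ HiggsAveraging.blockK k (blockIter k z), col C msq a k X y x'
      ≤ (Real.exp (δ₁ / 2) * ((nCol N : ℝ) * (4 * P.d / (δ₁ / 2)) ^ P.d) / ((P.L : ℝ) ^ (2 : ℝ) - 1)) *
          (P.mesh 0 ^ P.d * Cst) * (P.mesh k ^ (2 : ℝ) * (P.mesh k ^ P.d)⁻¹) := by
  have hL1' : (1 : ℝ) < (P.L : ℝ) := by exact_mod_cast hL1
  refine (block_avg_col_le h210 hmsq ha hk hkK hδ₁ hδ₁1 hCst i₀ z x').trans ?_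
  have hK : 0 ≤ (Real.exp (δ₁ / 2) * ((nCol N : ℝ) * (4 * P.d / (δ₁ / 2)) ^ P.d) / ((P.L : ℝ) ^ (2 : ℝ) - 1)) *
      (P.mesh 0 ^ P.d * Cst) * (P.mesh k ^ (2 : ℝ) * (P.mesh k ^ P.d)⁻¹) := by
    have h1 : 0 < (P.L : ℝ) ^ (2 : ℝ) - 1 := by
      have : (1 : ℝ) < (P.L : ℝ) ^ (2 : ℝ) := Real.one_lt_rpow hL1' (by norm_num)
      linarith
    have h2 : 0 ≤ (4 * (P.d : ℝ) / (δ₁ / 2)) ^ P.d := pow_nonneg (by positivity) _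
    have h3 := P.mesh_pos 0
    have h4 := P.mesh_pos k
    positivity
  refine (mul_le_of_le_one_right hK ?_)
  apply Real.exp_le_one_iff.mpr
  have := P.mesh_pos k; have := P.mesh_pos 0
  have : 0 ≤ δ₁ / 2 * (P.mesh k)⁻¹ * (P.mesh 0 * (HiggsLattice.Site.tdist z x' : ℝ)) := by positivity
  linarith

/-- **The smeared outer row, uniformly**: `L^{−kd}Σ_{z∈B^k(ȳ′)}κ_X(x,z) ≤ L^{−kd}·Σ_zκ_X(x,z) ≤ L^{−kd}·C·N(8d/δ₁)^d(L^kε)²/(L²−1)`.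
[cite: Balaban1983Higgs3, (2.10) p.426] -/
theorem block_row_le_unif (h210 : (regRegionKernels hL1 C Finset.univ X msq a k K₀).Ineq210 δ₁ Cst) (hmsq : 0 < msq)
    (ha : 0 < a) (hk : 1 ≤ k) (hkK : k ≤ P.K) (hδ₁ : 0 < δ₁) (hδ₁1 : δ₁ ≤ 1) (hCst : 0 ≤ Cst) (i₀ : Ix N)
    (x y' : HiggsLattice.Site P 0) :
    ((P.L : ℝ) ^ (k * P.d))⁻¹ * ∑ z ∈ HiggsAveraging.blockK k (blockIter k y'), col C msq a k X x z
      ≤ ((P.L : ℝ) ^ (k * P.d))⁻¹ * ((P.mesh 0 ^ P.d * Cst) * (P.mesh 0 ^ P.d)⁻¹ * ((nCol N : ℝ) * (4 * P.d / (δ₁ / 2)) ^ P.d) *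
          (P.mesh k ^ (2 : ℝ) / ((P.L : ℝ) ^ (2 : ℝ) - 1))) := by
  have hL0 : 0 ≤ ((P.L : ℝ) ^ (k * P.d))⁻¹ := inv_nonneg.mpr (pow_nonneg (Nat.cast_nonneg _) _)
  refine mul_le_mul_of_nonneg_left ?_ hL0
  refine le_trans (Finset.sum_le_sum_of_subset_of_nonneg (Finset.subset_univ _)
    (fun z _ _ => col_nonneg (C := C) (msq := msq) (a := a) (k := k) X x z)) ?_
  exact (sum_col_le h210 hmsq ha hk hkK hδ₁ hδ₁1 hCst i₀ x).1

end BlockExchange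


/-! ## §17 (v1.3) The averaging terms, uniformly (block averages of the columns are smooth at the top scale) -/

section AvgTerms

variable {C : ChargeData N} {A B : HiggsLattice.VecField P 0} {msq a : ℝ} {k K₀ : ℕ} {hL1 : 1 < P.L} {δ₁ Cst : ℝ}

/-- block averages are monotone: `‖w(y)‖ ≤ W(y)` for all `y` gives `L^{−kd}Σ_{y∈B}‖w(y)‖ ≤ L^{−kd}Σ_{y∈B}W(y)`. [cite: Balaban1982Higgs1, (1.20) p.607] -/
theorem block_avg_mono (w : ScalarField P 0 N) (W : HiggsLattice.Site P 0 → ℝ) (hW : ∀ y, ‖w y‖ ≤ W y)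
    (z : HiggsLattice.Site P k) :
    ((P.L : ℝ) ^ (k * P.d))⁻¹ * ∑ y ∈ HiggsAveraging.blockK k z, ‖w y‖
      ≤ ((P.L : ℝ) ^ (k * P.d))⁻¹ * ∑ y ∈ HiggsAveraging.blockK k z, W y :=
  mul_le_mul_of_nonneg_left (Finset.sum_le_sum fun y _ => hW y) (inv_nonneg.mpr (pow_nonneg (Nat.cast_nonneg _) _))

/-- **The inner averaging source through the VALUE row, uniformly**: for `w₀ = G_k(T,B)e_{(x′,i′)}`, `sup|A| ≤ s`, `1 ≤ k ≤ K`, every `y`: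
`‖(G_k(T,A+B)avgSrc w₀)(y)‖ ≤ m(2+m)·S_b·Σ_zκ_{A+B}(y,z)`, `m = |e|sεd(L^k−1)`, `S_b` the uniform block bound of `κ_B(·,x′)`
(`norm_mapE_avgSrc_le_block`, `block_avg_col_le_unif`). [cite: Balaban1982Higgs1, (3.15)–(3.16) pp.614–615] [cite: Balaban1983Higgs3, (1.16) p.414] -/
theorem avg_inner_value_le_unif
    (h210B : (regRegionKernels hL1 C Finset.univ B msq a k K₀).Ineq210 δ₁ Cst) (hmsq : 0 < msq) (ha : 0 < a)
    (hk : 1 ≤ k) (hkK : k ≤ P.K) (hδ₁ : 0 < δ₁) (hδ₁1 : δ₁ ≤ 1) (hCst : 0 ≤ Cst) (i₀ : Ix N)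
    {s : ℝ} (hs : 0 ≤ s) (hA : ∀ b : HiggsLattice.PBond P 0, |A b| ≤ s) (x' y : HiggsLattice.Site P 0) (i' : Ix N) :
    ‖propagatorK C Finset.univ (A + B) msq a k
        (B3Op116SourceForm.avgSrc C A B k (propagatorK C Finset.univ B msq a k (cb P N 0 (x', i')))) y‖
      ≤ ((|C.e| * s * P.mesh 0 * (P.d * ((P.L : ℝ) ^ k - 1))) * (2 + |C.e| * s * P.mesh 0 * (P.d * ((P.L : ℝ) ^ k - 1))) *
          ((Real.exp (δ₁ / 2) * ((nCol N : ℝ) * (4 * P.d / (δ₁ / 2)) ^ P.d) / ((P.L : ℝ) ^ (2 : ℝ) - 1)) *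
            (P.mesh 0 ^ P.d * Cst) * (P.mesh k ^ (2 : ℝ) * (P.mesh k ^ P.d)⁻¹))) *
        ∑ z : HiggsLattice.Site P 0, col C msq a k (A + B) y z := by
  set w₀ := propagatorK C Finset.univ B msq a k (cb P N 0 (x', i')) with hw₀
  set G' : ScalarField P 0 N →ₗ[ℝ] ScalarField P 0 N := propagatorK C Finset.univ (A + B) msq a k with hG'
  set m : ℝ := |C.e| * s * P.mesh 0 * (P.d * ((P.L : ℝ) ^ k - 1)) with hm
  set Sb : ℝ := (Real.exp (δ₁ / 2) * ((nCol N : ℝ) * (4 * P.d / (δ₁ / 2)) ^ P.d) / ((P.L : ℝ) ^ (2 : ℝ) - 1)) *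
      (P.mesh 0 ^ P.d * Cst) * (P.mesh k ^ (2 : ℝ) * (P.mesh k ^ P.d)⁻¹) with hSb
  have hL1k : (1 : ℝ) ≤ (P.L : ℝ) ^ k := one_le_pow₀ (by exact_mod_cast P.hL)
  have hm0 : 0 ≤ m := by
    have : (0 : ℝ) ≤ (P.L : ℝ) ^ k - 1 := by linarith
    have := P.mesh_pos 0
    rw [hm]; positivity
  have hmm : 0 ≤ m * (2 + m) := by positivity
  set T : ScalarField P 0 N →ₗ[ℝ] E N := (LinearMap.proj y : ScalarField P 0 N →ₗ[ℝ] E N) ∘ₗ G' with hT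
  have hT' : ∀ φ : ScalarField P 0 N, T φ = (G' φ) y := fun φ => rfl
  have h := norm_mapE_avgSrc_le_block (C := C) (A := A) (B := B) (k := k) T hkK hs hA w₀
  rw [hT'] at h
  refine h.trans ?_
  rw [Finset.mul_sum]
  refine Finset.sum_le_sum fun z _ => ?_
  have hcol : ∑ i : Ix N, ‖T (cb P N 0 (z, i))‖ = col C msq a k (A + B) y z := by
    simp only [hT', hG']; rfl
  rw [hcol]
  have hblk : ((P.L : ℝ) ^ (k * P.d))⁻¹ * ∑ x ∈ HiggsAveraging.blockK k (blockIter k z), ‖w₀ x‖ ≤ Sb :=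
    (block_avg_mono w₀ (fun u => col C msq a k B u x') (fun u => norm_G_cb_le_col C msq a k B x' u i') _).trans
      (block_avg_col_le_unif h210B hmsq ha hk hkK hδ₁ hδ₁1 hCst i₀ z x')
  exact mul_le_mul_of_nonneg_right (mul_le_mul_of_nonneg_left hblk hmm)
    (col_nonneg (C := C) (msq := msq) (a := a) (k := k) (A + B) y z)

/-- **The inner averaging source through the DERIVATIVE row, uniformly**:
`‖(D^ε_BG_k(T,A+B)avgSrc w₀)(b)‖ ≤ m(2+m)·S_b·Σ_zκ^D_{B,A+B}(b,z)`. [cite: Balaban1982Higgs1, (3.15)–(3.16) pp.614–615] [cite: Balaban1983Higgs3, (1.16) p.414] -/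
theorem avg_inner_deriv_le_unif
    (h210B : (regRegionKernels hL1 C Finset.univ B msq a k K₀).Ineq210 δ₁ Cst) (hmsq : 0 < msq) (ha : 0 < a)
    (hk : 1 ≤ k) (hkK : k ≤ P.K) (hδ₁ : 0 < δ₁) (hδ₁1 : δ₁ ≤ 1) (hCst : 0 ≤ Cst) (i₀ : Ix N)
    {s : ℝ} (hs : 0 ≤ s) (hA : ∀ b : HiggsLattice.PBond P 0, |A b| ≤ s) (x' : HiggsLattice.Site P 0)
    (b : HiggsLattice.PBond P 0) (i' : Ix N) :
    ‖covDeriv C B (propagatorK C Finset.univ (A + B) msq a k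
        (B3Op116SourceForm.avgSrc C A B k (propagatorK C Finset.univ B msq a k (cb P N 0 (x', i'))))) b‖
      ≤ ((|C.e| * s * P.mesh 0 * (P.d * ((P.L : ℝ) ^ k - 1))) * (2 + |C.e| * s * P.mesh 0 * (P.d * ((P.L : ℝ) ^ k - 1))) *
          ((Real.exp (δ₁ / 2) * ((nCol N : ℝ) * (4 * P.d / (δ₁ / 2)) ^ P.d) / ((P.L : ℝ) ^ (2 : ℝ) - 1)) *
            (P.mesh 0 ^ P.d * Cst) * (P.mesh k ^ (2 : ℝ) * (P.mesh k ^ P.d)⁻¹))) *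
        ∑ z : HiggsLattice.Site P 0, dcol C msq a k B (A + B) b z := by
  set w₀ := propagatorK C Finset.univ B msq a k (cb P N 0 (x', i')) with hw₀
  set G' : ScalarField P 0 N →ₗ[ℝ] ScalarField P 0 N := propagatorK C Finset.univ (A + B) msq a k with hG'
  set m : ℝ := |C.e| * s * P.mesh 0 * (P.d * ((P.L : ℝ) ^ k - 1)) with hm
  set Sb : ℝ := (Real.exp (δ₁ / 2) * ((nCol N : ℝ) * (4 * P.d / (δ₁ / 2)) ^ P.d) / ((P.L : ℝ) ^ (2 : ℝ) - 1)) *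
      (P.mesh 0 ^ P.d * Cst) * (P.mesh k ^ (2 : ℝ) * (P.mesh k ^ P.d)⁻¹) with hSb
  have hL1k : (1 : ℝ) ≤ (P.L : ℝ) ^ k := one_le_pow₀ (by exact_mod_cast P.hL)
  have hm0 : 0 ≤ m := by
    have : (0 : ℝ) ≤ (P.L : ℝ) ^ k - 1 := by linarith
    have := P.mesh_pos 0
    rw [hm]; positivity
  have hmm : 0 ≤ m * (2 + m) := by positivity
  set T : ScalarField P 0 N →ₗ[ℝ] E N := B3Op116SourceForm.covDerivAt C B b ∘ₗ G' with hT
  have hT' : ∀ φ : ScalarField P 0 N, T φ = covDeriv C B (G' φ) b := fun φ => by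
    simp [hT, B3Op116SourceForm.covDerivAt_apply]
  have h := norm_mapE_avgSrc_le_block (C := C) (A := A) (B := B) (k := k) T hkK hs hA w₀
  rw [hT'] at h
  refine h.trans ?_
  rw [Finset.mul_sum]
  refine Finset.sum_le_sum fun z _ => ?_
  have hcol : ∑ i : Ix N, ‖T (cb P N 0 (z, i))‖ = dcol C msq a k B (A + B) b z := by
    simp only [hT', hG']; rfl
  rw [hcol]
  have hblk : ((P.L : ℝ) ^ (k * P.d))⁻¹ * ∑ x ∈ HiggsAveraging.blockK k (blockIter k z), ‖w₀ x‖ ≤ Sb :=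
    (block_avg_mono w₀ (fun u => col C msq a k B u x') (fun u => norm_G_cb_le_col C msq a k B x' u i') _).trans
      (block_avg_col_le_unif h210B hmsq ha hk hkK hδ₁ hδ₁1 hCst i₀ z x')
  exact mul_le_mul_of_nonneg_right (mul_le_mul_of_nonneg_left hblk hmm)
    (dcol_nonneg (C := C) (msq := msq) (a := a) (k := k) B (A + B) b z)

end AvgTerms


/-! ## §18 (v1.3) Named constants of the uniform bound and the three outer terms -/

section Terms

/-- the row/column-sum constant of exponent `e`: `ε^dC·ε^{−d}·N(8d/δ₁)^d·(L^kε)^e/(L^e−1)` (`sum_col_le`: `e = 2`; `sum_dcol_le`: `e = 1`).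
[cite: Balaban1983Higgs3, (2.10) p.426] -/
def rowK (P : HiggsLattice.Params) (N : ℕ) (δ₁ Cst : ℝ) (k : ℕ) (e : ℝ) : ℝ :=
  (P.mesh 0 ^ P.d * Cst) * (P.mesh 0 ^ P.d)⁻¹ * ((nCol N : ℝ) * (4 * P.d / (δ₁ / 2)) ^ P.d) *
    (P.mesh k ^ e / ((P.L : ℝ) ^ e - 1))

/-- the uniform block bound `S_b = [e^{δ₁/2}N(8d/δ₁)^d/(L²−1)]·ε^dC·(L^kε)²((L^kε)^d)^{−1}` (`block_avg_col_le_unif`).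
[cite: Balaban1983Higgs3, (2.10) p.426] -/
def blkK (P : HiggsLattice.Params) (N : ℕ) (δ₁ Cst : ℝ) (k : ℕ) : ℝ :=
  (Real.exp (δ₁ / 2) * ((nCol N : ℝ) * (4 * P.d / (δ₁ / 2)) ^ P.d) / ((P.L : ℝ) ^ (2 : ℝ) - 1)) *
    (P.mesh 0 ^ P.d * Cst) * (P.mesh k ^ (2 : ℝ) * (P.mesh k ^ P.d)⁻¹)

/-- the averaging amplitude `m = |e|sεd(L^k−1)` of `F_{2,k}` (p40's `norm_fTwo_apply_le`). [cite: Balaban1982Higgs1, (3.15) p.614] -/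
def mK (P : HiggsLattice.Params) {N : ℕ} (C : ChargeData N) (s : ℝ) (k : ℕ) : ℝ :=
  |C.e| * s * P.mesh 0 * (P.d * ((P.L : ℝ) ^ k - 1))

/-- the three-kernel chain bound `chainConst·K·(L^kε)^{p+a₂+a₃−d}·e^{−(δ₁/4)(L^kε)^{−1}ε|x−x′|}` (`bond_chain3_le'`).
[cite: Balaban1983Higgs3, (2.10) p.426] -/
def chainB (P : HiggsLattice.Params) (N : ℕ) (δ₁ p a₂ a₃ K : ℝ) (k : ℕ) (x x' : HiggsLattice.Site P 0) : ℝ :=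
  chainConst P N δ₁ p a₂ a₃ * K * P.mesh k ^ (p + a₂ + a₃ - (P.d : ℝ)) *
    Real.exp (-(δ₁ / 4 * (P.mesh k)⁻¹ * (P.mesh 0 * (HiggsLattice.Site.tdist x x' : ℝ))))

variable {C : ChargeData N} {A B : HiggsLattice.VecField P 0} {msq a : ℝ} {k K₀ : ℕ} {hL1 : 1 < P.L} {δ₁ Cst : ℝ}

variable (hδ₁ : 0 < δ₁) (hδ₁1 : δ₁ ≤ 1) (hCst : 0 ≤ Cst)
  (h210B : (regRegionKernels hL1 C Finset.univ B msq a k K₀).Ineq210 δ₁ Cst)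
  (h210AB : (regRegionKernels hL1 C Finset.univ (A + B) msq a k K₀).Ineq210 δ₁ Cst)
  (hmsq : 0 < msq) (ha : 0 < a) (hk : 1 ≤ k) (hkK : k ≤ P.K) (hd3 : P.d ≤ 3) (i₀ : Ix N)
  {s : ℝ} (hs : 0 ≤ s) (hA : ∀ b : HiggsLattice.PBond P 0, |A b| ≤ s)
  (x x' : HiggsLattice.Site P 0) (i' : Ix N)
include hδ₁ hδ₁1 hCst h210B h210AB hmsq ha hk hkK hd3 i₀ hs hA

/-- **TERM II — an outer row `R` (exponent `p ∈ {1,2}`, `Σ_bR(b) ≤ SR`) against `‖w₁(b₊)‖`, uniformly in `k`**: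
`Σ_bR(b)‖w₁(b₊)‖ ≤ |e|s·T3 + |e|s·T4 + (|e|s)²·T5 + a(L^kε)^{−2}·m(2+m)S_b·rowK₂(A+B)·SR` (`value_chains_eq`, `chainT3/4/5_le`,
`avg_inner_value_le_unif`, `sum_col_le`). [cite: Balaban1983Higgs3, (1.16) p.414] -/
theorem termII_le {p cR SR : ℝ} (hp : 0 < p) (hcR : 0 ≤ cR) (R : HiggsLattice.PBond P 0 → ℝ) (hR0 : ∀ b, 0 ≤ R b)
    (hR : ∀ b, R b ≤ ∑ j ∈ Finset.range k, cR * P.mesh j ^ (p - (P.d : ℝ)) *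
      Real.exp (-(δ₁ * (P.mesh j)⁻¹ * (P.mesh 0 * (HiggsLattice.Site.tdist x b.src : ℝ)))))
    (hRsum : ∑ b : HiggsLattice.PBond P 0, R b ≤ SR) :
    ∑ b : HiggsLattice.PBond P 0, R b *
        ‖propagatorK C Finset.univ (A + B) msq a k
          (B3Op116SourceForm.srcV C A B k Finset.univ a (propagatorK C Finset.univ B msq a k (cb P N 0 (x', i')))) b.tgt‖
      ≤ |C.e| * s * chainB P N δ₁ p 2 1 (cR * (Real.exp 1 * (Real.exp 1 * (P.mesh 0 ^ P.d * Cst))) * (P.mesh 0 ^ P.d * Cst)) k x x'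
        + |C.e| * s * (chainB P N δ₁ p 1 2 (cR * (Real.exp 1 * (P.mesh 0 ^ P.d * Cst)) * (Real.exp 1 * (P.mesh 0 ^ P.d * Cst))) k x x'
            + |C.e| * s * chainB P N δ₁ p 2 2
                (cR * (Real.exp 1 * (Real.exp 1 * (P.mesh 0 ^ P.d * Cst))) * (Real.exp 1 * (P.mesh 0 ^ P.d * Cst))) k x x')
        + (|C.e| * s) ^ 2 * chainB P N δ₁ p 2 2
            (cR * (Real.exp 1 * (Real.exp 1 * (P.mesh 0 ^ P.d * Cst))) * (Real.exp 1 * (P.mesh 0 ^ P.d * Cst))) k x x'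
        + a * (P.mesh k)⁻¹ ^ 2 * (mK P C s k * (2 + mK P C s k) * blkK P N δ₁ Cst k * rowK P N δ₁ Cst k 2) * SR := by
  have hL1' : (1 : ℝ) < (P.L : ℝ) := by exact_mod_cast hL1
  have hes : 0 ≤ |C.e| * s := mul_nonneg (abs_nonneg _) hs
  have hd3' : (P.d : ℝ) ≤ 3 := by exact_mod_cast hd3
  -- pointwise inner value row, multiplied by R b ≥ 0 and summed
  have step1 := Finset.sum_le_sum fun b (_ : b ∈ (Finset.univ : Finset (HiggsLattice.PBond P 0))) =>
    (mul_le_mul_of_nonneg_left (inner_value_row_le C A B msq a k hA hs x' b.tgt i') (hR0 b)).trans_eq (mul_add _ _ _)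
  refine step1.trans ?_
  rw [Finset.sum_add_distrib, value_chains_eq C A B msq a k s R x']
  -- the three chains
  have hT3 := chainT3_le hδ₁ hδ₁1 hCst h210B h210AB hmsq ha hk hkK i₀ x x' hp hcR R hR0 hR (by linarith)
  have hT4 := chainT4_le hδ₁ hδ₁1 hCst h210B h210AB hmsq ha hk hkK i₀ x x' hp hcR R hR0 hR hA (by linarith)
  have hT5 := chainT5_le hδ₁ hδ₁1 hCst h210B h210AB hmsq ha hk hkK i₀ x x' hp hcR R hR0 hR (by linarith)
  -- the averaging term, uniformly
  have hc0 : 0 ≤ |B1.aSeq a P.L k| * (P.mesh k)⁻¹ ^ 2 := by positivity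
  have hca : |B1.aSeq a P.L k| * (P.mesh k)⁻¹ ^ 2 ≤ a * (P.mesh k)⁻¹ ^ 2 := by
    rw [abs_of_pos (B1.aSeq_pos ha hL1' hk)]
    exact mul_le_mul_of_nonneg_right (B1.aSeq_le ha hL1' k hk) (by positivity)
  have hAV := fun b : HiggsLattice.PBond P 0 =>
    avg_inner_value_le_unif (A := A) h210B hmsq ha hk hkK hδ₁ hδ₁1 hCst i₀ hs hA x' b.tgt i'
  have hrow := fun b : HiggsLattice.PBond P 0 => (sum_col_le h210AB hmsq ha hk hkK hδ₁ hδ₁1 hCst i₀ b.tgt).1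
  have hM0 : 0 ≤ mK P C s k * (2 + mK P C s k) * blkK P N δ₁ Cst k := by
    have hL1k : (1 : ℝ) ≤ (P.L : ℝ) ^ k := one_le_pow₀ hL1'.le
    have hm : 0 ≤ mK P C s k := by
      have : (0 : ℝ) ≤ (P.L : ℝ) ^ k - 1 := by linarith
      have := P.mesh_pos 0; unfold mK; positivity
    have hb : 0 ≤ blkK P N δ₁ Cst k := by
      have h1 : 0 < (P.L : ℝ) ^ (2 : ℝ) - 1 := by
        have : (1 : ℝ) < (P.L : ℝ) ^ (2 : ℝ) := Real.one_lt_rpow hL1' (by norm_num)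
        linarith
      have h2 : 0 ≤ (4 * (P.d : ℝ) / (δ₁ / 2)) ^ P.d := pow_nonneg (by positivity) _
      have := P.mesh_pos 0; have := P.mesh_pos k; unfold blkK; positivity
    positivity
  have hrowK0 : 0 ≤ rowK P N δ₁ Cst k 2 := by
    have h1 : 0 < (P.L : ℝ) ^ (2 : ℝ) - 1 := by
      have : (1 : ℝ) < (P.L : ℝ) ^ (2 : ℝ) := Real.one_lt_rpow hL1' (by norm_num)
      linarith
    have h2 : 0 ≤ (4 * (P.d : ℝ) / (δ₁ / 2)) ^ P.d := pow_nonneg (by positivity) _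
    have := P.mesh_pos 0; have := P.mesh_pos k; unfold rowK; positivity
  have havg : ∑ b : HiggsLattice.PBond P 0, R b * (|B1.aSeq a P.L k| * (P.mesh k)⁻¹ ^ 2 *
      ‖propagatorK C Finset.univ (A + B) msq a k
        (B3Op116SourceForm.avgSrc C A B k (propagatorK C Finset.univ B msq a k (cb P N 0 (x', i')))) b.tgt‖)
      ≤ a * (P.mesh k)⁻¹ ^ 2 * (mK P C s k * (2 + mK P C s k) * blkK P N δ₁ Cst k * rowK P N δ₁ Cst k 2) * SR := by
    have hpt : ∀ b : HiggsLattice.PBond P 0, R b * (|B1.aSeq a P.L k| * (P.mesh k)⁻¹ ^ 2 *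
        ‖propagatorK C Finset.univ (A + B) msq a k
          (B3Op116SourceForm.avgSrc C A B k (propagatorK C Finset.univ B msq a k (cb P N 0 (x', i')))) b.tgt‖)
        ≤ R b * (a * (P.mesh k)⁻¹ ^ 2 * (mK P C s k * (2 + mK P C s k) * blkK P N δ₁ Cst k * rowK P N δ₁ Cst k 2)) := by
      intro b
      refine mul_le_mul_of_nonneg_left ?_ (hR0 b)
      refine mul_le_mul hca ((hAV b).trans ?_) (norm_nonneg _) (by positivity)
      exact mul_le_mul_of_nonneg_left (hrow b) hM0
    refine (Finset.sum_le_sum fun b _ => hpt b).trans ?_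
    rw [← Finset.sum_mul, mul_comm]
    exact mul_le_mul_of_nonneg_left hRsum (by positivity)
  -- assemble
  unfold chainB
  have e3 : p + 2 + 1 - (P.d : ℝ) = p + 2 + 1 - (P.d : ℝ) := rfl
  refine add_le_add (add_le_add (add_le_add (mul_le_mul_of_nonneg_left hT3 hes) (mul_le_mul_of_nonneg_left hT4 hes))
    (mul_le_mul_of_nonneg_left hT5 (sq_nonneg _))) havg

omit hδ₁1 h210B h210AB hmsq ha hk hkK hd3 i₀ hA in
/-- positivity of the named constants. [cite: Balaban1983Higgs3, (2.10) p.426] -/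
theorem consts_nonneg (hL1 : 1 < P.L) : 0 ≤ mK P C s k ∧ 0 ≤ blkK P N δ₁ Cst k ∧ 0 ≤ rowK P N δ₁ Cst k 2 ∧ 0 ≤ rowK P N δ₁ Cst k 1 := by
  have hL1' : (1 : ℝ) < (P.L : ℝ) := by exact_mod_cast hL1
  have hL1k : (1 : ℝ) ≤ (P.L : ℝ) ^ k := one_le_pow₀ hL1'.le
  have h2 : 0 ≤ (4 * (P.d : ℝ) / (δ₁ / 2)) ^ P.d := pow_nonneg (by positivity) _
  have hp2 : 0 < (P.L : ℝ) ^ (2 : ℝ) - 1 := by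
    have : (1 : ℝ) < (P.L : ℝ) ^ (2 : ℝ) := Real.one_lt_rpow hL1' (by norm_num)
    linarith
  have hp1 : 0 < (P.L : ℝ) ^ (1 : ℝ) - 1 := by rw [Real.rpow_one]; linarith
  have := P.mesh_pos 0; have := P.mesh_pos k
  refine ⟨?_, ?_, ?_, ?_⟩
  · have : (0 : ℝ) ≤ (P.L : ℝ) ^ k - 1 := by linarith
    unfold mK; positivity
  · unfold blkK; positivity
  · unfold rowK; positivity
  · unfold rowK; positivity

/-- **TERM I — the outer `MD` source: `Σ_bκ_B(x,b₊)‖(D^ε_Bw₁)(b)‖`, uniformly in `k`**: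
`≤ |e|s·T1 + (|e|s)²·T2 + NINTH + a(L^kε)^{−2}m(2+m)S_b(rowK₁ + |e|s·rowK₂)·d·rowK₂` (`deriv_chains_eq`, `chainT1_le`, `chainT2_le`,
`ninth_term_le`, `avg_inner_deriv_le_unif`, `dcol_le_add_split`, `sum_col_le`, `sum_dcol_le`). [cite: Balaban1983Higgs3, (1.16) p.414] -/
theorem termI_le {δX : ℝ} (hreg : ∀ (z : HiggsLattice.Site P 0) (μ ν : Fin P.d), |(A + B) ⟨z.shift ν, μ⟩ - (A + B) ⟨z, μ⟩| ≤ δX)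
    (hsmall : (P.d : ℝ) ^ 2 * (P.mesh 0 * |C.e|) * ((P.L : ℝ) ^ k) ^ 2 * δX ≤ 1 / 3) :
    ∑ b : HiggsLattice.PBond P 0, col C msq a k B x b.tgt *
        ‖covDeriv C B (propagatorK C Finset.univ (A + B) msq a k
          (B3Op116SourceForm.srcV C A B k Finset.univ a (propagatorK C Finset.univ B msq a k (cb P N 0 (x', i'))))) b‖
      ≤ |C.e| * s * (chainB P N δ₁ 2 1 1 ((Real.exp 1 * (P.mesh 0 ^ P.d * Cst)) * (Real.exp 1 * (P.mesh 0 ^ P.d * Cst)) *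
              (P.mesh 0 ^ P.d * Cst)) k x x'
            + |C.e| * s * chainB P N δ₁ 2 2 1 ((Real.exp 1 * (P.mesh 0 ^ P.d * Cst)) *
              (Real.exp 1 * (Real.exp 1 * (P.mesh 0 ^ P.d * Cst))) * (P.mesh 0 ^ P.d * Cst)) k x x')
        + (|C.e| * s) ^ 2 * (chainB P N δ₁ 2 1 2 ((Real.exp 1 * (P.mesh 0 ^ P.d * Cst)) *
              (Real.exp 1 * (P.mesh 0 ^ P.d * Cst)) * (Real.exp 1 * (P.mesh 0 ^ P.d * Cst))) k x x'
            + |C.e| * s * chainB P N δ₁ 2 2 2 ((Real.exp 1 * (P.mesh 0 ^ P.d * Cst)) *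
              (Real.exp 1 * (Real.exp 1 * (P.mesh 0 ^ P.d * Cst))) * (Real.exp 1 * (P.mesh 0 ^ P.d * Cst))) k x x')
        + (4 + 2 * (2 / Real.sqrt (min 2 (a * (1 - ((P.L : ℝ) ^ 2)⁻¹) / 4)) * P.mesh k) * Real.sqrt (P.d * (|C.e| * s) ^ 2)
              + (2 / min 2 (a * (1 - ((P.L : ℝ) ^ 2)⁻¹) / 4) * P.mesh k ^ 2) * Real.sqrt (P.d * (|C.e| * s) ^ 2) ^ 2) *
            (|C.e| * s) * P.d * (P.mesh 0 ^ P.d)⁻¹ *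
            ((P.mesh 0 ^ P.d * Cst) ^ 2 * ((nCol N : ℝ) * (4 * P.d / (δ₁ / 2)) ^ P.d) /
              ((P.L : ℝ) ^ (((4 : ℝ) - (P.d : ℝ)) / 2) - 1) ^ 2 * P.mesh k ^ ((4 : ℝ) - (P.d : ℝ)))
        + a * (P.mesh k)⁻¹ ^ 2 * (mK P C s k * (2 + mK P C s k) * blkK P N δ₁ Cst k *
            (rowK P N δ₁ Cst k 1 + |C.e| * s * rowK P N δ₁ Cst k 2)) * ((P.d : ℝ) * rowK P N δ₁ Cst k 2) := by
  have hL1' : (1 : ℝ) < (P.L : ℝ) := by exact_mod_cast hL1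
  have hes : 0 ≤ |C.e| * s := mul_nonneg (abs_nonneg _) hs
  have hd3' : (P.d : ℝ) ≤ 3 := by exact_mod_cast hd3
  have hc : 0 ≤ P.mesh 0 ^ P.d * Cst := mul_nonneg (pow_nonneg (P.mesh_pos 0).le _) hCst
  obtain ⟨hm0, hb0, hr20, hr10⟩ := consts_nonneg (P := P) (N := N) (C := C) (k := k) (δ₁ := δ₁) (Cst := Cst) hδ₁ hCst hs hL1
  set R : HiggsLattice.PBond P 0 → ℝ := fun b => col C msq a k B x b.tgt with hRdef
  have hR0 : ∀ b, 0 ≤ R b := fun b => col_nonneg (C := C) (msq := msq) (a := a) (k := k) B x b.tgt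
  have hR : ∀ b, R b ≤ ∑ j ∈ Finset.range k, (Real.exp 1 * (P.mesh 0 ^ P.d * Cst)) * P.mesh j ^ ((2 : ℝ) - (P.d : ℝ)) *
      Real.exp (-(δ₁ * (P.mesh j)⁻¹ * (P.mesh 0 * (HiggsLattice.Site.tdist x b.src : ℝ)))) :=
    fun b => row_col_majorant h210B hmsq ha hk hkK hδ₁ hδ₁1 hCst x b
  have hRsum : ∑ b : HiggsLattice.PBond P 0, R b ≤ (P.d : ℝ) * rowK P N δ₁ Cst k 2 := by
    simp only [hRdef]
    rw [sum_bond_tgt_eq (fun y => col C msq a k B x y)]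
    exact mul_le_mul_of_nonneg_left (sum_col_le h210B hmsq ha hk hkK hδ₁ hδ₁1 hCst i₀ x).1 (Nat.cast_nonneg _)
  -- pointwise inner derivative row, times R b, summed and split
  have step1 := Finset.sum_le_sum fun b (_ : b ∈ (Finset.univ : Finset (HiggsLattice.PBond P 0))) =>
    (mul_le_mul_of_nonneg_left (inner_deriv_row_le C A B msq a k hA hs x' b i') (hR0 b)).trans_eq
      (by rw [mul_add, mul_add])
  refine step1.trans ?_
  rw [Finset.sum_add_distrib, Finset.sum_add_distrib, deriv_chains_eq C A B msq a k s R x']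
  have hT1 := chainT1_le hδ₁ hδ₁1 hCst h210B h210AB hmsq ha hk hkK i₀ x x' (by norm_num : (0 : ℝ) < 2) (mul_nonneg (Real.exp_nonneg _) hc)
    R hR0 hR hA (by linarith)
  have hT2 := chainT2_le hδ₁ hδ₁1 hCst h210B h210AB hmsq ha hk hkK i₀ x x' (by norm_num : (0 : ℝ) < 2) (mul_nonneg (Real.exp_nonneg _) hc)
    R hR0 hR hA (by linarith)
  have h9 := ninth_term_le (A := A) h210B hmsq ha hk hkK hδ₁ hδ₁1 hCst hd3 i₀ hreg hsmall hs hA x x' i'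
  -- the averaging term
  have hca : |B1.aSeq a P.L k| * (P.mesh k)⁻¹ ^ 2 ≤ a * (P.mesh k)⁻¹ ^ 2 := by
    rw [abs_of_pos (B1.aSeq_pos ha hL1' hk)]
    exact mul_le_mul_of_nonneg_right (B1.aSeq_le ha hL1' k hk) (by positivity)
  have hAD := fun b : HiggsLattice.PBond P 0 =>
    avg_inner_deriv_le_unif (A := A) h210B hmsq ha hk hkK hδ₁ hδ₁1 hCst i₀ hs hA x' b i'
  obtain ⟨hrowD, -⟩ := sum_dcol_le h210AB hmsq ha hk hkK hδ₁ hδ₁1 hCst i₀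
  have hsplit : ∀ b : HiggsLattice.PBond P 0, ∑ z : HiggsLattice.Site P 0, dcol C msq a k B (A + B) b z
      ≤ rowK P N δ₁ Cst k 1 + |C.e| * s * rowK P N δ₁ Cst k 2 := by
    intro b
    refine (Finset.sum_le_sum fun z _ => dcol_le_add_split (C := C) (msq := msq) (a := a) (k := k) A B (hA b) z).trans ?_
    rw [Finset.sum_add_distrib, ← Finset.mul_sum]
    exact add_le_add (hrowD b) (mul_le_mul_of_nonneg_left (sum_col_le h210AB hmsq ha hk hkK hδ₁ hδ₁1 hCst i₀ b.tgt).1 hes)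
  have hM : 0 ≤ mK P C s k * (2 + mK P C s k) * blkK P N δ₁ Cst k := by positivity
  have havg : ∑ b : HiggsLattice.PBond P 0, R b * (|B1.aSeq a P.L k| * (P.mesh k)⁻¹ ^ 2 *
      ‖covDeriv C B (propagatorK C Finset.univ (A + B) msq a k
        (B3Op116SourceForm.avgSrc C A B k (propagatorK C Finset.univ B msq a k (cb P N 0 (x', i'))))) b‖)
      ≤ a * (P.mesh k)⁻¹ ^ 2 * (mK P C s k * (2 + mK P C s k) * blkK P N δ₁ Cst k *
          (rowK P N δ₁ Cst k 1 + |C.e| * s * rowK P N δ₁ Cst k 2)) * ((P.d : ℝ) * rowK P N δ₁ Cst k 2) := by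
    have hpt : ∀ b : HiggsLattice.PBond P 0, R b * (|B1.aSeq a P.L k| * (P.mesh k)⁻¹ ^ 2 *
        ‖covDeriv C B (propagatorK C Finset.univ (A + B) msq a k
          (B3Op116SourceForm.avgSrc C A B k (propagatorK C Finset.univ B msq a k (cb P N 0 (x', i'))))) b‖)
        ≤ R b * (a * (P.mesh k)⁻¹ ^ 2 * (mK P C s k * (2 + mK P C s k) * blkK P N δ₁ Cst k *
            (rowK P N δ₁ Cst k 1 + |C.e| * s * rowK P N δ₁ Cst k 2))) := by
      intro b
      refine mul_le_mul_of_nonneg_left ?_ (hR0 b)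
      refine mul_le_mul hca ((hAD b).trans ?_) (norm_nonneg _) (by positivity)
      exact mul_le_mul_of_nonneg_left (hsplit b) hM
    refine (Finset.sum_le_sum fun b _ => hpt b).trans ?_
    rw [← Finset.sum_mul, mul_comm]
    exact mul_le_mul_of_nonneg_left hRsum (by positivity)
  unfold chainB
  refine add_le_add (add_le_add (add_le_add (mul_le_mul_of_nonneg_left hT1 hes) (mul_le_mul_of_nonneg_left hT2 (sq_nonneg _))) h9)
    havg

omit hd3 in
/-- **The total mass of `w₁`**: `Σ_{y′}‖w₁(y′)‖ ≤ |e|s·d·rowK₁·rowK₂ + |e|s·d·rowK₂(rowK₁ + |e|s·rowK₂) + (|e|s)²d·rowK₂² +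
a(L^kε)^{−2}m(2+m)rowK₂²` (inner value row summed over the torus; block averaging preserves the total sum, `sum_block_avg_eq`).
[cite: Balaban1983Higgs3, (1.16) p.414, (2.10) p.426] -/
theorem sum_norm_w1_le :
    ∑ y' : HiggsLattice.Site P 0, ‖propagatorK C Finset.univ (A + B) msq a k
        (B3Op116SourceForm.srcV C A B k Finset.univ a (propagatorK C Finset.univ B msq a k (cb P N 0 (x', i')))) y'‖
      ≤ |C.e| * s * ((P.d : ℝ) * rowK P N δ₁ Cst k 1) * rowK P N δ₁ Cst k 2
        + |C.e| * s * ((P.d : ℝ) * rowK P N δ₁ Cst k 2) * (rowK P N δ₁ Cst k 1 + |C.e| * s * rowK P N δ₁ Cst k 2)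
        + (|C.e| * s) ^ 2 * ((P.d : ℝ) * rowK P N δ₁ Cst k 2) * rowK P N δ₁ Cst k 2
        + a * (P.mesh k)⁻¹ ^ 2 * (mK P C s k * (2 + mK P C s k) * rowK P N δ₁ Cst k 2 * rowK P N δ₁ Cst k 2) := by
  have hL1' : (1 : ℝ) < (P.L : ℝ) := by exact_mod_cast hL1
  have hes : 0 ≤ |C.e| * s := mul_nonneg (abs_nonneg _) hs
  obtain ⟨hm0, hb0, hr20, hr10⟩ := consts_nonneg (P := P) (N := N) (C := C) (k := k) (δ₁ := δ₁) (Cst := Cst) hδ₁ hCst hs hL1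
  set w₀ := propagatorK C Finset.univ B msq a k (cb P N 0 (x', i')) with hw₀
  set G' : ScalarField P 0 N →ₗ[ℝ] ScalarField P 0 N := propagatorK C Finset.univ (A + B) msq a k with hG'
  obtain ⟨hrowD', hcolD⟩ := sum_dcol_le h210AB hmsq ha hk hkK hδ₁ hδ₁1 hCst i₀
  obtain ⟨-, hcolDB⟩ := sum_dcol_le h210B hmsq ha hk hkK hδ₁ hδ₁1 hCst i₀
  have hcol' := fun u => (sum_col_le h210AB hmsq ha hk hkK hδ₁ hδ₁1 hCst i₀ u)
  have hcolB := fun u => (sum_col_le h210B hmsq ha hk hkK hδ₁ hδ₁1 hCst i₀ u)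
  -- Σ_{b'} κ_B(b'₊, x') ≤ d rowK₂ and Σ_{b'} κ^D_{B,B}(b', x') ≤ d rowK₁
  have hSb1 : ∑ b' : HiggsLattice.PBond P 0, col C msq a k B b'.tgt x' ≤ (P.d : ℝ) * rowK P N δ₁ Cst k 2 := by
    rw [sum_bond_tgt_eq (fun y => col C msq a k B y x')]
    exact mul_le_mul_of_nonneg_left (hcolB x').2 (Nat.cast_nonneg _)
  have hSb2 : ∑ b' : HiggsLattice.PBond P 0, dcol C msq a k B B b' x' ≤ (P.d : ℝ) * rowK P N δ₁ Cst k 1 := hcolDB x'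
  have hsplit : ∀ b' : HiggsLattice.PBond P 0, ∑ z : HiggsLattice.Site P 0, dcol C msq a k B (A + B) b' z
      ≤ rowK P N δ₁ Cst k 1 + |C.e| * s * rowK P N δ₁ Cst k 2 := by
    intro b'
    refine (Finset.sum_le_sum fun z _ => dcol_le_add_split (C := C) (msq := msq) (a := a) (k := k) A B (hA b') z).trans ?_
    rw [Finset.sum_add_distrib, ← Finset.mul_sum]
    exact add_le_add (hrowD' b') (mul_le_mul_of_nonneg_left (hcol' b'.tgt).1 hes)
  -- the inner averaging term summed over the torus
  have hca : |B1.aSeq a P.L k| * (P.mesh k)⁻¹ ^ 2 ≤ a * (P.mesh k)⁻¹ ^ 2 := by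
    rw [abs_of_pos (B1.aSeq_pos ha hL1' hk)]
    exact mul_le_mul_of_nonneg_right (B1.aSeq_le ha hL1' k hk) (by positivity)
  have havgsum : ∑ y' : HiggsLattice.Site P 0, ‖G' (B3Op116SourceForm.avgSrc C A B k w₀) y'‖
      ≤ mK P C s k * (2 + mK P C s k) * rowK P N δ₁ Cst k 2 * rowK P N δ₁ Cst k 2 := by
    have hy : ∀ y' : HiggsLattice.Site P 0, ‖G' (B3Op116SourceForm.avgSrc C A B k w₀) y'‖
        ≤ ∑ z : HiggsLattice.Site P 0, (mK P C s k * (2 + mK P C s k) *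
            (((P.L : ℝ) ^ (k * P.d))⁻¹ * ∑ u ∈ HiggsAveraging.blockK k (blockIter k z), ‖w₀ u‖)) * col C msq a k (A + B) y' z := by
      intro y'
      set T : ScalarField P 0 N →ₗ[ℝ] E N := (LinearMap.proj y' : ScalarField P 0 N →ₗ[ℝ] E N) ∘ₗ G' with hT
      have hT' : ∀ φ : ScalarField P 0 N, T φ = (G' φ) y' := fun φ => rfl
      have h := norm_mapE_avgSrc_le_block (C := C) (A := A) (B := B) (k := k) T hkK hs hA w₀
      rw [hT'] at h
      refine h.trans (le_of_eq (Finset.sum_congr rfl fun z _ => ?_))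
      have hcol : ∑ i : Ix N, ‖T (cb P N 0 (z, i))‖ = col C msq a k (A + B) y' z := by simp only [hT', hG']; rfl
      rw [hcol]; rfl
    refine (Finset.sum_le_sum fun y' _ => hy y').trans ?_
    rw [Finset.sum_comm]
    have hz : ∀ z : HiggsLattice.Site P 0, ∑ y' : HiggsLattice.Site P 0, (mK P C s k * (2 + mK P C s k) *
        (((P.L : ℝ) ^ (k * P.d))⁻¹ * ∑ u ∈ HiggsAveraging.blockK k (blockIter k z), ‖w₀ u‖)) * col C msq a k (A + B) y' z
        ≤ (mK P C s k * (2 + mK P C s k) * rowK P N δ₁ Cst k 2) *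
          (((P.L : ℝ) ^ (k * P.d))⁻¹ * ∑ u ∈ HiggsAveraging.blockK k (blockIter k z), ‖w₀ u‖) := by
      intro z
      rw [← Finset.mul_sum]
      have hblk0 : 0 ≤ ((P.L : ℝ) ^ (k * P.d))⁻¹ * ∑ u ∈ HiggsAveraging.blockK k (blockIter k z), ‖w₀ u‖ :=
        mul_nonneg (inv_nonneg.mpr (pow_nonneg (Nat.cast_nonneg _) _)) (Finset.sum_nonneg fun _ _ => norm_nonneg _)
      calc mK P C s k * (2 + mK P C s k) * (((P.L : ℝ) ^ (k * P.d))⁻¹ * ∑ u ∈ HiggsAveraging.blockK k (blockIter k z), ‖w₀ u‖) *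
            ∑ y' : HiggsLattice.Site P 0, col C msq a k (A + B) y' z
          ≤ mK P C s k * (2 + mK P C s k) * (((P.L : ℝ) ^ (k * P.d))⁻¹ * ∑ u ∈ HiggsAveraging.blockK k (blockIter k z), ‖w₀ u‖) *
            rowK P N δ₁ Cst k 2 := mul_le_mul_of_nonneg_left (hcol' z).2 (by positivity)
        _ = _ := by ring
    refine (Finset.sum_le_sum fun z _ => hz z).trans ?_
    rw [← Finset.mul_sum, sum_block_avg_eq hkK (fun u => ‖w₀ u‖)]
    have hw : ∑ u : HiggsLattice.Site P 0, ‖w₀ u‖ ≤ rowK P N δ₁ Cst k 2 :=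
      (Finset.sum_le_sum fun u _ => norm_G_cb_le_col C msq a k B x' u i').trans (hcolB x').2
    exact mul_le_mul_of_nonneg_left hw (by positivity)
  -- sum the inner value row over y'
  have step1 := Finset.sum_le_sum fun y' (_ : y' ∈ (Finset.univ : Finset (HiggsLattice.Site P 0))) =>
    inner_value_row_le C A B msq a k hA hs x' y' i'
  refine step1.trans ?_
  rw [Finset.sum_add_distrib]
  refine add_le_add ?_ ?_
  · -- the three chain-type double sums: exchange and factor
    rw [Finset.sum_comm]
    simp only [Finset.sum_add_distrib]
    refine add_le_add (add_le_add ?_ ?_) ?_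
    · -- Σ_{b'} |e|s dcol_BB(b',x') Σ_{y'} col'(y', b'₊)
      have h1 : ∀ b' : HiggsLattice.PBond P 0, ∑ y' : HiggsLattice.Site P 0,
          |C.e| * s * dcol C msq a k B B b' x' * col C msq a k (A + B) y' b'.tgt
            ≤ |C.e| * s * dcol C msq a k B B b' x' * rowK P N δ₁ Cst k 2 := by
        intro b'
        rw [← Finset.mul_sum]
        exact mul_le_mul_of_nonneg_left (hcol' b'.tgt).2
          (mul_nonneg hes (dcol_nonneg (C := C) (msq := msq) (a := a) (k := k) B B b' x'))
      refine (Finset.sum_le_sum fun b' _ => h1 b').trans ?_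
      rw [← Finset.sum_mul, ← Finset.mul_sum]
      exact mul_le_mul_of_nonneg_right (mul_le_mul_of_nonneg_left hSb2 hes) hr20
    · have h1 : ∀ b' : HiggsLattice.PBond P 0, ∑ y' : HiggsLattice.Site P 0,
          |C.e| * s * col C msq a k B b'.tgt x' * dcol C msq a k B (A + B) b' y'
            ≤ |C.e| * s * col C msq a k B b'.tgt x' * (rowK P N δ₁ Cst k 1 + |C.e| * s * rowK P N δ₁ Cst k 2) := by
        intro b'
        rw [← Finset.mul_sum]
        exact mul_le_mul_of_nonneg_left (hsplit b')
          (mul_nonneg hes (col_nonneg (C := C) (msq := msq) (a := a) (k := k) B b'.tgt x'))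
      refine (Finset.sum_le_sum fun b' _ => h1 b').trans ?_
      rw [← Finset.sum_mul, ← Finset.mul_sum]
      exact mul_le_mul_of_nonneg_right (mul_le_mul_of_nonneg_left hSb1 hes) (by positivity)
    · have h1 : ∀ b' : HiggsLattice.PBond P 0, ∑ y' : HiggsLattice.Site P 0,
          (|C.e| * s) ^ 2 * col C msq a k B b'.tgt x' * col C msq a k (A + B) y' b'.tgt
            ≤ (|C.e| * s) ^ 2 * col C msq a k B b'.tgt x' * rowK P N δ₁ Cst k 2 := by
        intro b'
        rw [← Finset.mul_sum]
        exact mul_le_mul_of_nonneg_left (hcol' b'.tgt).2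
          (mul_nonneg (sq_nonneg _) (col_nonneg (C := C) (msq := msq) (a := a) (k := k) B b'.tgt x'))
      refine (Finset.sum_le_sum fun b' _ => h1 b').trans ?_
      rw [← Finset.sum_mul, ← Finset.mul_sum]
      exact mul_le_mul_of_nonneg_right (mul_le_mul_of_nonneg_left hSb1 (sq_nonneg _)) hr20
  · rw [← Finset.mul_sum]
    exact mul_le_mul hca havgsum (Finset.sum_nonneg fun _ _ => norm_nonneg _) (by positivity)

omit hd3 in
/-- **TERM IV — the outer averaging source, uniformly in `k`**: `‖(G_k(T,B)avgSrc w₁)(x)‖ ≤ m(2+m)·(L^{−kd}rowK₂)·W`, `W` the total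
mass bound of `sum_norm_w1_le` (block-sum exchange `sum_mul_sum_blockK_comm`, smeared row `block_row_le_unif`).
[cite: Balaban1982Higgs1, (3.15)–(3.16) pp.614–615] [cite: Balaban1983Higgs3, (1.16) p.414] -/
theorem termIV_le :
    ‖propagatorK C Finset.univ B msq a k (B3Op116SourceForm.avgSrc C A B k
        (propagatorK C Finset.univ (A + B) msq a k
          (B3Op116SourceForm.srcV C A B k Finset.univ a (propagatorK C Finset.univ B msq a k (cb P N 0 (x', i')))))) x‖
      ≤ mK P C s k * (2 + mK P C s k) * (((P.L : ℝ) ^ (k * P.d))⁻¹ * rowK P N δ₁ Cst k 2) *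
        (|C.e| * s * ((P.d : ℝ) * rowK P N δ₁ Cst k 1) * rowK P N δ₁ Cst k 2
          + |C.e| * s * ((P.d : ℝ) * rowK P N δ₁ Cst k 2) * (rowK P N δ₁ Cst k 1 + |C.e| * s * rowK P N δ₁ Cst k 2)
          + (|C.e| * s) ^ 2 * ((P.d : ℝ) * rowK P N δ₁ Cst k 2) * rowK P N δ₁ Cst k 2
          + a * (P.mesh k)⁻¹ ^ 2 * (mK P C s k * (2 + mK P C s k) * rowK P N δ₁ Cst k 2 * rowK P N δ₁ Cst k 2)) := by
  have hL1' : (1 : ℝ) < (P.L : ℝ) := by exact_mod_cast hL1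
  have hes : 0 ≤ |C.e| * s := mul_nonneg (abs_nonneg _) hs
  obtain ⟨hm0, hb0, hr20, hr10⟩ := consts_nonneg (P := P) (N := N) (C := C) (k := k) (δ₁ := δ₁) (Cst := Cst) hδ₁ hCst hs hL1
  set w₁ := propagatorK C Finset.univ (A + B) msq a k
    (B3Op116SourceForm.srcV C A B k Finset.univ a (propagatorK C Finset.univ B msq a k (cb P N 0 (x', i')))) with hw₁
  set G : ScalarField P 0 N →ₗ[ℝ] ScalarField P 0 N := propagatorK C Finset.univ B msq a k with hG
  set M : ℝ := mK P C s k * (2 + mK P C s k) with hM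
  have hM0 : 0 ≤ M := by positivity
  set Linv : ℝ := ((P.L : ℝ) ^ (k * P.d))⁻¹ with hLinv
  have hLinv0 : 0 ≤ Linv := inv_nonneg.mpr (pow_nonneg (Nat.cast_nonneg _) _)
  set T : ScalarField P 0 N →ₗ[ℝ] E N := (LinearMap.proj x : ScalarField P 0 N →ₗ[ℝ] E N) ∘ₗ G with hT
  have hT' : ∀ φ : ScalarField P 0 N, T φ = (G φ) x := fun φ => rfl
  have h := norm_mapE_avgSrc_le_block (C := C) (A := A) (B := B) (k := k) T hkK hs hA w₁
  rw [hT'] at h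
  refine h.trans ?_
  have hcol : ∀ z, ∑ i : Ix N, ‖T (cb P N 0 (z, i))‖ = col C msq a k B x z := fun z => by simp only [hT', hG]; rfl
  simp only [hcol]
  -- rewrite as M * Linv * Σ_z col(x,z) Σ_{u∈B(z̄)} ‖w₁ u‖ and exchange
  have e1 : ∑ z : HiggsLattice.Site P 0, mK P C s k * (2 + mK P C s k) *
      (((P.L : ℝ) ^ (k * P.d))⁻¹ * ∑ u ∈ HiggsAveraging.blockK k (blockIter k z), ‖w₁ u‖) * col C msq a k B x z
      = M * Linv * ∑ u : HiggsLattice.Site P 0, ‖w₁ u‖ * ∑ z ∈ HiggsAveraging.blockK k (blockIter k u), col C msq a k B x z := by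
    rw [← sum_mul_sum_blockK_comm (k := k) (fun z => col C msq a k B x z) (fun u => ‖w₁ u‖), Finset.mul_sum]
    exact Finset.sum_congr rfl fun z _ => by rw [hM, hLinv]; ring
  change (∑ z : HiggsLattice.Site P 0, mK P C s k * (2 + mK P C s k) *
      (((P.L : ℝ) ^ (k * P.d))⁻¹ * ∑ u ∈ HiggsAveraging.blockK k (blockIter k z), ‖w₁ u‖) * col C msq a k B x z) ≤ _
  rw [e1]
  have hW := sum_norm_w1_le hδ₁ hδ₁1 hCst h210B h210AB hmsq ha hk hkK i₀ hs hA x' i'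
  have hrow : ∀ u : HiggsLattice.Site P 0, Linv * ∑ z ∈ HiggsAveraging.blockK k (blockIter k u), col C msq a k B x z
      ≤ Linv * rowK P N δ₁ Cst k 2 := fun u => block_row_le_unif h210B hmsq ha hk hkK hδ₁ hδ₁1 hCst i₀ x u
  calc M * Linv * ∑ u : HiggsLattice.Site P 0, ‖w₁ u‖ * ∑ z ∈ HiggsAveraging.blockK k (blockIter k u), col C msq a k B x z
      = M * ∑ u : HiggsLattice.Site P 0, ‖w₁ u‖ * (Linv * ∑ z ∈ HiggsAveraging.blockK k (blockIter k u), col C msq a k B x z) := by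
        rw [mul_assoc, Finset.mul_sum, Finset.mul_sum, Finset.mul_sum]
        exact Finset.sum_congr rfl fun u _ => by ring
    _ ≤ M * ∑ u : HiggsLattice.Site P 0, ‖w₁ u‖ * (Linv * rowK P N δ₁ Cst k 2) :=
        mul_le_mul_of_nonneg_left (Finset.sum_le_sum fun u _ => mul_le_mul_of_nonneg_left (hrow u) (norm_nonneg _)) hM0
    _ = M * (Linv * rowK P N δ₁ Cst k 2) * ∑ u : HiggsLattice.Site P 0, ‖w₁ u‖ := by rw [← Finset.sum_mul]; ring
    _ ≤ _ := mul_le_mul_of_nonneg_left hW (by positivity)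

end Terms

/-! ## §19 (v1.3) THE UNIFORM BOUND of the kernel of (1.16) at `n = n′ = 1` on the torus -/

section Uniform

/-- the bound of TERM I (`termI_le`) as a named quantity. [cite: Balaban1983Higgs3, (1.16) p.414] -/
def termIBound (P : HiggsLattice.Params) (N : ℕ) (C : ChargeData N) (a δ₁ Cst s : ℝ) (k : ℕ)
    (x x' : HiggsLattice.Site P 0) : ℝ :=
  |C.e| * s * (chainB P N δ₁ 2 1 1 ((Real.exp 1 * (P.mesh 0 ^ P.d * Cst)) * (Real.exp 1 * (P.mesh 0 ^ P.d * Cst)) *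
          (P.mesh 0 ^ P.d * Cst)) k x x'
        + |C.e| * s * chainB P N δ₁ 2 2 1 ((Real.exp 1 * (P.mesh 0 ^ P.d * Cst)) *
          (Real.exp 1 * (Real.exp 1 * (P.mesh 0 ^ P.d * Cst))) * (P.mesh 0 ^ P.d * Cst)) k x x')
    + (|C.e| * s) ^ 2 * (chainB P N δ₁ 2 1 2 ((Real.exp 1 * (P.mesh 0 ^ P.d * Cst)) *
          (Real.exp 1 * (P.mesh 0 ^ P.d * Cst)) * (Real.exp 1 * (P.mesh 0 ^ P.d * Cst))) k x x'
        + |C.e| * s * chainB P N δ₁ 2 2 2 ((Real.exp 1 * (P.mesh 0 ^ P.d * Cst)) *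
          (Real.exp 1 * (Real.exp 1 * (P.mesh 0 ^ P.d * Cst))) * (Real.exp 1 * (P.mesh 0 ^ P.d * Cst))) k x x')
    + (4 + 2 * (2 / Real.sqrt (min 2 (a * (1 - ((P.L : ℝ) ^ 2)⁻¹) / 4)) * P.mesh k) * Real.sqrt (P.d * (|C.e| * s) ^ 2)
          + (2 / min 2 (a * (1 - ((P.L : ℝ) ^ 2)⁻¹) / 4) * P.mesh k ^ 2) * Real.sqrt (P.d * (|C.e| * s) ^ 2) ^ 2) *
        (|C.e| * s) * P.d * (P.mesh 0 ^ P.d)⁻¹ *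
        ((P.mesh 0 ^ P.d * Cst) ^ 2 * ((nCol N : ℝ) * (4 * P.d / (δ₁ / 2)) ^ P.d) /
          ((P.L : ℝ) ^ (((4 : ℝ) - (P.d : ℝ)) / 2) - 1) ^ 2 * P.mesh k ^ ((4 : ℝ) - (P.d : ℝ)))
    + a * (P.mesh k)⁻¹ ^ 2 * (mK P C s k * (2 + mK P C s k) * blkK P N δ₁ Cst k *
        (rowK P N δ₁ Cst k 1 + |C.e| * s * rowK P N δ₁ Cst k 2)) * ((P.d : ℝ) * rowK P N δ₁ Cst k 2)

/-- the bound of TERM II (`termII_le`) for an outer row of exponent `p`, constant `cR`, total `SR`. [cite: Balaban1983Higgs3, (1.16) p.414] -/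
def termIIBound (P : HiggsLattice.Params) (N : ℕ) (C : ChargeData N) (a δ₁ Cst s : ℝ) (k : ℕ) (p cR SR : ℝ)
    (x x' : HiggsLattice.Site P 0) : ℝ :=
  |C.e| * s * chainB P N δ₁ p 2 1 (cR * (Real.exp 1 * (Real.exp 1 * (P.mesh 0 ^ P.d * Cst))) * (P.mesh 0 ^ P.d * Cst)) k x x'
    + |C.e| * s * (chainB P N δ₁ p 1 2 (cR * (Real.exp 1 * (P.mesh 0 ^ P.d * Cst)) * (Real.exp 1 * (P.mesh 0 ^ P.d * Cst))) k x x'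
        + |C.e| * s * chainB P N δ₁ p 2 2
            (cR * (Real.exp 1 * (Real.exp 1 * (P.mesh 0 ^ P.d * Cst))) * (Real.exp 1 * (P.mesh 0 ^ P.d * Cst))) k x x')
    + (|C.e| * s) ^ 2 * chainB P N δ₁ p 2 2
        (cR * (Real.exp 1 * (Real.exp 1 * (P.mesh 0 ^ P.d * Cst))) * (Real.exp 1 * (P.mesh 0 ^ P.d * Cst))) k x x'
    + a * (P.mesh k)⁻¹ ^ 2 * (mK P C s k * (2 + mK P C s k) * blkK P N δ₁ Cst k * rowK P N δ₁ Cst k 2) * SR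

/-- the bound of TERM IV (`termIV_le`). [cite: Balaban1983Higgs3, (1.16) p.414] -/
def termIVBound (P : HiggsLattice.Params) (N : ℕ) (C : ChargeData N) (a δ₁ Cst s : ℝ) (k : ℕ) : ℝ :=
  mK P C s k * (2 + mK P C s k) * (((P.L : ℝ) ^ (k * P.d))⁻¹ * rowK P N δ₁ Cst k 2) *
    (|C.e| * s * ((P.d : ℝ) * rowK P N δ₁ Cst k 1) * rowK P N δ₁ Cst k 2
      + |C.e| * s * ((P.d : ℝ) * rowK P N δ₁ Cst k 2) * (rowK P N δ₁ Cst k 1 + |C.e| * s * rowK P N δ₁ Cst k 2)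
      + (|C.e| * s) ^ 2 * ((P.d : ℝ) * rowK P N δ₁ Cst k 2) * rowK P N δ₁ Cst k 2
      + a * (P.mesh k)⁻¹ ^ 2 * (mK P C s k * (2 + mK P C s k) * rowK P N δ₁ Cst k 2 * rowK P N δ₁ Cst k 2))

variable {C : ChargeData N} {A B : HiggsLattice.VecField P 0} {msq a : ℝ} {k K₀ : ℕ} {hL1 : 1 < P.L} {δ₁ Cst : ℝ}

/-- **THE KERNEL OF (1.16) AT `n = n′ = 1` ON THE TORUS IS UNIFORMLY BOUNDED** — the print's «uniformly bounded by
O(1)(e(L^kε)^{1−α})^{n+n′}» half of [B3] (1.16) p.414 for the VALUE of the kernel, first case `n = n′ = 1`, `Ω = T_ε`, `d ≤ 3`: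
for `m² > 0`, `a > 0`, `1 ≤ k ≤ K`, the (2.10) bounds of `G_k(T_ε,B)` and `G_k(T_ε,A+B)` with constants `(δ₁, C)` (`0 < δ₁ ≤ 1`,
e.g. from `B3Ineq210RegularTorus.ineq210_regularRegion_univ_small`), `A + B` (I.2.23)-regular with `d²ε|e|L^{2k}δ_{A+B} ≤ 1/3`,
`sup_b|A_b| ≤ s`, and every `x, x′ ∈ T_ε`, `i′`:
`‖(G_k(T,B)V_kG_k(T,A+B)V_kG_k(T,B) e_{(x′,i′)})(x)‖ ≤ |e|s·B_I + |e|s·B_II(1, ε^dC, d·rowK₁) + (|e|s)²·B_II(2, e·ε^dC, d·rowK₂) +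
a(L^kε)^{−2}·B_IV` with the explicit, `k`-UNIFORM term bounds `termIBound`, `termIIBound`, `termIVBound` of §18 (every summand is
`ε^d·t^m·(L^kε)^{2−d}·O(1)`, `t = L^kε|e|s`, `m ∈ {2,3,4}`, up to the displayed decay factors `≤ 1`): the sixteen source pairings of
`V_k(A,B) = −Σ_b[D^*M + M^*D + M^*M] − a_k(L^kε)^{−2}·avg` (THEOREM A of `B3Op116SourceForm`) — fifteen by three-kernel chains /
Schur sums, the sixteenth (`MD∘DM′`, logarithmic in sup norm) by the `L²` bound `sqrt_bondInner_DGDt_le`. The exponential decay in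
`|x − x′|` (the other half of the printed sentence) is the object of the next append (near/far split, `abs_bondInner_DGDt_le`).
[cite: Balaban1983Higgs3, (1.16) p.414, (2.10) p.426] [cite: Balaban1983RegularityDecay, Cor. 2.3 p.580] [cite: Balaban1982Higgs1, Prop. 2.1 (2.23)–(2.25) pp.610–611] -/
theorem kernel116_one_one_unif_le
    (hδ₁ : 0 < δ₁) (hδ₁1 : δ₁ ≤ 1) (hCst : 0 ≤ Cst)
    (h210B : (regRegionKernels hL1 C Finset.univ B msq a k K₀).Ineq210 δ₁ Cst)
    (h210AB : (regRegionKernels hL1 C Finset.univ (A + B) msq a k K₀).Ineq210 δ₁ Cst)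
    (hmsq : 0 < msq) (ha : 0 < a) (hk : 1 ≤ k) (hkK : k ≤ P.K) (hd3 : P.d ≤ 3) (i₀ : Ix N)
    {δX : ℝ} (hreg : ∀ (z : HiggsLattice.Site P 0) (μ ν : Fin P.d), |(A + B) ⟨z.shift ν, μ⟩ - (A + B) ⟨z, μ⟩| ≤ δX)
    (hsmall : (P.d : ℝ) ^ 2 * (P.mesh 0 * |C.e|) * ((P.L : ℝ) ^ k) ^ 2 * δX ≤ 1 / 3)
    {s : ℝ} (hs : 0 ≤ s) (hA : ∀ b : HiggsLattice.PBond P 0, |A b| ≤ s)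
    (x x' : HiggsLattice.Site P 0) (i' : Ix N) :
    ‖B3Eq116TwoSidedExpansion.op116 C Finset.univ A B msq a k 1 1 (cb P N 0 (x', i')) x‖
      ≤ |C.e| * s * termIBound P N C a δ₁ Cst s k x x'
        + |C.e| * s * termIIBound P N C a δ₁ Cst s k 1 (P.mesh 0 ^ P.d * Cst) ((P.d : ℝ) * rowK P N δ₁ Cst k 1) x x'
        + (|C.e| * s) ^ 2 * termIIBound P N C a δ₁ Cst s k 2 (Real.exp 1 * (P.mesh 0 ^ P.d * Cst)) ((P.d : ℝ) * rowK P N δ₁ Cst k 2) x x'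
        + a * (P.mesh k)⁻¹ ^ 2 * termIVBound P N C a δ₁ Cst s k := by
  have hL1' : (1 : ℝ) < (P.L : ℝ) := by exact_mod_cast hL1
  have hes : 0 ≤ |C.e| * s := mul_nonneg (abs_nonneg _) hs
  have hc : 0 ≤ P.mesh 0 ^ P.d * Cst := mul_nonneg (pow_nonneg (P.mesh_pos 0).le _) hCst
  rw [B3Op116SourceForm.op116_one_one_apply C Finset.univ A B msq a k]
  set w₁ := propagatorK C Finset.univ (A + B) msq a k
    (B3Op116SourceForm.srcV C A B k Finset.univ a (propagatorK C Finset.univ B msq a k (cb P N 0 (x', i')))) with hw₁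
  refine (outer_row_le C A B msq a k hA w₁ x).trans ?_
  simp only [Finset.sum_add_distrib]
  -- the four terms
  have hI := termI_le hδ₁ hδ₁1 hCst h210B h210AB hmsq ha hk hkK hd3 i₀ hs hA x x' i' hreg hsmall
  have hR1 : ∀ b : HiggsLattice.PBond P 0, col C msq a k B x b.tgt ≤ ∑ j ∈ Finset.range k,
      (Real.exp 1 * (P.mesh 0 ^ P.d * Cst)) * P.mesh j ^ ((2 : ℝ) - (P.d : ℝ)) *
        Real.exp (-(δ₁ * (P.mesh j)⁻¹ * (P.mesh 0 * (HiggsLattice.Site.tdist x b.src : ℝ)))) :=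
    fun b => row_col_majorant h210B hmsq ha hk hkK hδ₁ hδ₁1 hCst x b
  have hR2 : ∀ b : HiggsLattice.PBond P 0, dcol C msq a k B B b x ≤ ∑ j ∈ Finset.range k,
      (P.mesh 0 ^ P.d * Cst) * P.mesh j ^ ((1 : ℝ) - (P.d : ℝ)) *
        Real.exp (-(δ₁ * (P.mesh j)⁻¹ * (P.mesh 0 * (HiggsLattice.Site.tdist x b.src : ℝ)))) :=
    fun b => row_dcol_majorant h210B hmsq ha hk hkK x b
  have hR1sum : ∑ b : HiggsLattice.PBond P 0, col C msq a k B x b.tgt ≤ (P.d : ℝ) * rowK P N δ₁ Cst k 2 := by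
    rw [sum_bond_tgt_eq (fun y => col C msq a k B x y)]
    exact mul_le_mul_of_nonneg_left (sum_col_le h210B hmsq ha hk hkK hδ₁ hδ₁1 hCst i₀ x).1 (Nat.cast_nonneg _)
  have hR2sum : ∑ b : HiggsLattice.PBond P 0, dcol C msq a k B B b x ≤ (P.d : ℝ) * rowK P N δ₁ Cst k 1 :=
    (sum_dcol_le h210B hmsq ha hk hkK hδ₁ hδ₁1 hCst i₀).2 x
  have hII2 := termII_le hδ₁ hδ₁1 hCst h210B h210AB hmsq ha hk hkK hd3 i₀ hs hA x x' i' (by norm_num : (0 : ℝ) < 1) hc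
    (fun b => dcol C msq a k B B b x) (fun b => dcol_nonneg (C := C) (msq := msq) (a := a) (k := k) B B b x) hR2 hR2sum
  have hII1 := termII_le hδ₁ hδ₁1 hCst h210B h210AB hmsq ha hk hkK hd3 i₀ hs hA x x' i' (by norm_num : (0 : ℝ) < 2)
    (mul_nonneg (Real.exp_nonneg _) hc)
    (fun b => col C msq a k B x b.tgt) (fun b => col_nonneg (C := C) (msq := msq) (a := a) (k := k) B x b.tgt) hR1 hR1sum
  have hIV := termIV_le hδ₁ hδ₁1 hCst h210B h210AB hmsq ha hk hkK i₀ hs hA x x' i'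
  have hca : |B1.aSeq a P.L k| * (P.mesh k)⁻¹ ^ 2 ≤ a * (P.mesh k)⁻¹ ^ 2 := by
    rw [abs_of_pos (B1.aSeq_pos ha hL1' hk)]
    exact mul_le_mul_of_nonneg_right (B1.aSeq_le ha hL1' k hk) (by positivity)
  have hIV0 : 0 ≤ termIVBound P N C a δ₁ Cst s k := le_trans (norm_nonneg _) hIV
  refine add_le_add (add_le_add (add_le_add ?_ ?_) ?_) (mul_le_mul hca hIV (norm_nonneg _) (by positivity))
  · -- Σ_b |e|s ‖D w₁ b‖ κ_B(x,b₊) = |e|s Σ_b κ_B(x,b₊) ‖D w₁ b‖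
    have e : ∑ b : HiggsLattice.PBond P 0, |C.e| * s * ‖covDeriv C B w₁ b‖ * col C msq a k B x b.tgt
        = |C.e| * s * ∑ b : HiggsLattice.PBond P 0, col C msq a k B x b.tgt * ‖covDeriv C B w₁ b‖ := by
      rw [Finset.mul_sum]; exact Finset.sum_congr rfl fun b _ => by ring
    rw [e]
    exact mul_le_mul_of_nonneg_left hI hes
  · have e : ∑ b : HiggsLattice.PBond P 0, |C.e| * s * ‖w₁ b.tgt‖ * dcol C msq a k B B b x
        = |C.e| * s * ∑ b : HiggsLattice.PBond P 0, dcol C msq a k B B b x * ‖w₁ b.tgt‖ := by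
      rw [Finset.mul_sum]; exact Finset.sum_congr rfl fun b _ => by ring
    rw [e]
    exact mul_le_mul_of_nonneg_left hII2 hes
  · have e : ∑ b : HiggsLattice.PBond P 0, (|C.e| * s) ^ 2 * ‖w₁ b.tgt‖ * col C msq a k B x b.tgt
        = (|C.e| * s) ^ 2 * ∑ b : HiggsLattice.PBond P 0, col C msq a k B x b.tgt * ‖w₁ b.tgt‖ := by
      rw [Finset.mul_sum]; exact Finset.sum_congr rfl fun b _ => by ring
    rw [e]
    exact mul_le_mul_of_nonneg_left hII1 (sq_nonneg _)

end Uniform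


end Literature.MathematicalPhysics.QuantumFieldTheory.Balaban1983to89.B3Op116KernelRegularTorus

end
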